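import Mathlib.Analysis.SpecialFunctions.SmoothTransition
import Mathlib.Analysis.SpecialFunctions.Sqrt
import Mathlib.Analysis.Calculus.ContDiff.Deriv
import Mathlib.MeasureTheory.Integral.IntervalIntegral.FundThmCalculus
import Mathlib.MeasureTheory.Integral.IntervalIntegral.IntegrationByParts
import Literature.Analysis.FluidPDE.RadialCalculus
import Literature.Analysis.FluidPDE.NewtonPotentialHolder
import Literature.Analysis.FunctionSpaces.SobolevDomain
import Literature.Analysis.FluidPDE.SereginSverakPressureProofs
import Literature.Analysis.FluidPDE.PressureEquationSlicing
import HarnessLib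

/-!
# One-sided pressure bounds give scale-invariant (Type I) energy bounds

Analysis/FluidPDE proofs-layer file (everything PROVED; the only `def`s are explicit auxiliary
functions and constants) on the discharge path of the named fact
`Literature.Analysis.FluidPDE.seregin_sverak_2002` (`SereginSverakPressure.lean`; G. Seregin,
V. Šverák, *Navier–Stokes equations with lower bounds on the pressure*, Arch. Ration. Mech.
Anal. **163** (2002) 65–86, main theorem; equivalently, by
`seregin_sverak_2002_iff_pressureOneSidedBound`, of `SereginSverak2002_pressureOneSidedBound`).

## What is proved

For a classical solution `(u, p)` of the unforced Navier–Stokes system on `[0, T) × ℝ³` which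
is Leray–Hopf on `[0, T)`, under EITHER one-sided bound of the fact — `|u|²/2 + p̃ ≤ K` or
`p̃ ≥ -K` on `(0, T) × ℝ³`, `p̃ = normalisedPressure (u t)` — the local kinetic energy obeys the
scale-invariant bound

  `∫_{B(x₀, r)} |u(t, x)|² dx ≤ M r`  for a.e. `t ∈ (0, T)`, every `x₀ ∈ ℝ³`, every
  `0 < r ≤ 1/17`

(`ae_energy_ball_le`), with `M` depending only on `K` and the initial energy. In the language
of Caffarelli–Kohn–Nirenberg / Albritton–Barker this says `A(u; z, r) ≤ M` for all backward
parabolic balls `Q(z, r)`, `r ≤ 1/17`, inside `(0, T) × ℝ³`: the solution is Type I in the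
`A`-sense uniformly UP TO the final time. This is the first step towards the discharge of the fact
(the remaining steps being: bounded `A` ⇒ all scaled energies bounded, which is the tree's
`albrittonBarker2019_lemma_2_6_holds`, and the paper's blow-up/Liouville step at a singular
point of the final slice).

## The argument (self-contained; a fixed-time, elliptic estimate)

Fix a.e. `t` and write `v = u(t)`, `π = p̃(t)`. The only input from the equations is the
pressure Poisson equation on the slice, tested against test functions:
`∫ π Δθ = -∫ D²θ(v, v)` (the tree's `ae_forall_slice_pressure_identity`, through Tao's gauge
`exists_pressure_gauge_of_classical`, which also shows that `p̃(t) = p(t) - c(t)` is continuous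
for a.e. `t`). It is applied to the radial test functions `θₙ(y) = gₙ(|y - c|²)` with
`gₙ' (σ) = ℓ²/(2 √(σ+ε²) (σ+ℓ²)) · Γₙ(σ)`, `Γₙ` a cutoff at `σ ∼ n²`: a regularisation at scale
`ε` of `|y|` near the centre, glued to a Newtonian tail `-ℓ²/|y|`, for which

* `D²θₙ(v,v) = 2gₙ' |v_tan|² + (2gₙ' + 4σ gₙ'') |v_rad|²` with `2gₙ' ≥ 1/(2τ_ε)` on `B_ℓ` and
  `2gₙ' + 4σgₙ'' ≥ -1/ℓ - O(ℓ²/n³)` (`rad_testRate_ge`);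
* `Δθₙ ≥ -O(ℓ²/n³) 𝟙_{n ≤ |y| ≤ 2n}` and `∫ (Δθₙ)₊ ≤ (17/2)|B₁| ℓ²` uniformly in `ε ≤ ℓ` and `n`
  (`integral_posPart_laplacian_testFn_le`).

With `π ≥ -K` this gives `∫_{B_ℓ} |v_tan|²/(2τ_ε) ≤ K·O(ℓ²) + ℓ⁻¹∫|v|² + o(1)` as `n → ∞`
(`core_estimate_pressure`; the `o(1)` uses `π ∈ L^{3/2}`, Stein's bound of the tree), hence,
`ε := r` being free, `∫_{B_r} |v_tan|² ≤ C r (Kℓ² + ℓ⁻¹∫|v|²)` for all `r ≤ ℓ`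
(`tan_energy_ball_le`); with `|v|²/2 + π ≤ K` the same holds for the radial part
(`core_estimate_head`, `rad_energy_ball_le`). Tangential (resp. radial) parts with respect to
the three centres `x₀ - 8r eₖ` (resp. `x₀ - 16r eₖ`) recombine to the full energy on `B(x₀, r)`
(`sum_tan_ge`, `sum_rad_ge`), whence the bound at every centre (`energy_ball_le_pressure`,
`energy_ball_le_head`) and, slice by slice, `ae_energy_ball_le`.

The weight `|y - x₀|⁻¹` on balls of a FIXED radius is what makes one estimate serve all smaller
scales; it is the weight of hypothesis (1.2) of the paper as restated in Tran–Yu 2017, Thm. 1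
(`sup_{x₀} sup_t ∫_{B(x₀,r)} g |x - x₀|⁻¹ dx < ∞`), of which the constant majorant `g ≡ K` of the
fact is the special case treated here.

## Mathlib / tree search

Tree (used): `fderiv_fderiv_comp_norm_sq_apply`, `laplacian_comp_norm_sq` (`RadialCalculus`);
`hasCompactSupport_laplacian` (`LerayHopfMild`, via the imports);
`NewtonPotentialHolder.integral_ball_norm_rpow_neg`, `…_compl_…`, `integrableOn_…`
(`NewtonPotentialHolder`); `FunctionSpaces.IsTestFunctionOn` (`SobolevDomain`);
`SereginSverak2002.exists_pressure_gauge_of_classical`, `isSuitableWeakSolutionOn_gauge_of_classical`,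
`lintegral_slab_enorm_pow_three_lt_top`, `lintegral_normalisedPressure_rpow_le`, `eEnergy_le`,
`continuousOn_uncurry` (`SereginSverakPressureProofs`);
`IsDistributionalNSSolutionOn.ae_forall_slice_pressure_identity` (`PressureEquationSlicing`);
`restrict_prod_univ_eq` (`NSEssSupBound`); `deriv_smoothTransition_eq_zero` (`SlicedLocalEnergy`).
Mathlib: `Real.smoothTransition` (cutoffs), `intervalIntegral.integral_hasDerivAt_right` (the
profile as a primitive), `contDiffOn_infty_iff_deriv_of_isOpen`, `laplacian_eq_iteratedFDeriv_orthonormalBasis`,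
`LocallyIntegrable.integrable_smul_right_of_hasCompactSupport`, `integral_add_right_eq_self`,
`Measure.addHaar_ball_of_pos`, `lintegral_prod`, `ae_lt_top'`. Nothing on Seregin–Šverák 2002
itself beyond the two fact files and their proofs files.

## References

* G. Seregin, V. Šverák, Arch. Ration. Mech. Anal. 163 (2002) 65–86, main theorem and
  hypothesis (1.2). [SereginSverak2002]
* C. V. Tran, X. Yu, Appl. Math. Lett. 67 (2017) 21–27, Thm. 1 (restatement). [TranYu2017]
* D. Chae, Comm. PDE 37 (2012) = arXiv:1110.3631, Thm. 1.2 (the identity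
  `2∫_{|x|>R} p/|x| + ∫_{|x|=R} p = -∫_{|x|=R} |v_r|² - ∫_{|x|>R} |v_τ|²/|x|` behind the choice
  of the Newtonian tail).
* D. Albritton, T. Barker, J. Math. Fluid Mech. 21 (2019) = arXiv:1811.00502, §1 (the scaled
  energy `A`). [AlbrittonBarker2019]
-/

noncomputable section

open Set Filter Topology MeasureTheory
open scoped ContDiff

namespace Literature.Analysis.FluidPDE

namespace SereginSverak2002

/-! ### A bound for the derivative of `Real.smoothTransition` -/

/-- **A uniform bound for `(Real.smoothTransition)'`**: the derivative is continuous and vanishes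
off the compact interval `[0, 1]`. [folklore] -/
theorem exists_abs_deriv_smoothTransition_le :
    ∃ C : ℝ, 0 ≤ C ∧ ∀ x : ℝ, |deriv Real.smoothTransition x| ≤ C := by
  have hcont : Continuous (deriv Real.smoothTransition) :=
    (Real.smoothTransition.contDiff (n := 1)).continuous_deriv le_rfl
  obtain ⟨C, hC⟩ := isCompact_Icc.exists_bound_of_continuousOn (s := Icc (0 : ℝ) 1)
    hcont.continuousOn
  refine ⟨max C 0, le_max_right _ _, fun x => ?_⟩
  by_cases hx : x ∈ Icc (0 : ℝ) 1
  · exact (Real.norm_eq_abs _ ▸ hC x hx).trans (le_max_left _ _)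
  · rw [deriv_smoothTransition_eq_zero hx, abs_zero]
    exact le_max_right _ _

/-- The chosen bound `C_ST ≥ 0` of `|(Real.smoothTransition)'|`. [folklore] -/
def stDerivBound : ℝ := exists_abs_deriv_smoothTransition_le.choose

/-- Auxiliary lemma `stDerivBound_nonneg`. [folklore] -/
theorem stDerivBound_nonneg : 0 ≤ stDerivBound :=
  exists_abs_deriv_smoothTransition_le.choose_spec.1

/-- Auxiliary lemma `abs_deriv_smoothTransition_le`. [folklore] -/
theorem abs_deriv_smoothTransition_le (x : ℝ) :
    |deriv Real.smoothTransition x| ≤ stDerivBound :=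
  exists_abs_deriv_smoothTransition_le.choose_spec.2 x

/-! ### The far cutoff `Γₙ(σ) = 1 - ST((σ - n²)/(3n²))` -/

/-- The far cutoff in the variable `σ = |y|²`: `1` for `σ ≤ n²`, `0` for `σ ≥ 4n²`. [folklore] -/
def farCut (n σ : ℝ) : ℝ := 1 - Real.smoothTransition ((σ - n ^ 2) / (3 * n ^ 2))

/-- Its derivative. [folklore] -/
def farCutD (n σ : ℝ) : ℝ :=
  -(deriv Real.smoothTransition ((σ - n ^ 2) / (3 * n ^ 2)) * (1 / (3 * n ^ 2)))

/-- Auxiliary lemma `farCut_contDiff`. [folklore] -/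
theorem farCut_contDiff (n : ℝ) {m : ℕ∞} : ContDiff ℝ m (farCut n) := by
  unfold farCut
  exact contDiff_const.sub (Real.smoothTransition.contDiff.comp
    ((contDiff_id.sub contDiff_const).div_const _))

/-- Auxiliary lemma `farCut_eq_one`. [folklore] -/
theorem farCut_eq_one {n σ : ℝ} (h : σ ≤ n ^ 2) : farCut n σ = 1 := by
  unfold farCut
  rw [Real.smoothTransition.zero_of_nonpos, sub_zero]
  rcases eq_or_ne n 0 with rfl | hn
  · simp
  · exact div_nonpos_of_nonpos_of_nonneg (by linarith) (by positivity)

/-- Auxiliary lemma `farCut_eq_zero`. [folklore] -/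
theorem farCut_eq_zero {n σ : ℝ} (hn : n ≠ 0) (h : 4 * n ^ 2 ≤ σ) : farCut n σ = 0 := by
  unfold farCut
  rw [Real.smoothTransition.one_of_one_le, sub_self]
  have hn2 : 0 < 3 * n ^ 2 := by positivity
  rw [le_div_iff₀ hn2]
  linarith

/-- Auxiliary lemma `farCut_nonneg`. [folklore] -/
theorem farCut_nonneg (n σ : ℝ) : 0 ≤ farCut n σ := by
  unfold farCut
  linarith [Real.smoothTransition.le_one ((σ - n ^ 2) / (3 * n ^ 2))]

/-- Auxiliary lemma `farCut_le_one`. [folklore] -/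
theorem farCut_le_one (n σ : ℝ) : farCut n σ ≤ 1 := by
  unfold farCut
  linarith [Real.smoothTransition.nonneg ((σ - n ^ 2) / (3 * n ^ 2))]

/-- Auxiliary lemma `hasDerivAt_farCut`. [folklore] -/
theorem hasDerivAt_farCut (n σ : ℝ) : HasDerivAt (farCut n) (farCutD n σ) σ := by
  have h1 := ((hasDerivAt_id σ).sub_const (n ^ 2)).div_const (3 * n ^ 2)
  have h2 : HasDerivAt Real.smoothTransition
      (deriv Real.smoothTransition ((σ - n ^ 2) / (3 * n ^ 2))) ((id σ - n ^ 2) / (3 * n ^ 2)) :=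
    ((Real.smoothTransition.contDiff (n := 1)).differentiable one_ne_zero _).hasDerivAt
  exact (h2.comp σ h1).const_sub 1

/-- `Γₙ' ≤ 0` wherever `n ≠ 0` (the cutoff is decreasing in `σ`). [folklore] -/
theorem farCutD_nonpos {n : ℝ} (hn : n ≠ 0) (σ : ℝ) : farCutD n σ ≤ 0 := by
  unfold farCutD
  have hd : 0 ≤ deriv Real.smoothTransition ((σ - n ^ 2) / (3 * n ^ 2)) :=
    Real.smoothTransition.monotone.deriv_nonneg
  have hn2 : 0 < 1 / (3 * n ^ 2) := by positivity
  have := mul_nonneg hd hn2.le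
  linarith

/-- Auxiliary lemma `abs_farCutD_le`. [folklore] -/
theorem abs_farCutD_le {n : ℝ} (hn : n ≠ 0) (σ : ℝ) :
    |farCutD n σ| ≤ stDerivBound / (3 * n ^ 2) := by
  unfold farCutD
  have hn2 : 0 < 3 * n ^ 2 := by positivity
  rw [abs_neg, abs_mul, abs_of_pos (by positivity : (0 : ℝ) < 1 / (3 * n ^ 2)),
    ← div_eq_mul_one_div]
  exact div_le_div_of_nonneg_right (abs_deriv_smoothTransition_le _) hn2.le

/-- `Γₙ'` vanishes off the shell `n² ≤ σ ≤ 4n²`. [folklore] -/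
theorem farCutD_eq_zero {n σ : ℝ} (hn : n ≠ 0) (h : σ < n ^ 2 ∨ 4 * n ^ 2 < σ) :
    farCutD n σ = 0 := by
  unfold farCutD
  have hn2 : 0 < 3 * n ^ 2 := by positivity
  rw [deriv_smoothTransition_eq_zero, zero_mul, neg_zero]
  rw [mem_Icc, not_and_or, not_le, not_le]
  rcases h with h | h
  · left
    exact div_neg_of_neg_of_pos (by linarith) hn2
  · right
    rw [lt_div_iff₀ hn2]
    linarith

/-! ### The regularised radius `τ(σ) = √(σ + ε²)` and the profile rate `g'` -/

/-- `τ_ε(σ) = √(σ + ε²)` (so that `τ_ε(|y|²) = √(|y|² + ε²)`). [folklore] -/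
def regR (ε σ : ℝ) : ℝ := Real.sqrt (σ + ε ^ 2)

/-- The profile rate `g'(σ) = ℓ² / (2 τ_ε(σ) (σ + ℓ²))`. [folklore] -/
def profRate (ε ℓ σ : ℝ) : ℝ := ℓ ^ 2 / (2 * regR ε σ * (σ + ℓ ^ 2))

/-- Its derivative `g''(σ) = -g'(σ) (1/(2τ²) + 1/(σ+ℓ²))`. [folklore] -/
def profRateD (ε ℓ σ : ℝ) : ℝ :=
  -(profRate ε ℓ σ * (1 / (2 * regR ε σ ^ 2) + 1 / (σ + ℓ ^ 2)))

variable {ε ℓ n σ : ℝ}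

/-- Auxiliary lemma `regR_pos`. [folklore] -/
theorem regR_pos (hσ : -ε ^ 2 < σ) : 0 < regR ε σ :=
  Real.sqrt_pos.2 (by linarith)

/-- Auxiliary lemma `regR_nonneg`. [folklore] -/
theorem regR_nonneg (ε σ : ℝ) : 0 ≤ regR ε σ := Real.sqrt_nonneg _

/-- Auxiliary lemma `regR_sq`. [folklore] -/
theorem regR_sq (hσ : -ε ^ 2 < σ) : regR ε σ ^ 2 = σ + ε ^ 2 :=
  Real.sq_sqrt (by linarith)

/-- Auxiliary lemma `le_regR_of_sq_le`. [folklore] -/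
theorem le_regR_of_sq_le {a : ℝ} (ha : 0 ≤ a) (h : a ^ 2 ≤ σ + ε ^ 2) : a ≤ regR ε σ := by
  unfold regR
  rw [← Real.sqrt_sq ha]
  exact Real.sqrt_le_sqrt h

/-- Auxiliary lemma `regR_le_of_le_sq`. [folklore] -/
theorem regR_le_of_le_sq {a : ℝ} (h : σ + ε ^ 2 ≤ a ^ 2) (ha : 0 ≤ a) : regR ε σ ≤ a := by
  unfold regR
  rw [← Real.sqrt_sq ha]
  exact Real.sqrt_le_sqrt h

/-- `√σ ≤ τ(σ)`: in `3D`, `|y| ≤ τ_ε(|y|²)`. [folklore] -/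
theorem sqrt_le_regR : Real.sqrt σ ≤ regR ε σ :=
  Real.sqrt_le_sqrt (by nlinarith [sq_nonneg ε])

/-- `ε ≤ τ(σ)` for `σ ≥ 0`, `ε ≥ 0`. [folklore] -/
theorem eps_le_regR (hε : 0 ≤ ε) (hσ : 0 ≤ σ) : ε ≤ regR ε σ :=
  le_regR_of_sq_le hε (by linarith)

/-- Auxiliary lemma `hasDerivAt_regR`. [folklore] -/
theorem hasDerivAt_regR (hσ : -ε ^ 2 < σ) :
    HasDerivAt (regR ε) (1 / (2 * regR ε σ)) σ := by
  unfold regR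
  have h : HasDerivAt (fun σ : ℝ => σ + ε ^ 2) 1 σ := (hasDerivAt_id σ).add_const _
  have hne : σ + ε ^ 2 ≠ 0 := by linarith
  simpa using h.sqrt hne

/-- Auxiliary lemma `profRate_pos`. [folklore] -/
theorem profRate_pos (hℓ : 0 < ℓ) (hσ : -ε ^ 2 < σ) (hσ' : -ℓ ^ 2 < σ) : 0 < profRate ε ℓ σ := by
  unfold profRate
  have h1 := regR_pos hσ
  have h2 : 0 < σ + ℓ ^ 2 := by linarith
  positivity

/-- Auxiliary lemma `profRate_nonneg`. [folklore] -/
theorem profRate_nonneg (hℓ : 0 < ℓ) (hσ : -ε ^ 2 < σ) (hσ' : -ℓ ^ 2 < σ) : 0 ≤ profRate ε ℓ σ :=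
  (profRate_pos hℓ hσ hσ').le

/-- Auxiliary lemma `hasDerivAt_profRate`. [folklore] -/
theorem hasDerivAt_profRate (hℓ : 0 < ℓ) (hσ : -ε ^ 2 < σ) (hσ' : -ℓ ^ 2 < σ) :
    HasDerivAt (profRate ε ℓ) (profRateD ε ℓ σ) σ := by
  have hτ := regR_pos hσ
  have h2 : 0 < σ + ℓ ^ 2 := by linarith
  have hτ' := hτ.ne'
  have h2' := h2.ne'
  have hinv1 := (hasDerivAt_regR hσ).inv hτ'
  have hinv2 := ((hasDerivAt_id σ).add_const (ℓ ^ 2)).inv (by simpa using h2')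
  have hprod := (hinv1.mul hinv2).const_mul (ℓ ^ 2 / 2)
  simp only [Pi.inv_apply, Pi.mul_apply, id_eq] at hprod
  have hfun : profRate ε ℓ = fun y => ℓ ^ 2 / 2 * ((regR ε y)⁻¹ * (y + ℓ ^ 2)⁻¹) := by
    funext y
    simp only [profRate]
    rw [div_eq_mul_inv, mul_inv, mul_inv]
    ring
  rw [hfun]
  refine hprod.congr_deriv ?_
  unfold profRateD profRate
  field_simp
  ring

/-! ### The cut-off rate `g'ₙ = g' Γₙ`, its derivative, and the profile `gₙ = ∫₀ g'ₙ` -/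

/-- `g'ₙ(σ) = g'(σ) Γₙ(σ)`. [folklore] -/
def testRate (ε ℓ n σ : ℝ) : ℝ := profRate ε ℓ σ * farCut n σ

/-- `g''ₙ = g'' Γₙ + g' Γₙ'`. [folklore] -/
def testRateD (ε ℓ n σ : ℝ) : ℝ := profRateD ε ℓ σ * farCut n σ + profRate ε ℓ σ * farCutD n σ

/-- The profile `gₙ(σ) = ∫₀^σ g'ₙ`. [folklore] -/
def testProf (ε ℓ n σ : ℝ) : ℝ := ∫ s in (0 : ℝ)..σ, testRate ε ℓ n s

/-- Auxiliary lemma `hasDerivAt_testRate`. [folklore] -/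
theorem hasDerivAt_testRate (hℓ : 0 < ℓ) (hσ : -ε ^ 2 < σ) (hσ' : -ℓ ^ 2 < σ) :
    HasDerivAt (testRate ε ℓ n) (testRateD ε ℓ n σ) σ := by
  unfold testRate testRateD
  exact (hasDerivAt_profRate hℓ hσ hσ').mul (hasDerivAt_farCut n σ)

/-- Auxiliary lemma `testRate_nonneg`. [folklore] -/
theorem testRate_nonneg (hℓ : 0 < ℓ) (hσ : -ε ^ 2 < σ) (hσ' : -ℓ ^ 2 < σ) :
    0 ≤ testRate ε ℓ n σ :=
  mul_nonneg (profRate_nonneg hℓ hσ hσ') (farCut_nonneg n σ)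

/-- Auxiliary lemma `testRate_le_profRate`. [folklore] -/
theorem testRate_le_profRate (hℓ : 0 < ℓ) (hσ : -ε ^ 2 < σ) (hσ' : -ℓ ^ 2 < σ) :
    testRate ε ℓ n σ ≤ profRate ε ℓ σ :=
  mul_le_of_le_one_right (profRate_nonneg hℓ hσ hσ') (farCut_le_one n σ)

/-- Auxiliary lemma `testRate_eq_profRate`. [folklore] -/
theorem testRate_eq_profRate (h : σ ≤ n ^ 2) : testRate ε ℓ n σ = profRate ε ℓ σ := by
  unfold testRate
  rw [farCut_eq_one h, mul_one]

/-- Auxiliary lemma `testRate_eq_zero`. [folklore] -/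
theorem testRate_eq_zero (hn : n ≠ 0) (h : 4 * n ^ 2 ≤ σ) : testRate ε ℓ n σ = 0 := by
  unfold testRate
  rw [farCut_eq_zero hn h, mul_zero]

/-- Continuity of `g'ₙ` on `(-ε², ∞)` (for `ε ≤ ℓ`). [folklore] -/
theorem continuousOn_testRate (hℓ : 0 < ℓ) (hεℓ : ε ^ 2 ≤ ℓ ^ 2) :
    ContinuousOn (testRate ε ℓ n) (Ioi (-ε ^ 2)) := fun σ hσ =>
  (hasDerivAt_testRate hℓ hσ (by simp only [mem_Ioi] at hσ; linarith)).continuousAt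
    |>.continuousWithinAt

/-- Auxiliary lemma `intervalIntegrable_testRate`. [folklore] -/
theorem intervalIntegrable_testRate (hℓ : 0 < ℓ) (hεℓ : ε ^ 2 ≤ ℓ ^ 2) {a b : ℝ}
    (ha : -ε ^ 2 < a) (hb : -ε ^ 2 < b) :
    IntervalIntegrable (testRate ε ℓ n) volume a b := by
  refine ContinuousOn.intervalIntegrable ((continuousOn_testRate (n := n) hℓ hεℓ).mono ?_)
  intro x hx
  simp only [mem_Ioi]
  rcases le_total a b with hab | hab
  · rw [uIcc_of_le hab] at hx
    exact lt_of_lt_of_le ha hx.1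
  · rw [uIcc_of_ge hab] at hx
    exact lt_of_lt_of_le hb hx.1

/-- **FTC**: `gₙ' = g'ₙ` on `(-ε², ∞)`. [folklore] -/
theorem hasDerivAt_testProf (hε : 0 < ε) (hℓ : 0 < ℓ) (hεℓ : ε ^ 2 ≤ ℓ ^ 2) (hσ : -ε ^ 2 < σ) :
    HasDerivAt (testProf ε ℓ n) (testRate ε ℓ n σ) σ := by
  unfold testProf
  have h0 : -ε ^ 2 < (0 : ℝ) := by nlinarith
  have hcont : ContinuousAt (testRate ε ℓ n) σ :=
    (continuousOn_testRate hℓ hεℓ).continuousAt (Ioi_mem_nhds hσ)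
  refine intervalIntegral.integral_hasDerivAt_right (intervalIntegrable_testRate hℓ hεℓ h0 hσ) ?_ hcont
  exact ((continuousOn_testRate hℓ hεℓ).stronglyMeasurableAtFilter isOpen_Ioi _ hσ)

/-- Auxiliary lemma `testProf_zero`. [folklore] -/
theorem testProf_zero : testProf ε ℓ n 0 = 0 :=
  intervalIntegral.integral_same

/-- `gₙ` is constant beyond `σ = 4n²`. [folklore] -/
theorem testProf_eq_of_le (hε : 0 < ε) (hℓ : 0 < ℓ) (hεℓ : ε ^ 2 ≤ ℓ ^ 2) (hn : n ≠ 0)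
    (h : 4 * n ^ 2 ≤ σ) : testProf ε ℓ n σ = testProf ε ℓ n (4 * n ^ 2) := by
  unfold testProf
  have h0 : -ε ^ 2 < (0 : ℝ) := by nlinarith
  have h4 : -ε ^ 2 < 4 * n ^ 2 := by nlinarith [sq_nonneg n]
  have hσ : -ε ^ 2 < σ := lt_of_lt_of_le h4 h
  rw [← intervalIntegral.integral_add_adjacent_intervals (intervalIntegrable_testRate hℓ hεℓ h0 h4)
    (intervalIntegrable_testRate hℓ hεℓ h4 hσ)]
  have hz : ∫ s in (4 * n ^ 2)..σ, testRate ε ℓ n s = 0 := by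
    refine intervalIntegral.integral_zero_ae (Eventually.of_forall fun s hs => ?_)
    rw [uIoc_of_le h] at hs
    exact testRate_eq_zero hn hs.1.le
  rw [hz, add_zero]

/-- Smoothness of `g'ₙ` on `(-ε², ∞)`. [folklore] -/
theorem contDiffOn_testRate (hεℓ : ε ^ 2 ≤ ℓ ^ 2) {m : ℕ∞} :
    ContDiffOn ℝ m (testRate ε ℓ n) (Ioi (-ε ^ 2)) := by
  have hreg : ContDiffOn ℝ m (regR ε) (Ioi (-ε ^ 2)) := by
    intro σ hσ
    simp only [mem_Ioi] at hσ
    unfold regR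
    refine (ContDiffAt.sqrt (contDiffAt_id.add contDiffAt_const) ?_).contDiffWithinAt
    simp only [id_eq]
    linarith
  have hprof : ContDiffOn ℝ m (profRate ε ℓ) (Ioi (-ε ^ 2)) := by
    unfold profRate
    refine contDiffOn_const.div ((contDiffOn_const.mul hreg).mul
      (contDiffOn_id.add contDiffOn_const)) fun σ hσ => ?_
    simp only [mem_Ioi] at hσ
    have h1 := regR_pos hσ
    have h2 : 0 < σ + ℓ ^ 2 := by linarith
    exact (mul_pos (mul_pos two_pos h1) h2).ne'
  unfold testRate
  exact hprof.mul (farCut_contDiff n).contDiffOn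

/-- **Smoothness of the profile** on `(-ε², ∞)`. [folklore] -/
theorem contDiffOn_testProf (hε : 0 < ε) (hℓ : 0 < ℓ) (hεℓ : ε ^ 2 ≤ ℓ ^ 2) :
    ContDiffOn ℝ ∞ (testProf ε ℓ n) (Ioi (-ε ^ 2)) := by
  rw [contDiffOn_infty_iff_deriv_of_isOpen isOpen_Ioi]
  refine ⟨fun σ hσ => (hasDerivAt_testProf hε hℓ hεℓ hσ).differentiableAt.differentiableWithinAt,
    ?_⟩
  refine (contDiffOn_testRate (n := n) hεℓ).congr fun σ hσ => ?_
  exact (hasDerivAt_testProf hε hℓ hεℓ hσ).deriv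

/-- Measurability of `g'`, `g''`, `g'ₙ`, `g''ₙ` (as functions on `ℝ`, junk values included).
[folklore] -/
theorem measurable_profRate : Measurable (profRate ε ℓ) := by
  unfold profRate regR
  exact measurable_const.div ((measurable_const.mul
    (Real.continuous_sqrt.measurable.comp (measurable_id.add measurable_const))).mul
    (measurable_id.add measurable_const))

/-- Auxiliary lemma `measurable_profRateD`. [folklore] -/
theorem measurable_profRateD : Measurable (profRateD ε ℓ) := by
  unfold profRateD
  have hreg : Measurable (regR ε) := by
    unfold regR
    exact Real.continuous_sqrt.measurable.comp (measurable_id.add measurable_const)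
  exact (measurable_profRate.mul ((measurable_const.div ((hreg.pow_const 2).const_mul 2)).add
    (measurable_const.div (measurable_id.add measurable_const)))).neg

/-- Auxiliary lemma `continuous_farCutD`. [folklore] -/
theorem continuous_farCutD : Continuous (farCutD n) := by
  unfold farCutD
  have hd : Continuous (deriv Real.smoothTransition) :=
    (Real.smoothTransition.contDiff (n := 1)).continuous_deriv le_rfl
  exact ((hd.comp ((continuous_id.sub continuous_const).div_const _)).mul continuous_const).neg

/-- Auxiliary lemma `measurable_testRate`. [folklore] -/
theorem measurable_testRate : Measurable (testRate ε ℓ n) :=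
  measurable_profRate.mul (farCut_contDiff n (m := 0)).continuous.measurable

/-- Auxiliary lemma `measurable_testRateD`. [folklore] -/
theorem measurable_testRateD : Measurable (testRateD ε ℓ n) :=
  (measurable_profRateD.mul (farCut_contDiff n (m := 0)).continuous.measurable).add
    (measurable_profRate.mul continuous_farCutD.measurable)

/-! ### Pointwise facts about the rates (`σ ≥ 0`, `0 < ε ≤ ℓ ≤ n`) -/

section Pointwise

variable (hε : 0 < ε) (hℓ : 0 < ℓ) (hσ : 0 ≤ σ)
include hε hℓ hσ

omit hℓ in
/-- Auxiliary lemma `neg_eps_sq_lt`. [folklore] -/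
theorem neg_eps_sq_lt : -ε ^ 2 < σ := by nlinarith

omit hε in
/-- Auxiliary lemma `neg_ell_sq_lt`. [folklore] -/
theorem neg_ell_sq_lt : -ℓ ^ 2 < σ := by nlinarith

/-- On the core `σ ≤ ℓ² ≤ n²`: `2 g'ₙ(σ) ≥ 1/(2τ)`. [folklore] -/
theorem inv_two_regR_le (hσℓ : σ ≤ ℓ ^ 2) (hℓn : ℓ ≤ n) :
    1 / (2 * regR ε σ) ≤ 2 * testRate ε ℓ n σ := by
  have hσn : σ ≤ n ^ 2 := hσℓ.trans (pow_le_pow_left₀ hℓ.le hℓn 2)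
  rw [testRate_eq_profRate hσn]
  unfold profRate
  have hτ := regR_pos (neg_eps_sq_lt hε hσ)
  have h2 : 0 < σ + ℓ ^ 2 := by positivity
  rw [show 2 * (ℓ ^ 2 / (2 * regR ε σ * (σ + ℓ ^ 2))) = (ℓ ^ 2 / (σ + ℓ ^ 2)) * (1 / regR ε σ) by
    field_simp]
  rw [show 1 / (2 * regR ε σ) = (1 / 2) * (1 / regR ε σ) by field_simp]
  refine mul_le_mul_of_nonneg_right ?_ (by positivity)
  rw [div_le_div_iff₀ two_pos h2]
  nlinarith

/-- The explicit form of the Laplacian profile before the cutoff: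
`6g' + 4σ g'' = ℓ²ε²/(τ³(σ+ℓ²)) + 2ℓ⁴/(τ(σ+ℓ²)²)`. [folklore] -/
theorem lap_profRate_eq :
    6 * profRate ε ℓ σ + 4 * σ * profRateD ε ℓ σ =
      ℓ ^ 2 * ε ^ 2 / (regR ε σ ^ 3 * (σ + ℓ ^ 2)) + 2 * ℓ ^ 4 / (regR ε σ * (σ + ℓ ^ 2) ^ 2) := by
  have hτ := regR_pos (neg_eps_sq_lt hε hσ)
  have hτ2 := regR_sq (neg_eps_sq_lt hε hσ)
  have h2 : 0 < σ + ℓ ^ 2 := by positivity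
  unfold profRateD profRate
  field_simp
  nlinarith [hτ2]

/-- The explicit form of the radial coefficient before the cutoff:
`2g' + 4σ g'' = ℓ²ε²/(τ³(σ+ℓ²)) - 2ℓ²σ/(τ(σ+ℓ²)²)`. [folklore] -/
theorem rad_profRate_eq :
    2 * profRate ε ℓ σ + 4 * σ * profRateD ε ℓ σ =
      ℓ ^ 2 * ε ^ 2 / (regR ε σ ^ 3 * (σ + ℓ ^ 2)) - 2 * ℓ ^ 2 * σ / (regR ε σ * (σ + ℓ ^ 2) ^ 2) := by
  have hτ := regR_pos (neg_eps_sq_lt hε hσ)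
  have hτ2 := regR_sq (neg_eps_sq_lt hε hσ)
  have h2 : 0 < σ + ℓ ^ 2 := by positivity
  unfold profRateD profRate
  field_simp
  nlinarith [hτ2]

/-- `2ℓ²σ/(τ(σ+ℓ²)²) ≤ 1/ℓ` (AM–GM: `τ(σ+ℓ²) ≥ √σ · 2ℓ√σ`). [folklore] -/
theorem rad_error_le : 2 * ℓ ^ 2 * σ / (regR ε σ * (σ + ℓ ^ 2) ^ 2) ≤ 1 / ℓ := by
  have hτ := regR_pos (neg_eps_sq_lt hε hσ)
  have h2 : 0 < σ + ℓ ^ 2 := by positivity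
  rw [div_le_div_iff₀ (by positivity) hℓ, one_mul]
  -- `2ℓ³σ ≤ τ (σ+ℓ²)²`, from `√σ ≤ τ` and `2ℓ√σ ≤ σ + ℓ²`
  have hs : Real.sqrt σ ≤ regR ε σ := sqrt_le_regR
  have hs0 : 0 ≤ Real.sqrt σ := Real.sqrt_nonneg σ
  have hsσ : Real.sqrt σ ^ 2 = σ := Real.sq_sqrt hσ
  have hamgm : 2 * ℓ * Real.sqrt σ ≤ σ + ℓ ^ 2 := by nlinarith [sq_nonneg (Real.sqrt σ - ℓ)]
  calc 2 * ℓ ^ 2 * σ * ℓ = ℓ ^ 2 * (Real.sqrt σ * (2 * ℓ * Real.sqrt σ)) := by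
        rw [show Real.sqrt σ * (2 * ℓ * Real.sqrt σ) = 2 * ℓ * Real.sqrt σ ^ 2 by ring, hsσ]; ring
    _ ≤ ℓ ^ 2 * (regR ε σ * (σ + ℓ ^ 2)) := by
        refine mul_le_mul_of_nonneg_left ?_ (by positivity)
        exact mul_le_mul hs hamgm (by positivity) hτ.le
    _ ≤ regR ε σ * (σ + ℓ ^ 2) ^ 2 := by
        rw [show regR ε σ * (σ + ℓ ^ 2) ^ 2 = (σ + ℓ ^ 2) * (regR ε σ * (σ + ℓ ^ 2)) by ring]
        refine mul_le_mul_of_nonneg_right (by nlinarith) (by positivity)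

/-- The first Laplacian term is at most `ℓ²ε²/τ⁵` (uses `ε ≤ ℓ`). [folklore] -/
theorem lap_term₁_le (hεℓ : ε ≤ ℓ) :
    ℓ ^ 2 * ε ^ 2 / (regR ε σ ^ 3 * (σ + ℓ ^ 2)) ≤ ℓ ^ 2 * ε ^ 2 / regR ε σ ^ 5 := by
  have hτ := regR_pos (neg_eps_sq_lt hε hσ)
  have hτ2 := regR_sq (neg_eps_sq_lt hε hσ)
  have h2 : 0 < σ + ℓ ^ 2 := by positivity
  refine div_le_div_of_nonneg_left (by positivity) (by positivity) ?_
  rw [show regR ε σ ^ 5 = regR ε σ ^ 3 * regR ε σ ^ 2 by ring, hτ2]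
  refine mul_le_mul_of_nonneg_left ?_ (by positivity)
  nlinarith

/-- The shell term of the cutoff: `|4σ g' Γₙ'| ≤ (2 C_ST / 3) ℓ² / n³`, and it vanishes off
`n² ≤ σ ≤ 4 n²`. [folklore] -/
theorem abs_shell_le (hn : 0 < n) :
    |4 * σ * profRate ε ℓ σ * farCutD n σ| ≤ 2 * stDerivBound / 3 * ℓ ^ 2 / n ^ 3 := by
  have hτ := regR_pos (neg_eps_sq_lt hε hσ)
  have h2 : 0 < σ + ℓ ^ 2 := by positivity
  have hC := stDerivBound_nonneg
  by_cases hs : σ < n ^ 2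
  · rw [farCutD_eq_zero hn.ne' (Or.inl hs), mul_zero, abs_zero]
    positivity
  · push Not at hs
    -- here `τ ≥ n`
    have hτn : n ≤ regR ε σ := le_regR_of_sq_le hn.le (by nlinarith)
    have hg : 4 * σ * profRate ε ℓ σ ≤ 2 * ℓ ^ 2 / n := by
      unfold profRate
      rw [show 4 * σ * (ℓ ^ 2 / (2 * regR ε σ * (σ + ℓ ^ 2))) =
        2 * ℓ ^ 2 * σ / (regR ε σ * (σ + ℓ ^ 2)) by field_simp; ring]
      rw [div_le_div_iff₀ (by positivity) hn]
      have : σ * n ≤ regR ε σ * (σ + ℓ ^ 2) := by nlinarith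
      nlinarith
    have hg0 : 0 ≤ 4 * σ * profRate ε ℓ σ := by
      have := profRate_nonneg hℓ (neg_eps_sq_lt hε hσ) (neg_ell_sq_lt hℓ hσ) (ε := ε)
      positivity
    rw [abs_mul, abs_of_nonneg hg0]
    calc 4 * σ * profRate ε ℓ σ * |farCutD n σ|
        ≤ 2 * ℓ ^ 2 / n * (stDerivBound / (3 * n ^ 2)) :=
          mul_le_mul hg (abs_farCutD_le hn.ne' σ) (abs_nonneg _) (by positivity)
      _ = 2 * stDerivBound / 3 * ℓ ^ 2 / n ^ 3 := by field_simp

/-- **Lower bound for the Laplacian profile**: `6 g'ₙ + 4σ g''ₙ ≥ -(2C_ST/3) ℓ²/n³`, and in fact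
`≥ 0` off the shell `n² ≤ σ ≤ 4n²`. [folklore] -/
theorem lap_testRate_ge (hn : 0 < n) :
    -(2 * stDerivBound / 3 * ℓ ^ 2 / n ^ 3) ≤
      6 * testRate ε ℓ n σ + 4 * σ * testRateD ε ℓ n σ := by
  have hτ := regR_pos (neg_eps_sq_lt hε hσ)
  have h2 : 0 < σ + ℓ ^ 2 := by positivity
  have key : 6 * testRate ε ℓ n σ + 4 * σ * testRateD ε ℓ n σ =
      (6 * profRate ε ℓ σ + 4 * σ * profRateD ε ℓ σ) * farCut n σ +
        4 * σ * profRate ε ℓ σ * farCutD n σ := by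
    unfold testRate testRateD; ring
  rw [key, lap_profRate_eq hε hℓ hσ]
  have hA : 0 ≤ (ℓ ^ 2 * ε ^ 2 / (regR ε σ ^ 3 * (σ + ℓ ^ 2)) +
      2 * ℓ ^ 4 / (regR ε σ * (σ + ℓ ^ 2) ^ 2)) * farCut n σ :=
    mul_nonneg (by positivity) (farCut_nonneg n σ)
  have hB := abs_shell_le hε hℓ hσ hn
  have hB' := neg_abs_le (4 * σ * profRate ε ℓ σ * farCutD n σ)
  linarith

/-- Auxiliary lemma `lap_testRate_nonneg_of`. [folklore] -/
theorem lap_testRate_nonneg_of (hn : 0 < n) (h : σ < n ^ 2 ∨ 4 * n ^ 2 < σ) :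
    0 ≤ 6 * testRate ε ℓ n σ + 4 * σ * testRateD ε ℓ n σ := by
  have hτ := regR_pos (neg_eps_sq_lt hε hσ)
  have h2 : 0 < σ + ℓ ^ 2 := by positivity
  have key : 6 * testRate ε ℓ n σ + 4 * σ * testRateD ε ℓ n σ =
      (6 * profRate ε ℓ σ + 4 * σ * profRateD ε ℓ σ) * farCut n σ +
        4 * σ * profRate ε ℓ σ * farCutD n σ := by
    unfold testRate testRateD; ring
  rw [key, lap_profRate_eq hε hℓ hσ, farCutD_eq_zero hn.ne' h, mul_zero, add_zero]
  exact mul_nonneg (by positivity) (farCut_nonneg n σ)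

/-- **Upper bound for the Laplacian profile**:
`6 g'ₙ + 4σ g''ₙ ≤ ℓ²ε²/τ⁵ + 2ℓ⁴/(τ(σ+ℓ²)²)`. [folklore] -/
theorem lap_testRate_le (hεℓ : ε ≤ ℓ) (hn : 0 < n) :
    6 * testRate ε ℓ n σ + 4 * σ * testRateD ε ℓ n σ ≤
      ℓ ^ 2 * ε ^ 2 / regR ε σ ^ 5 + 2 * ℓ ^ 4 / (regR ε σ * (σ + ℓ ^ 2) ^ 2) := by
  have hτ := regR_pos (neg_eps_sq_lt hε hσ)
  have h2 : 0 < σ + ℓ ^ 2 := by positivity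
  have key : 6 * testRate ε ℓ n σ + 4 * σ * testRateD ε ℓ n σ =
      (6 * profRate ε ℓ σ + 4 * σ * profRateD ε ℓ σ) * farCut n σ +
        4 * σ * profRate ε ℓ σ * farCutD n σ := by
    unfold testRate testRateD; ring
  rw [key, lap_profRate_eq hε hℓ hσ]
  have hpos : 0 ≤ ℓ ^ 2 * ε ^ 2 / (regR ε σ ^ 3 * (σ + ℓ ^ 2)) +
      2 * ℓ ^ 4 / (regR ε σ * (σ + ℓ ^ 2) ^ 2) := by positivity
  have h1 : (ℓ ^ 2 * ε ^ 2 / (regR ε σ ^ 3 * (σ + ℓ ^ 2)) +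
      2 * ℓ ^ 4 / (regR ε σ * (σ + ℓ ^ 2) ^ 2)) * farCut n σ ≤
      ℓ ^ 2 * ε ^ 2 / (regR ε σ ^ 3 * (σ + ℓ ^ 2)) + 2 * ℓ ^ 4 / (regR ε σ * (σ + ℓ ^ 2) ^ 2) :=
    mul_le_of_le_one_right hpos (farCut_le_one n σ)
  have h3 : 4 * σ * profRate ε ℓ σ * farCutD n σ ≤ 0 := by
    have := profRate_nonneg hℓ (neg_eps_sq_lt hε hσ) (neg_ell_sq_lt hℓ hσ) (ε := ε)
    have := farCutD_nonpos hn.ne' σ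
    have : 0 ≤ 4 * σ * profRate ε ℓ σ := by positivity
    nlinarith
  have h4 := lap_term₁_le hε hℓ hσ hεℓ
  linarith

/-- **Lower bound for the radial coefficient**: `2 g'ₙ + 4σ g''ₙ ≥ -1/ℓ - (2C_ST/3) ℓ²/n³`.
[folklore] -/
theorem rad_testRate_ge (hn : 0 < n) :
    -(1 / ℓ) - 2 * stDerivBound / 3 * ℓ ^ 2 / n ^ 3 ≤
      2 * testRate ε ℓ n σ + 4 * σ * testRateD ε ℓ n σ := by
  have hτ := regR_pos (neg_eps_sq_lt hε hσ)
  have h2 : 0 < σ + ℓ ^ 2 := by positivity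
  have key : 2 * testRate ε ℓ n σ + 4 * σ * testRateD ε ℓ n σ =
      (2 * profRate ε ℓ σ + 4 * σ * profRateD ε ℓ σ) * farCut n σ +
        4 * σ * profRate ε ℓ σ * farCutD n σ := by
    unfold testRate testRateD; ring
  rw [key, rad_profRate_eq hε hℓ hσ]
  have hΓ0 := farCut_nonneg n σ
  have hΓ1 := farCut_le_one n σ
  have hE := rad_error_le hε hℓ hσ
  have hP : 0 ≤ ℓ ^ 2 * ε ^ 2 / (regR ε σ ^ 3 * (σ + ℓ ^ 2)) := by positivity
  have hQ : 0 ≤ 2 * ℓ ^ 2 * σ / (regR ε σ * (σ + ℓ ^ 2) ^ 2) := by positivity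
  -- `(P - Q) Γ ≥ -Q Γ ≥ -Q ≥ -1/ℓ`
  have h1 : -(1 / ℓ) ≤ (ℓ ^ 2 * ε ^ 2 / (regR ε σ ^ 3 * (σ + ℓ ^ 2)) -
      2 * ℓ ^ 2 * σ / (regR ε σ * (σ + ℓ ^ 2) ^ 2)) * farCut n σ := by nlinarith
  have hB := abs_shell_le hε hℓ hσ hn
  have hB' := neg_abs_le (4 * σ * profRate ε ℓ σ * farCutD n σ)
  linarith

/-- **Upper bound for the radial coefficient**: `2 g'ₙ + 4σ g''ₙ ≤ 1/ε + (2C_ST/3) ℓ²/n³`.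
[folklore] -/
theorem rad_testRate_le (hn : 0 < n) :
    2 * testRate ε ℓ n σ + 4 * σ * testRateD ε ℓ n σ ≤
      1 / ε + 2 * stDerivBound / 3 * ℓ ^ 2 / n ^ 3 := by
  have hτ := regR_pos (neg_eps_sq_lt hε hσ)
  have hτε : ε ≤ regR ε σ := eps_le_regR hε.le hσ
  have h2 : 0 < σ + ℓ ^ 2 := by positivity
  have key : 2 * testRate ε ℓ n σ + 4 * σ * testRateD ε ℓ n σ =
      (2 * profRate ε ℓ σ + 4 * σ * profRateD ε ℓ σ) * farCut n σ +
        4 * σ * profRate ε ℓ σ * farCutD n σ := by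
    unfold testRate testRateD; ring
  rw [key, rad_profRate_eq hε hℓ hσ]
  have hΓ0 := farCut_nonneg n σ
  have hΓ1 := farCut_le_one n σ
  have hP : 0 ≤ ℓ ^ 2 * ε ^ 2 / (regR ε σ ^ 3 * (σ + ℓ ^ 2)) := by positivity
  have hQ : 0 ≤ 2 * ℓ ^ 2 * σ / (regR ε σ * (σ + ℓ ^ 2) ^ 2) := by positivity
  have hP1 : ℓ ^ 2 * ε ^ 2 / (regR ε σ ^ 3 * (σ + ℓ ^ 2)) ≤ 1 / ε := by
    rw [div_le_div_iff₀ (by positivity) hε, one_mul]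
    have h3 : ε ^ 3 ≤ regR ε σ ^ 3 := pow_le_pow_left₀ hε.le hτε 3
    have h4 : ℓ ^ 2 ≤ σ + ℓ ^ 2 := by linarith
    calc ℓ ^ 2 * ε ^ 2 * ε = ε ^ 3 * ℓ ^ 2 := by ring
      _ ≤ regR ε σ ^ 3 * (σ + ℓ ^ 2) := mul_le_mul h3 h4 (by positivity) (by positivity)
  have h1 : (ℓ ^ 2 * ε ^ 2 / (regR ε σ ^ 3 * (σ + ℓ ^ 2)) -
      2 * ℓ ^ 2 * σ / (regR ε σ * (σ + ℓ ^ 2) ^ 2)) * farCut n σ ≤ 1 / ε := by nlinarith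
  have hB := abs_shell_le hε hℓ hσ hn
  have hB' := le_abs_self (4 * σ * profRate ε ℓ σ * farCutD n σ)
  linarith

/-- For the head case: `g'ₙ - 2σ g''ₙ ≥ g'ₙ - (C_ST/3) ℓ²/n³` (since `g'' ≤ 0`). [folklore] -/
theorem testRate_sub_ge (hn : 0 < n) :
    testRate ε ℓ n σ - stDerivBound / 3 * ℓ ^ 2 / n ^ 3 ≤
      testRate ε ℓ n σ - 2 * σ * testRateD ε ℓ n σ := by
  have hτ := regR_pos (neg_eps_sq_lt hε hσ)
  have h2 : 0 < σ + ℓ ^ 2 := by positivity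
  have hg := profRate_nonneg hℓ (neg_eps_sq_lt hε hσ) (neg_ell_sq_lt hℓ hσ) (ε := ε)
  have hgD : profRateD ε ℓ σ ≤ 0 := by
    unfold profRateD
    have : 0 ≤ profRate ε ℓ σ * (1 / (2 * regR ε σ ^ 2) + 1 / (σ + ℓ ^ 2)) := by positivity
    linarith
  have key : 2 * σ * testRateD ε ℓ n σ =
      2 * σ * profRateD ε ℓ σ * farCut n σ + (4 * σ * profRate ε ℓ σ * farCutD n σ) / 2 := by
    unfold testRateD; ring
  rw [key]
  have h1 : 2 * σ * profRateD ε ℓ σ * farCut n σ ≤ 0 := by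
    have := farCut_nonneg n σ
    have : 2 * σ * profRateD ε ℓ σ ≤ 0 := by nlinarith
    nlinarith
  have hB := abs_shell_le hε hℓ hσ hn
  have hB' := le_abs_self (4 * σ * profRate ε ℓ σ * farCutD n σ)
  have hhalf : stDerivBound / 3 * ℓ ^ 2 / n ^ 3 = (2 * stDerivBound / 3 * ℓ ^ 2 / n ^ 3) / 2 := by
    ring
  rw [hhalf]
  linarith

end Pointwise


/-! ## The radial test function on `ℝ³` -/

section Radial3D

open InnerProductSpace
open scoped RealInnerProductSpace Laplacian

/-- Local notation for physical space `ℝ³ = EuclideanSpace ℝ (Fin 3)`. -/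
local notation "ℝ³" => EuclideanSpace ℝ (Fin 3)

/-- The radial potential `G(y) = gₙ(|y|²)`. [folklore] -/
def radPot (ε ℓ n : ℝ) (y : ℝ³) : ℝ := testProf ε ℓ n (‖y‖ ^ 2)

/-- The test function `θₙ(y) = gₙ(|y|²) - gₙ(4n²)` (compactly supported in `|y| ≤ 2n`).
[folklore] -/
def testFn (ε ℓ n : ℝ) (y : ℝ³) : ℝ := testProf ε ℓ n (‖y‖ ^ 2) - testProf ε ℓ n (4 * n ^ 2)

variable {ε ℓ n : ℝ}

/-- Auxiliary lemma `neg_eps_sq_lt_norm_sq`. [folklore] -/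
theorem neg_eps_sq_lt_norm_sq (hε : 0 < ε) (y : ℝ³) : -ε ^ 2 < ‖y‖ ^ 2 := by
  nlinarith [sq_nonneg ‖y‖]

/-- `G` is smooth. [folklore] -/
theorem contDiff_radPot (hε : 0 < ε) (hℓ : 0 < ℓ) (hεℓ : ε ^ 2 ≤ ℓ ^ 2) :
    ContDiff ℝ ∞ (radPot ε ℓ n) := by
  rw [contDiff_iff_contDiffAt]
  intro y
  have hg := (contDiffOn_testProf (n := n) hε hℓ hεℓ).contDiffAt
    (Ioi_mem_nhds (neg_eps_sq_lt_norm_sq hε y))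
  exact hg.comp y (contDiff_norm_sq ℝ (n := ∞)).contDiffAt

/-- `θₙ` is smooth. [folklore] -/
theorem contDiff_testFn (hε : 0 < ε) (hℓ : 0 < ℓ) (hεℓ : ε ^ 2 ≤ ℓ ^ 2) :
    ContDiff ℝ ∞ (testFn ε ℓ n) :=
  (contDiff_radPot hε hℓ hεℓ).sub contDiff_const

/-- `θₙ` vanishes off the closed ball of radius `2n`. [folklore] -/
theorem testFn_eq_zero (hε : 0 < ε) (hℓ : 0 < ℓ) (hεℓ : ε ^ 2 ≤ ℓ ^ 2) (hn : 0 < n) {y : ℝ³}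
    (hy : 2 * n ≤ ‖y‖) : testFn ε ℓ n y = 0 := by
  unfold testFn
  have h4 : 4 * n ^ 2 ≤ ‖y‖ ^ 2 := by nlinarith
  rw [testProf_eq_of_le hε hℓ hεℓ hn.ne' h4, sub_self]

/-- Auxiliary lemma `hasCompactSupport_testFn`. [folklore] -/
theorem hasCompactSupport_testFn (hε : 0 < ε) (hℓ : 0 < ℓ) (hεℓ : ε ^ 2 ≤ ℓ ^ 2) (hn : 0 < n) :
    HasCompactSupport (testFn ε ℓ n) := by
  refine HasCompactSupport.intro (isCompact_closedBall (0 : ℝ³) (2 * n)) fun y hy => ?_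
  refine testFn_eq_zero hε hℓ hεℓ hn ?_
  rw [Metric.mem_closedBall, dist_zero_right, not_le] at hy
  exact hy.le

/-- `θₙ` is a test function on the whole space. [folklore] -/
theorem isTestFunctionOn_testFn (hε : 0 < ε) (hℓ : 0 < ℓ) (hεℓ : ε ^ 2 ≤ ℓ ^ 2) (hn : 0 < n) :
    FunctionSpaces.IsTestFunctionOn (⊤ : TopologicalSpace.Opens ℝ³) (testFn ε ℓ n) where
  contDiff := contDiff_testFn hε hℓ hεℓ
  hasCompactSupport := hasCompactSupport_testFn hε hℓ hεℓ hn
  tsupport_subset := by simp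

/-- The derivative data of the profile along `σ = |y|²`. [folklore] -/
theorem hasDerivAt_testProf_all (hε : 0 < ε) (hℓ : 0 < ℓ) (hεℓ : ε ^ 2 ≤ ℓ ^ 2) :
    ∀ σ ∈ Ioi (-ε ^ 2), HasDerivAt (testProf ε ℓ n) (testRate ε ℓ n σ) σ := fun _ hσ =>
  hasDerivAt_testProf hε hℓ hεℓ hσ

/-- Auxiliary lemma `hasDerivAt_testRate_norm_sq`. [folklore] -/
theorem hasDerivAt_testRate_norm_sq (hε : 0 < ε) (hℓ : 0 < ℓ) (hεℓ : ε ^ 2 ≤ ℓ ^ 2) (y : ℝ³) :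
    HasDerivAt (testRate ε ℓ n) (testRateD ε ℓ n (‖y‖ ^ 2)) (‖y‖ ^ 2) :=
  hasDerivAt_testRate hℓ (neg_eps_sq_lt_norm_sq hε y) (by nlinarith [sq_nonneg ‖y‖])

/-- `Dθₙ = DG`. [folklore] -/
theorem fderiv_testFn_eq : fderiv ℝ (testFn ε ℓ n) = fderiv ℝ (radPot ε ℓ n) := by
  funext y
  unfold testFn radPot
  exact fderiv_sub_const _

/-- **The Hessian of the test function**:
`D²θₙ(y)(a, a) = 4 g''ₙ(|y|²) ⟨y, a⟩² + 2 g'ₙ(|y|²) |a|²`. [folklore] -/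
theorem hessian_testFn_apply (hε : 0 < ε) (hℓ : 0 < ℓ) (hεℓ : ε ^ 2 ≤ ℓ ^ 2) (y a : ℝ³) :
    fderiv ℝ (fderiv ℝ (testFn ε ℓ n)) y a a =
      4 * testRateD ε ℓ n (‖y‖ ^ 2) * ⟪y, a⟫ ^ 2 + 2 * testRate ε ℓ n (‖y‖ ^ 2) * ‖a‖ ^ 2 := by
  rw [fderiv_testFn_eq]
  have hD : DifferentiableAt ℝ (fderiv ℝ (radPot ε ℓ n)) y :=
    (hasFDerivAt_fderiv_comp_norm_sq isOpen_Ioi (hasDerivAt_testProf_all hε hℓ hεℓ)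
      (neg_eps_sq_lt_norm_sq hε y) (hasDerivAt_testRate_norm_sq hε hℓ hεℓ y)).differentiableAt
  have h1 : fderiv ℝ (fun w => fderiv ℝ (radPot ε ℓ n) w a) y a =
      fderiv ℝ (fderiv ℝ (radPot ε ℓ n)) y a a := by
    rw [fderiv_clm_apply hD (differentiableAt_const a)]
    simp
  rw [← h1]
  unfold radPot
  rw [fderiv_fderiv_comp_norm_sq_apply isOpen_Ioi (hasDerivAt_testProf_all hε hℓ hεℓ)
    (neg_eps_sq_lt_norm_sq hε y) (hasDerivAt_testRate_norm_sq hε hℓ hεℓ y)]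
  rw [real_inner_self_eq_norm_sq]
  ring

/-- **The Laplacian of the test function**: `Δθₙ(y) = 4|y|² g''ₙ(|y|²) + 6 g'ₙ(|y|²)`.
[folklore] -/
theorem laplacian_testFn (hε : 0 < ε) (hℓ : 0 < ℓ) (hεℓ : ε ^ 2 ≤ ℓ ^ 2) (y : ℝ³) :
    (Δ (testFn ε ℓ n)) y =
      6 * testRate ε ℓ n (‖y‖ ^ 2) + 4 * ‖y‖ ^ 2 * testRateD ε ℓ n (‖y‖ ^ 2) := by
  have hG : ContDiffAt ℝ 2 (radPot ε ℓ n) y :=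
    (contDiff_infty.1 (contDiff_radPot (n := n) hε hℓ hεℓ) 2).contDiffAt
  have hsub : testFn ε ℓ n = radPot ε ℓ n - fun _ => testProf ε ℓ n (4 * n ^ 2) := by
    funext y; rfl
  rw [hsub, ContDiffAt.laplacian_sub hG contDiffAt_const, Scheffer.laplacian_const, sub_zero]
  unfold radPot
  rw [laplacian_comp_norm_sq isOpen_Ioi (hasDerivAt_testProf_all hε hℓ hεℓ)
    (neg_eps_sq_lt_norm_sq hε y) (hasDerivAt_testRate_norm_sq hε hℓ hεℓ y),
    finrank_euclideanSpace_fin]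
  push_cast
  ring

/-- Continuity of `y ↦ g'ₙ(|y|²)`. [folklore] -/
theorem continuous_testRate_norm_sq (hε : 0 < ε) (hℓ : 0 < ℓ) (hεℓ : ε ^ 2 ≤ ℓ ^ 2) :
    Continuous fun y : ℝ³ => testRate ε ℓ n (‖y‖ ^ 2) :=
  (continuousOn_testRate (n := n) hℓ hεℓ).comp_continuous (continuous_norm.pow 2)
    (neg_eps_sq_lt_norm_sq hε)

/-- The uniform bound `g'ₙ(|y|²) ≤ 1/(2ε)`. [folklore] -/
theorem testRate_norm_sq_le (hε : 0 < ε) (hℓ : 0 < ℓ) (y : ℝ³) :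
    testRate ε ℓ n (‖y‖ ^ 2) ≤ 1 / (2 * ε) := by
  have hσ : (0 : ℝ) ≤ ‖y‖ ^ 2 := sq_nonneg _
  refine (testRate_le_profRate hℓ (neg_eps_sq_lt hε hσ) (neg_ell_sq_lt hℓ hσ)).trans ?_
  unfold profRate
  have hτ : ε ≤ regR ε (‖y‖ ^ 2) := eps_le_regR hε.le hσ
  have hτ0 : 0 < regR ε (‖y‖ ^ 2) := regR_pos (neg_eps_sq_lt hε hσ)
  rw [div_le_div_iff₀ (by positivity) (by positivity), one_mul]
  have : ℓ ^ 2 * (2 * ε) ≤ 2 * regR ε (‖y‖ ^ 2) * ℓ ^ 2 := by nlinarith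
  nlinarith [mul_nonneg (mul_nonneg (by norm_num : (0:ℝ) ≤ 2) hτ0.le) hσ]

/-- Auxiliary lemma `testRate_norm_sq_nonneg`. [folklore] -/
theorem testRate_norm_sq_nonneg (hε : 0 < ε) (hℓ : 0 < ℓ) (y : ℝ³) :
    0 ≤ testRate ε ℓ n (‖y‖ ^ 2) :=
  testRate_nonneg hℓ (neg_eps_sq_lt hε (sq_nonneg _)) (neg_ell_sq_lt hℓ (sq_nonneg _))

end Radial3D


/-! ## Generic facts: second derivatives and Laplacians of compactly supported smooth functions -/

section Generic

open InnerProductSpace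
open scoped RealInnerProductSpace Laplacian

/-- Local notation for physical space `ℝ³ = EuclideanSpace ℝ (Fin 3)`. -/
local notation "ℝ³" => EuclideanSpace ℝ (Fin 3)

variable {θ : ℝ³ → ℝ}

/-- Off the topological support all second derivatives vanish. [folklore] -/
theorem fderiv_fderiv_apply_eq_zero_of_notMem_tsupport {y : ℝ³} (hy : y ∉ tsupport θ) (a b : ℝ³) :
    fderiv ℝ (fderiv ℝ θ) y a b = 0 := by
  have h : iteratedFDeriv ℝ 2 θ y = 0 := by
    by_contra h
    exact hy (support_iteratedFDeriv_subset 2 (Function.mem_support.2 h))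
  have h2 := congrArg (fun L => L ![a, b]) h
  simpa [iteratedFDeriv_two_apply] using h2

/-- The second derivative of a smooth function is continuous. [folklore] -/
theorem continuous_fderiv_fderiv (hθ : ContDiff ℝ ∞ θ) : Continuous (fderiv ℝ (fderiv ℝ θ)) := by
  have h1 : ContDiff ℝ ∞ (fderiv ℝ θ) := (contDiff_infty_iff_fderiv.1 hθ).2
  exact ((contDiff_infty_iff_fderiv.1 h1).2).continuous

/-- The Laplacian of a smooth function is continuous. [folklore] -/
theorem continuous_laplacian' (hθ : ContDiff ℝ ∞ θ) : Continuous (Δ θ) := by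
  have h : Δ θ = fun x => ∑ i, fderiv ℝ (fderiv ℝ θ) x (stdOrthonormalBasis ℝ ℝ³ i)
      (stdOrthonormalBasis ℝ ℝ³ i) := by
    rw [laplacian_eq_iteratedFDeriv_orthonormalBasis θ (stdOrthonormalBasis ℝ ℝ³)]
    funext x
    simp [iteratedFDeriv_two_apply]
  rw [h]
  refine continuous_finsetSum _ fun i _ => ?_
  exact ((continuous_fderiv_fderiv hθ).clm_apply continuous_const).clm_apply continuous_const

end Generic

/-! ## The core estimate at the origin -/

section Core

open InnerProductSpace
open scoped RealInnerProductSpace Laplacian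

/-- Local notation for physical space `ℝ³ = EuclideanSpace ℝ (Fin 3)`. -/
local notation "ℝ³" => EuclideanSpace ℝ (Fin 3)

/-- The radial part of `|v|²` with respect to the origin: `⟨y, v(y)⟩²/|y|²` (`0` at `y = 0`).
[folklore] -/
def radE (v : ℝ³ → ℝ³) (y : ℝ³) : ℝ := ⟪y, v y⟫ ^ 2 / ‖y‖ ^ 2

/-- The tangential part of `|v|²` with respect to the origin: `|v|² - ⟨y, v(y)⟩²/|y|²`.
[folklore] -/
def tanE (v : ℝ³ → ℝ³) (y : ℝ³) : ℝ := ‖v y‖ ^ 2 - radE v y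

variable (v : ℝ³ → ℝ³)

/-- Auxiliary lemma `radE_nonneg`. [folklore] -/
theorem radE_nonneg (y : ℝ³) : 0 ≤ radE v y := by
  unfold radE; positivity

/-- Auxiliary lemma `radE_le`. [folklore] -/
theorem radE_le (y : ℝ³) : radE v y ≤ ‖v y‖ ^ 2 := by
  unfold radE
  rcases eq_or_ne y 0 with rfl | hy
  · simp
  · rw [div_le_iff₀ (by positivity)]
    have h := abs_real_inner_le_norm y (v y)
    have h2 : |⟪y, v y⟫| ^ 2 ≤ (‖y‖ * ‖v y‖) ^ 2 := pow_le_pow_left₀ (abs_nonneg _) h 2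
    rw [sq_abs] at h2
    nlinarith

/-- Auxiliary lemma `tanE_nonneg`. [folklore] -/
theorem tanE_nonneg (y : ℝ³) : 0 ≤ tanE v y := by
  unfold tanE; linarith [radE_le v y]

/-- Auxiliary lemma `tanE_le`. [folklore] -/
theorem tanE_le (y : ℝ³) : tanE v y ≤ ‖v y‖ ^ 2 := by
  unfold tanE; linarith [radE_nonneg v y]

/-- Auxiliary lemma `tanE_add_radE`. [folklore] -/
theorem tanE_add_radE (y : ℝ³) : tanE v y + radE v y = ‖v y‖ ^ 2 := by
  unfold tanE; ring

/-- Auxiliary lemma `inner_sq_eq_norm_sq_mul_radE`. [folklore] -/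
theorem inner_sq_eq_norm_sq_mul_radE (y : ℝ³) : ⟪y, v y⟫ ^ 2 = ‖y‖ ^ 2 * radE v y := by
  unfold radE
  rcases eq_or_ne y 0 with rfl | hy
  · simp
  · field_simp

variable {v}

/-- Auxiliary lemma `measurable_radE`. [folklore] -/
theorem measurable_radE (hv : Continuous v) : Measurable (radE v) := by
  unfold radE
  exact ((continuous_id.inner hv).pow 2).measurable.div (continuous_norm.pow 2).measurable

/-- Auxiliary lemma `measurable_tanE`. [folklore] -/
theorem measurable_tanE (hv : Continuous v) : Measurable (tanE v) := by
  unfold tanE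
  exact (hv.norm.pow 2).measurable.sub (measurable_radE hv)

variable {ε ℓ n : ℝ}

/-- **The Hessian of `θₙ` along `v`, split into tangential and radial parts.** [folklore] -/
theorem hessian_testFn_decomp (hε : 0 < ε) (hℓ : 0 < ℓ) (hεℓ : ε ^ 2 ≤ ℓ ^ 2) (v : ℝ³ → ℝ³)
    (y : ℝ³) :
    fderiv ℝ (fderiv ℝ (testFn ε ℓ n)) y (v y) (v y) =
      2 * testRate ε ℓ n (‖y‖ ^ 2) * tanE v y +
        (2 * testRate ε ℓ n (‖y‖ ^ 2) + 4 * ‖y‖ ^ 2 * testRateD ε ℓ n (‖y‖ ^ 2)) * radE v y := by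
  rw [hessian_testFn_apply hε hℓ hεℓ, inner_sq_eq_norm_sq_mul_radE]
  unfold tanE
  ring

/-- An integrable majorant times a uniformly bounded measurable factor. [folklore] -/
theorem integrable_of_abs_le_mul_norm_sq {v : ℝ³ → ℝ³} {f : ℝ³ → ℝ} {C : ℝ}
    (hv2 : Integrable (fun y => ‖v y‖ ^ 2)) (hf : AEStronglyMeasurable f volume)
    (hfC : ∀ y, |f y| ≤ C * ‖v y‖ ^ 2) : Integrable f := by
  refine Integrable.mono' (hv2.const_mul C) hf (Eventually.of_forall fun y => ?_)
  rw [Real.norm_eq_abs]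
  exact hfC y

/-- **The core estimate, pressure case (`π ≥ -K`), at the origin, before `n → ∞`.** For a
continuous finite-energy field `v`, a locally integrable `π ≥ -K` on `ℝ³` satisfying the
pressure identity `∫ π Δθₙ = -∫ D²θₙ(v, v)` for the test function `θₙ` (parameters
`0 < ε ≤ ℓ ≤ n`), and a bound `Λ` for `∫ (Δθₙ)₊`:
`∫_{B_ℓ} |v_tan|²/(2τ_ε) ≤ K Λ + (1/ℓ + S) ∫|v|² + S ∫_{|y| ≤ 2n} |π|`, `S = (2C_ST/3) ℓ²/n³`.
[folklore] -/
theorem core_estimate_pressure (hε : 0 < ε) (hℓ : 0 < ℓ) (hεℓ : ε ≤ ℓ) (hn : 0 < n) (hℓn : ℓ ≤ n)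
    {v : ℝ³ → ℝ³} {π : ℝ³ → ℝ} {K Λ : ℝ} (hK0 : 0 ≤ K)
    (hv : Continuous v) (hv2 : Integrable (fun y => ‖v y‖ ^ 2))
    (hπ : LocallyIntegrable π) (hK : ∀ y, -K ≤ π y)
    (hId : ∫ y, π y * (Δ (testFn ε ℓ n)) y =
      -∫ y, fderiv ℝ (fderiv ℝ (testFn ε ℓ n)) y (v y) (v y))
    (hΛ : ∫ y, max ((Δ (testFn ε ℓ n)) y) 0 ≤ Λ) :
    ∫ y in Metric.ball (0 : ℝ³) ℓ, tanE v y / (2 * regR ε (‖y‖ ^ 2)) ≤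
      K * Λ + (1 / ℓ + 2 * stDerivBound / 3 * ℓ ^ 2 / n ^ 3) * (∫ y, ‖v y‖ ^ 2) +
        2 * stDerivBound / 3 * ℓ ^ 2 / n ^ 3 *
          (∫ y in Metric.closedBall (0 : ℝ³) (2 * n), |π y|) := by
  have hεℓ2 : ε ^ 2 ≤ ℓ ^ 2 := pow_le_pow_left₀ hε.le hεℓ 2
  set θ := testFn ε ℓ n with hθ
  set S : ℝ := 2 * stDerivBound / 3 * ℓ ^ 2 / n ^ 3 with hS
  have hS0 : 0 ≤ S := by have := stDerivBound_nonneg; positivity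
  set g1 : ℝ³ → ℝ := fun y => testRate ε ℓ n (‖y‖ ^ 2) with hg1
  set Rc : ℝ³ → ℝ := fun y =>
    2 * testRate ε ℓ n (‖y‖ ^ 2) + 4 * ‖y‖ ^ 2 * testRateD ε ℓ n (‖y‖ ^ 2) with hRc
  set L : ℝ³ → ℝ := fun y => (Δ θ) y with hL
  set H : ℝ³ → ℝ := fun y => fderiv ℝ (fderiv ℝ θ) y (v y) (v y) with hH
  -- smoothness, support
  have hsmooth : ContDiff ℝ ∞ θ := contDiff_testFn hε hℓ hεℓ2
  have hsupp : HasCompactSupport θ := hasCompactSupport_testFn hε hℓ hεℓ2 hn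
  have hLc : Continuous L := continuous_laplacian' hsmooth
  have hLs : HasCompactSupport L := hasCompactSupport_laplacian hsupp
  -- pointwise formulas
  have hHdec : ∀ y, H y = 2 * g1 y * tanE v y + Rc y * radE v y := fun y =>
    hessian_testFn_decomp hε hℓ hεℓ2 v y
  have hLform : ∀ y, L y = 6 * testRate ε ℓ n (‖y‖ ^ 2) + 4 * ‖y‖ ^ 2 * testRateD ε ℓ n (‖y‖ ^ 2) :=
    fun y => laplacian_testFn hε hℓ hεℓ2 y
  have hσ : ∀ y : ℝ³, (0 : ℝ) ≤ ‖y‖ ^ 2 := fun y => sq_nonneg _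
  have hLlow : ∀ y, -S ≤ L y := fun y => by
    rw [hLform]; exact lap_testRate_ge hε hℓ (hσ y) hn
  have hLoff : ∀ y : ℝ³, (‖y‖ < n ∨ 2 * n < ‖y‖) → 0 ≤ L y := fun y hy => by
    rw [hLform]
    refine lap_testRate_nonneg_of hε hℓ (hσ y) hn ?_
    rcases hy with hy | hy
    · left; nlinarith [norm_nonneg y]
    · right; nlinarith [norm_nonneg y]
  have hRclow : ∀ y, -(1 / ℓ) - S ≤ Rc y := fun y => rad_testRate_ge hε hℓ (hσ y) hn
  have hg1nn : ∀ y, 0 ≤ g1 y := fun y => testRate_norm_sq_nonneg hε hℓ y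
  have hg1le : ∀ y, g1 y ≤ 1 / (2 * ε) := fun y => testRate_norm_sq_le hε hℓ y
  have hg1c : Continuous g1 := continuous_testRate_norm_sq hε hℓ hεℓ2
  have hcore : ∀ y ∈ Metric.ball (0 : ℝ³) ℓ, 1 / (2 * regR ε (‖y‖ ^ 2)) ≤ 2 * g1 y := by
    intro y hy
    rw [Metric.mem_ball, dist_zero_right] at hy
    exact inv_two_regR_le hε hℓ (hσ y) (by nlinarith [norm_nonneg y]) hℓn
  -- integrability
  have Iv2 := hv2
  have hRcup : ∀ y, Rc y ≤ 1 / ε + S := fun y => rad_testRate_le hε hℓ (hσ y) hn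
  have hRcm : Measurable Rc :=
    ((measurable_testRate.comp (measurable_norm.pow_const 2)).const_mul 2).add
      (((measurable_norm.pow_const 2).const_mul 4).mul
        (measurable_testRateD.comp (measurable_norm.pow_const 2)))
  have I_H : Integrable H := by
    have hHfun : H = fun y => 2 * g1 y * tanE v y + Rc y * radE v y := funext hHdec
    refine integrable_of_abs_le_mul_norm_sq (C := 1 / ε + (1 / ε + 1 / ℓ + S)) hv2 ?_ (fun y => ?_)
    · rw [hHfun]
      exact (((hg1c.measurable.const_mul 2).mul (measurable_tanE hv)).add
        (hRcm.mul (measurable_radE hv))).aestronglyMeasurable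
    · rw [hHdec]
      have ht0 := tanE_nonneg v y
      have ht1 := tanE_le v y
      have hr0 := radE_nonneg v y
      have hr1 := radE_le v y
      have ha : |2 * g1 y * tanE v y| ≤ 1 / ε * ‖v y‖ ^ 2 := by
        rw [abs_of_nonneg (by have := hg1nn y; positivity)]
        calc 2 * g1 y * tanE v y ≤ 2 * (1 / (2 * ε)) * ‖v y‖ ^ 2 := by
              gcongr
              exact hg1le y
          _ = 1 / ε * ‖v y‖ ^ 2 := by field_simp
      have hb : |Rc y * radE v y| ≤ (1 / ε + 1 / ℓ + S) * ‖v y‖ ^ 2 := by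
        rw [abs_mul, abs_of_nonneg hr0]
        have hRabs : |Rc y| ≤ 1 / ε + 1 / ℓ + S := by
          rw [abs_le]
          constructor
          · have := hRclow y
            have : (0 : ℝ) < 1 / ε := by positivity
            linarith
          · have : (0 : ℝ) < 1 / ℓ := by positivity
            linarith [hRcup y]
        calc |Rc y| * radE v y ≤ (1 / ε + 1 / ℓ + S) * radE v y :=
              mul_le_mul_of_nonneg_right hRabs hr0
          _ ≤ (1 / ε + 1 / ℓ + S) * ‖v y‖ ^ 2 := by
              refine mul_le_mul_of_nonneg_left hr1 ?_
              have : (0 : ℝ) < 1 / ε := by positivity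
              have : (0 : ℝ) < 1 / ℓ := by positivity
              linarith
      calc |2 * g1 y * tanE v y + Rc y * radE v y|
          ≤ |2 * g1 y * tanE v y| + |Rc y * radE v y| := abs_add_le _ _
        _ ≤ 1 / ε * ‖v y‖ ^ 2 + (1 / ε + 1 / ℓ + S) * ‖v y‖ ^ 2 := add_le_add ha hb
        _ = (1 / ε + (1 / ε + 1 / ℓ + S)) * ‖v y‖ ^ 2 := by ring
  have I_g1tan : Integrable (fun y => 2 * g1 y * tanE v y) := by
    refine integrable_of_abs_le_mul_norm_sq (C := 1 / ε) hv2 ?_ (fun y => ?_)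
    · exact ((hg1c.measurable.const_mul 2).mul (measurable_tanE hv)).aestronglyMeasurable
    · rw [abs_of_nonneg (by have := hg1nn y; have := tanE_nonneg v y; positivity)]
      calc 2 * g1 y * tanE v y ≤ 2 * (1 / (2 * ε)) * ‖v y‖ ^ 2 := by
            gcongr
            · exact tanE_nonneg v y
            · exact hg1le y
            · exact tanE_le v y
        _ = 1 / ε * ‖v y‖ ^ 2 := by field_simp
  have I_Rcrad : Integrable (fun y => Rc y * radE v y) := by
    have := I_H.sub I_g1tan
    refine this.congr (Eventually.of_forall fun y => ?_)
    simp only [Pi.sub_apply, hHdec]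
    ring
  have hπabs : LocallyIntegrable (fun y => |π y|) := by
    have h : LocallyIntegrable (fun y => ‖π y‖) := fun x => (hπ x).norm
    simpa [Real.norm_eq_abs] using h
  have I_πL : Integrable (fun y => π y * L y) := by
    have := hπ.integrable_smul_right_of_hasCompactSupport hLc hLs
    simpa [smul_eq_mul] using this
  have I_Lpos : Integrable (fun y => max (L y) 0) :=
    (hLc.max continuous_const).integrable_of_hasCompactSupport
      (hLs.comp_left (g := fun t => max t 0) (by simp))
  have hLnegc : Continuous fun y => max (-L y) 0 := hLc.neg.max continuous_const
  have hLnegs : HasCompactSupport fun y => max (-L y) 0 :=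
    hLs.comp_left (g := fun t => max (-t) 0) (by simp)
  have I_πLneg : Integrable (fun y => |π y| * max (-L y) 0) := by
    have := hπabs.integrable_smul_right_of_hasCompactSupport hLnegc hLnegs
    simpa [smul_eq_mul] using this
  -- Step 1: `∫ 2 g1 tan = -∫ π L - ∫ Rc rad`
  have step1 : ∫ y, 2 * g1 y * tanE v y = -(∫ y, π y * L y) - ∫ y, Rc y * radE v y := by
    have e1 : ∫ y, H y = (∫ y, 2 * g1 y * tanE v y) + ∫ y, Rc y * radE v y := by
      rw [← integral_add I_g1tan I_Rcrad]
      exact integral_congr_ae (Eventually.of_forall hHdec)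
    have e2 : ∫ y, H y = -∫ y, π y * L y := by
      rw [hH, hL, hId]; ring
    linarith
  -- Step 2: `-∫ π L ≤ K ∫ L₊ + ∫ |π| L₋`
  have step2 : -(∫ y, π y * L y) ≤ K * (∫ y, max (L y) 0) + ∫ y, |π y| * max (-L y) 0 := by
    rw [← MeasureTheory.integral_neg, ← MeasureTheory.integral_const_mul,
      ← integral_add (I_Lpos.const_mul K) I_πLneg]
    refine integral_mono I_πL.neg ((I_Lpos.const_mul K).add I_πLneg) fun y => ?_
    -- pointwise: `-(π L) ≤ K L₊ + |π| L₋`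
    have hπy := hK y
    rcases le_total 0 (L y) with hLy | hLy
    · rw [max_eq_left hLy, max_eq_right (by linarith)]
      nlinarith [abs_nonneg (π y)]
    · rw [max_eq_right hLy, max_eq_left (by linarith)]
      have := neg_abs_le (π y)
      have := le_abs_self (π y)
      nlinarith
  -- Step 3: `∫ |π| L₋ ≤ S ∫_{|y| ≤ 2n} |π|`
  have step3 : ∫ y, |π y| * max (-L y) 0 ≤
      S * ∫ y in Metric.closedBall (0 : ℝ³) (2 * n), |π y| := by
    have Iball : IntegrableOn (fun y => |π y|) (Metric.closedBall (0 : ℝ³) (2 * n)) :=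
      hπabs.integrableOn_isCompact (isCompact_closedBall _ _)
    rw [← integral_indicator measurableSet_closedBall, ← MeasureTheory.integral_const_mul]
    refine integral_mono I_πLneg ((Iball.integrable_indicator measurableSet_closedBall).const_mul S)
      fun y => ?_
    by_cases hy : y ∈ Metric.closedBall (0 : ℝ³) (2 * n)
    · rw [indicator_of_mem hy]
      have h1 : max (-L y) 0 ≤ S := max_le (by linarith [hLlow y]) hS0
      calc |π y| * max (-L y) 0 ≤ |π y| * S := by gcongr
        _ = S * |π y| := by ring
    · rw [indicator_of_notMem hy, mul_zero]
      rw [Metric.mem_closedBall, dist_zero_right, not_le] at hy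
      have h0 : max (-L y) 0 = 0 := max_eq_right (by linarith [hLoff y (Or.inr hy)])
      rw [h0, mul_zero]
  -- Step 4: `-∫ Rc rad ≤ (1/ℓ + S) ∫ |v|²`
  have step4 : -(∫ y, Rc y * radE v y) ≤ (1 / ℓ + S) * ∫ y, ‖v y‖ ^ 2 := by
    rw [← MeasureTheory.integral_neg, ← MeasureTheory.integral_const_mul]
    refine integral_mono I_Rcrad.neg (hv2.const_mul _) fun y => ?_
    have h1 : -(Rc y * radE v y) ≤ (1 / ℓ + S) * radE v y := by
      have := hRclow y
      have := radE_nonneg v y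
      nlinarith
    have hℓS : 0 ≤ 1 / ℓ + S := add_nonneg (by positivity) hS0
    have h2 : (1 / ℓ + S) * radE v y ≤ (1 / ℓ + S) * ‖v y‖ ^ 2 :=
      mul_le_mul_of_nonneg_left (radE_le v y) hℓS
    linarith
  -- Step 5: the left-hand side is at most `∫ 2 g1 tan`
  have step5 : ∫ y in Metric.ball (0 : ℝ³) ℓ, tanE v y / (2 * regR ε (‖y‖ ^ 2)) ≤
      ∫ y, 2 * g1 y * tanE v y := by
    rw [← integral_indicator measurableSet_ball]
    refine integral_mono ?_ I_g1tan fun y => ?_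
    · refine (integrable_indicator_iff measurableSet_ball).2 ?_
      refine (integrable_of_abs_le_mul_norm_sq (C := 1 / (2 * ε)) hv2 ?_ fun y => ?_).integrableOn
      · have hτc : Continuous fun y : ℝ³ => regR ε (‖y‖ ^ 2) :=
          Real.continuous_sqrt.comp ((continuous_norm.pow 2).add continuous_const)
        exact ((measurable_tanE hv).div (hτc.measurable.const_mul 2)).aestronglyMeasurable
      · have hτ : ε ≤ regR ε (‖y‖ ^ 2) := eps_le_regR hε.le (hσ y)
        have hτ0 : 0 < regR ε (‖y‖ ^ 2) := regR_pos (neg_eps_sq_lt hε (hσ y))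
        have ht0 := tanE_nonneg v y
        rw [abs_of_nonneg (by positivity)]
        calc tanE v y / (2 * regR ε (‖y‖ ^ 2)) ≤ tanE v y / (2 * ε) := by
              gcongr
          _ ≤ ‖v y‖ ^ 2 / (2 * ε) := by gcongr; exact tanE_le v y
          _ = 1 / (2 * ε) * ‖v y‖ ^ 2 := by ring
    · by_cases hy : y ∈ Metric.ball (0 : ℝ³) ℓ
      · rw [indicator_of_mem hy]
        have ht0 := tanE_nonneg v y
        calc tanE v y / (2 * regR ε (‖y‖ ^ 2)) = 1 / (2 * regR ε (‖y‖ ^ 2)) * tanE v y := by ring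
          _ ≤ 2 * g1 y * tanE v y := mul_le_mul_of_nonneg_right (hcore y hy) ht0
      · rw [indicator_of_notMem hy]
        have := hg1nn y
        have := tanE_nonneg v y
        positivity
  -- combine
  have hKΛ : K * (∫ y, max (L y) 0) ≤ K * Λ := mul_le_mul_of_nonneg_left hΛ hK0
  calc ∫ y in Metric.ball (0 : ℝ³) ℓ, tanE v y / (2 * regR ε (‖y‖ ^ 2))
      ≤ ∫ y, 2 * g1 y * tanE v y := step5
    _ = -(∫ y, π y * L y) - ∫ y, Rc y * radE v y := step1
    _ ≤ (K * (∫ y, max (L y) 0) + ∫ y, |π y| * max (-L y) 0) +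
          (1 / ℓ + S) * (∫ y, ‖v y‖ ^ 2) := by linarith [step2, step4]
    _ ≤ K * Λ + (1 / ℓ + S) * (∫ y, ‖v y‖ ^ 2) +
          S * (∫ y in Metric.closedBall (0 : ℝ³) (2 * n), |π y|) := by linarith [hKΛ, step3]

end Core


/-! ## The integral of the positive part of `Δθₙ` is `O(ℓ²)` -/

section Majorant

open InnerProductSpace
open scoped RealInnerProductSpace Laplacian

/-- Local notation for physical space `ℝ³ = EuclideanSpace ℝ (Fin 3)`. -/
local notation "ℝ³" => EuclideanSpace ℝ (Fin 3)

/-- The volume of the unit ball of `ℝ³` (as a real number). [folklore] -/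
def vB : ℝ := (volume : Measure ℝ³).real (Metric.ball (0 : ℝ³) 1)

/-- Auxiliary lemma `vB_pos`. [folklore] -/
theorem vB_pos : 0 < vB := by
  unfold vB
  rw [measureReal_def]
  exact ENNReal.toReal_pos (Metric.measure_ball_pos volume (0 : ℝ³) one_pos).ne' measure_ball_lt_top.ne

/-- Auxiliary lemma `volume_real_ball`. [folklore] -/
theorem volume_real_ball {r : ℝ} (hr : 0 < r) :
    (volume : Measure ℝ³).real (Metric.ball (0 : ℝ³) r) = r ^ 3 * vB := by
  unfold vB
  rw [measureReal_def, measureReal_def, Measure.addHaar_ball_of_pos volume (0 : ℝ³) hr,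
    finrank_euclideanSpace_fin, ENNReal.toReal_mul, ENNReal.toReal_ofReal (by positivity)]

variable {ε ℓ n : ℝ}

/-- `|y| ≤ τ_ε(|y|²)`. [folklore] -/
theorem norm_le_regR (ε : ℝ) (y : ℝ³) : ‖y‖ ≤ regR ε (‖y‖ ^ 2) := by
  have h := sqrt_le_regR (ε := ε) (σ := ‖y‖ ^ 2)
  rwa [Real.sqrt_sq (norm_nonneg y)] at h

/-- Auxiliary lemma `continuous_regR_norm_sq`. [folklore] -/
theorem continuous_regR_norm_sq (ε : ℝ) : Continuous fun y : ℝ³ => regR ε (‖y‖ ^ 2) :=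
  Real.continuous_sqrt.comp ((continuous_norm.pow 2).add continuous_const)

/-- The first majorant `P₁(y) = ℓ²ε²/τ⁵`. [folklore] -/
def major₁ (ε ℓ : ℝ) (y : ℝ³) : ℝ := ℓ ^ 2 * ε ^ 2 / regR ε (‖y‖ ^ 2) ^ 5

/-- The second majorant `P₂(y) = 2ℓ⁴/(τ (|y|² + ℓ²)²)`. [folklore] -/
def major₂ (ε ℓ : ℝ) (y : ℝ³) : ℝ := 2 * ℓ ^ 4 / (regR ε (‖y‖ ^ 2) * (‖y‖ ^ 2 + ℓ ^ 2) ^ 2)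

/-- Auxiliary lemma `continuous_major₁`. [folklore] -/
theorem continuous_major₁ (hε : 0 < ε) : Continuous (major₁ ε ℓ) := by
  unfold major₁
  refine continuous_const.div ((continuous_regR_norm_sq ε).pow 5) fun y => ?_
  exact (pow_pos (regR_pos (neg_eps_sq_lt_norm_sq hε y)) 5).ne'

/-- Auxiliary lemma `continuous_major₂`. [folklore] -/
theorem continuous_major₂ (hε : 0 < ε) (hℓ : 0 < ℓ) : Continuous (major₂ ε ℓ) := by
  unfold major₂
  refine continuous_const.div ((continuous_regR_norm_sq ε).mul
    (((continuous_norm.pow 2).add continuous_const).pow 2)) fun y => ?_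
  have h1 := regR_pos (neg_eps_sq_lt_norm_sq hε y)
  positivity

/-- Auxiliary lemma `major₁_nonneg`. [folklore] -/
theorem major₁_nonneg (y : ℝ³) : 0 ≤ major₁ ε ℓ y := by
  unfold major₁; have := regR_nonneg ε (‖y‖ ^ 2); positivity

/-- Auxiliary lemma `major₂_nonneg`. [folklore] -/
theorem major₂_nonneg (y : ℝ³) : 0 ≤ major₂ ε ℓ y := by
  unfold major₂; have := regR_nonneg ε (‖y‖ ^ 2); positivity

/-- `P₁ ≤ ℓ²ε²·ε⁻⁵` everywhere. [folklore] -/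
theorem major₁_le_const (hε : 0 < ε) (y : ℝ³) : major₁ ε ℓ y ≤ ℓ ^ 2 * ε ^ 2 / ε ^ 5 := by
  unfold major₁
  have hτ : ε ≤ regR ε (‖y‖ ^ 2) := eps_le_regR hε.le (sq_nonneg _)
  exact div_le_div_of_nonneg_left (by positivity) (by positivity) (pow_le_pow_left₀ hε.le hτ 5)

/-- `P₁ ≤ ℓ²ε² |y|⁻⁵` off the origin. [folklore] -/
theorem major₁_le_rpow (hε : 0 < ε) {y : ℝ³} (hy : 0 < ‖y‖) :
    major₁ ε ℓ y ≤ ℓ ^ 2 * ε ^ 2 * ‖y‖ ^ (-5 : ℝ) := by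
  unfold major₁
  rw [Real.rpow_neg (norm_nonneg _), show (5 : ℝ) = ((5 : ℕ) : ℝ) by norm_num, Real.rpow_natCast,
    ← div_eq_mul_inv]
  exact div_le_div_of_nonneg_left (by positivity) (by positivity)
    (pow_le_pow_left₀ hy.le (norm_le_regR ε y) 5)

/-- `P₂ ≤ 2/ε` everywhere. [folklore] -/
theorem major₂_le_const (hε : 0 < ε) (hℓ : 0 < ℓ) (y : ℝ³) : major₂ ε ℓ y ≤ 2 / ε := by
  unfold major₂
  have hτ : ε ≤ regR ε (‖y‖ ^ 2) := eps_le_regR hε.le (sq_nonneg _)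
  have hτ0 : 0 < regR ε (‖y‖ ^ 2) := regR_pos (neg_eps_sq_lt_norm_sq hε y)
  rw [div_le_div_iff₀ (by positivity) hε]
  have h1 : ℓ ^ 4 ≤ (‖y‖ ^ 2 + ℓ ^ 2) ^ 2 := by nlinarith [sq_nonneg ‖y‖]
  have h2 : ε * ℓ ^ 4 ≤ regR ε (‖y‖ ^ 2) * (‖y‖ ^ 2 + ℓ ^ 2) ^ 2 :=
    mul_le_mul hτ h1 (by positivity) hτ0.le
  nlinarith

/-- `P₂ ≤ 2 |y|⁻¹` off the origin. [folklore] -/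
theorem major₂_le_rpow_one (hε : 0 < ε) (hℓ : 0 < ℓ) {y : ℝ³} (hy : 0 < ‖y‖) :
    major₂ ε ℓ y ≤ 2 * ‖y‖ ^ (-1 : ℝ) := by
  unfold major₂
  rw [Real.rpow_neg_one, ← div_eq_mul_inv]
  have hτy := norm_le_regR ε y
  rw [div_le_div_iff₀ (by have := regR_pos (neg_eps_sq_lt_norm_sq hε y); positivity) hy]
  have h1 : ℓ ^ 4 ≤ (‖y‖ ^ 2 + ℓ ^ 2) ^ 2 := by nlinarith [sq_nonneg ‖y‖]
  have h2 : ‖y‖ * ℓ ^ 4 ≤ regR ε (‖y‖ ^ 2) * (‖y‖ ^ 2 + ℓ ^ 2) ^ 2 :=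
    mul_le_mul hτy h1 (by positivity) (regR_nonneg _ _)
  nlinarith

/-- `P₂ ≤ 2ℓ⁴ |y|⁻⁵` off the origin. [folklore] -/
theorem major₂_le_rpow_five (hℓ : 0 < ℓ) {y : ℝ³} (hy : 0 < ‖y‖) :
    major₂ ε ℓ y ≤ 2 * ℓ ^ 4 * ‖y‖ ^ (-5 : ℝ) := by
  unfold major₂
  rw [Real.rpow_neg (norm_nonneg _), show (5 : ℝ) = ((5 : ℕ) : ℝ) by norm_num, Real.rpow_natCast,
    ← div_eq_mul_inv]
  have hτy := norm_le_regR ε y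
  refine div_le_div_of_nonneg_left (by positivity) (by positivity) ?_
  have h1 : ‖y‖ ^ 4 ≤ (‖y‖ ^ 2 + ℓ ^ 2) ^ 2 := by nlinarith [sq_nonneg ‖y‖, sq_nonneg ℓ]
  calc ‖y‖ ^ 5 = ‖y‖ * ‖y‖ ^ 4 := by ring
    _ ≤ regR ε (‖y‖ ^ 2) * (‖y‖ ^ 2 + ℓ ^ 2) ^ 2 :=
        mul_le_mul hτy h1 (by positivity) (regR_nonneg _ _)

/-- Almost every point of `ℝ³` is not the origin. [folklore] -/
theorem ae_norm_pos : ∀ᵐ y ∂(volume : Measure ℝ³), 0 < ‖y‖ := by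
  have h : ∀ᵐ y ∂(volume : Measure ℝ³), y ≠ 0 := by
    have : ({0} : Set ℝ³)ᶜ ∈ ae (volume : Measure ℝ³) := compl_mem_ae_iff.2 (measure_singleton 0)
    filter_upwards [this] with y hy
    simpa using hy
  filter_upwards [h] with y hy
  exact norm_pos_iff.2 hy

/-- **`∫ P₁ ≤ (5/2) vB ℓ²`.** [folklore] -/
theorem integrable_major₁_and_le (hε : 0 < ε) (hℓ : 0 < ℓ) :
    Integrable (major₁ ε ℓ) ∧ ∫ y, major₁ ε ℓ y ≤ 5 / 2 * vB * ℓ ^ 2 := by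
  have hc := continuous_major₁ (ℓ := ℓ) hε
  have hmeas : AEStronglyMeasurable (major₁ ε ℓ) volume := hc.aestronglyMeasurable
  -- on the small ball
  have hB : IntegrableOn (major₁ ε ℓ) (Metric.ball (0 : ℝ³) ε) ∧
      ∫ y in Metric.ball (0 : ℝ³) ε, major₁ ε ℓ y ≤ vB * ℓ ^ 2 := by
    have hconst : IntegrableOn (fun _ : ℝ³ => ℓ ^ 2 * ε ^ 2 / ε ^ 5) (Metric.ball (0 : ℝ³) ε) :=
      integrableOn_const (measure_ball_lt_top).ne
    have hint : IntegrableOn (major₁ ε ℓ) (Metric.ball (0 : ℝ³) ε) :=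
      Integrable.mono' hconst hmeas.restrict (Eventually.of_forall fun y => by
        rw [Real.norm_eq_abs, abs_of_nonneg (major₁_nonneg y)]; exact major₁_le_const hε y)
    refine ⟨hint, ?_⟩
    calc ∫ y in Metric.ball (0 : ℝ³) ε, major₁ ε ℓ y
        ≤ ∫ _ in Metric.ball (0 : ℝ³) ε, ℓ ^ 2 * ε ^ 2 / ε ^ 5 :=
          setIntegral_mono hint hconst fun y => major₁_le_const hε y
      _ = vB * ℓ ^ 2 := by
          rw [setIntegral_const, volume_real_ball hε, smul_eq_mul]
          field_simp
  -- off the small ball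
  have hC : IntegrableOn (major₁ ε ℓ) (Metric.ball (0 : ℝ³) ε)ᶜ ∧
      ∫ y in (Metric.ball (0 : ℝ³) ε)ᶜ, major₁ ε ℓ y ≤ 3 / 2 * vB * ℓ ^ 2 := by
    have hdom : IntegrableOn (fun y : ℝ³ => ℓ ^ 2 * ε ^ 2 * ‖y‖ ^ (-5 : ℝ))
        (Metric.ball (0 : ℝ³) ε)ᶜ :=
      (NewtonPotentialHolder.integrableOn_compl_ball_norm_rpow_neg (by norm_num) hε).const_mul _
    have hle : ∀ y ∈ (Metric.ball (0 : ℝ³) ε)ᶜ, major₁ ε ℓ y ≤ ℓ ^ 2 * ε ^ 2 * ‖y‖ ^ (-5 : ℝ) := by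
      intro y hy
      rw [mem_compl_iff, Metric.mem_ball, dist_zero_right, not_lt] at hy
      exact major₁_le_rpow hε (hε.trans_le hy)
    have hint : IntegrableOn (major₁ ε ℓ) (Metric.ball (0 : ℝ³) ε)ᶜ :=
      Integrable.mono' hdom hmeas.restrict ((ae_restrict_iff' measurableSet_ball.compl).2
        (Eventually.of_forall fun y hy => by
          rw [Real.norm_eq_abs, abs_of_nonneg (major₁_nonneg y)]; exact hle y hy))
    refine ⟨hint, ?_⟩
    calc ∫ y in (Metric.ball (0 : ℝ³) ε)ᶜ, major₁ ε ℓ y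
        ≤ ∫ y in (Metric.ball (0 : ℝ³) ε)ᶜ, ℓ ^ 2 * ε ^ 2 * ‖y‖ ^ (-5 : ℝ) :=
          setIntegral_mono_on hint hdom measurableSet_ball.compl hle
      _ = ℓ ^ 2 * ε ^ 2 * (3 * vB * (ε ^ (3 - 5 : ℝ) / (5 - 3))) := by
          rw [integral_const_mul, NewtonPotentialHolder.integral_compl_ball_norm_rpow_neg
            (by norm_num) hε]
          rfl
      _ = 3 / 2 * vB * ℓ ^ 2 := by
          rw [show (3 - 5 : ℝ) = -2 by norm_num, Real.rpow_neg hε.le,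
            show (2 : ℝ) = ((2 : ℕ) : ℝ) by norm_num, Real.rpow_natCast]
          field_simp
          ring
  refine ⟨?_, ?_⟩
  · have := hB.1.union hC.1
    rwa [union_compl_self, integrableOn_univ] at this
  · have := hB.1.union hC.1
    rw [union_compl_self, integrableOn_univ] at this
    rw [← integral_add_compl (measurableSet_ball (x := (0 : ℝ³)) (ε := ε)) this]
    linarith [hB.2, hC.2]

/-- **`∫ P₂ ≤ 6 vB ℓ²`.** [folklore] -/
theorem integrable_major₂_and_le (hε : 0 < ε) (hℓ : 0 < ℓ) :
    Integrable (major₂ ε ℓ) ∧ ∫ y, major₂ ε ℓ y ≤ 6 * vB * ℓ ^ 2 := by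
  have hc := continuous_major₂ hε hℓ
  have hmeas : AEStronglyMeasurable (major₂ ε ℓ) volume := hc.aestronglyMeasurable
  -- on the ball of radius `ℓ`
  have hB : IntegrableOn (major₂ ε ℓ) (Metric.ball (0 : ℝ³) ℓ) ∧
      ∫ y in Metric.ball (0 : ℝ³) ℓ, major₂ ε ℓ y ≤ 3 * vB * ℓ ^ 2 := by
    have hconst : IntegrableOn (fun _ : ℝ³ => 2 / ε) (Metric.ball (0 : ℝ³) ℓ) :=
      integrableOn_const (measure_ball_lt_top).ne
    have hint : IntegrableOn (major₂ ε ℓ) (Metric.ball (0 : ℝ³) ℓ) :=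
      Integrable.mono' hconst hmeas.restrict (Eventually.of_forall fun y => by
        rw [Real.norm_eq_abs, abs_of_nonneg (major₂_nonneg y)]; exact major₂_le_const hε hℓ y)
    have hdom : IntegrableOn (fun y : ℝ³ => 2 * ‖y‖ ^ (-1 : ℝ)) (Metric.ball (0 : ℝ³) ℓ) :=
      (NewtonPotentialHolder.integrableOn_ball_norm_rpow_neg (by norm_num) ℓ).const_mul _
    refine ⟨hint, ?_⟩
    calc ∫ y in Metric.ball (0 : ℝ³) ℓ, major₂ ε ℓ y
        ≤ ∫ y in Metric.ball (0 : ℝ³) ℓ, 2 * ‖y‖ ^ (-1 : ℝ) := by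
          refine integral_mono_ae hint hdom ?_
          refine (ae_restrict_iff' measurableSet_ball).2 ?_
          filter_upwards [ae_norm_pos] with y hy _
          exact major₂_le_rpow_one hε hℓ hy
      _ = 2 * (3 * vB * (ℓ ^ (3 - 1 : ℝ) / (3 - 1))) := by
          rw [integral_const_mul, NewtonPotentialHolder.integral_ball_norm_rpow_neg
            (by norm_num) hℓ]
          rfl
      _ = 3 * vB * ℓ ^ 2 := by
          rw [show (3 - 1 : ℝ) = ((2 : ℕ) : ℝ) by norm_num, Real.rpow_natCast]
          ring
  -- off the ball of radius `ℓ`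
  have hC : IntegrableOn (major₂ ε ℓ) (Metric.ball (0 : ℝ³) ℓ)ᶜ ∧
      ∫ y in (Metric.ball (0 : ℝ³) ℓ)ᶜ, major₂ ε ℓ y ≤ 3 * vB * ℓ ^ 2 := by
    have hdom : IntegrableOn (fun y : ℝ³ => 2 * ℓ ^ 4 * ‖y‖ ^ (-5 : ℝ))
        (Metric.ball (0 : ℝ³) ℓ)ᶜ :=
      (NewtonPotentialHolder.integrableOn_compl_ball_norm_rpow_neg (by norm_num) hℓ).const_mul _
    have hle : ∀ y ∈ (Metric.ball (0 : ℝ³) ℓ)ᶜ, major₂ ε ℓ y ≤ 2 * ℓ ^ 4 * ‖y‖ ^ (-5 : ℝ) := by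
      intro y hy
      rw [mem_compl_iff, Metric.mem_ball, dist_zero_right, not_lt] at hy
      exact major₂_le_rpow_five hℓ (hℓ.trans_le hy)
    have hint : IntegrableOn (major₂ ε ℓ) (Metric.ball (0 : ℝ³) ℓ)ᶜ :=
      Integrable.mono' hdom hmeas.restrict ((ae_restrict_iff' measurableSet_ball.compl).2
        (Eventually.of_forall fun y hy => by
          rw [Real.norm_eq_abs, abs_of_nonneg (major₂_nonneg y)]; exact hle y hy))
    refine ⟨hint, ?_⟩
    calc ∫ y in (Metric.ball (0 : ℝ³) ℓ)ᶜ, major₂ ε ℓ y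
        ≤ ∫ y in (Metric.ball (0 : ℝ³) ℓ)ᶜ, 2 * ℓ ^ 4 * ‖y‖ ^ (-5 : ℝ) :=
          setIntegral_mono_on hint hdom measurableSet_ball.compl hle
      _ = 2 * ℓ ^ 4 * (3 * vB * (ℓ ^ (3 - 5 : ℝ) / (5 - 3))) := by
          rw [integral_const_mul, NewtonPotentialHolder.integral_compl_ball_norm_rpow_neg
            (by norm_num) hℓ]
          rfl
      _ = 3 * vB * ℓ ^ 2 := by
          rw [show (3 - 5 : ℝ) = -2 by norm_num, Real.rpow_neg hℓ.le,
            show (2 : ℝ) = ((2 : ℕ) : ℝ) by norm_num, Real.rpow_natCast]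
          field_simp
          ring
  refine ⟨?_, ?_⟩
  · have := hB.1.union hC.1
    rwa [union_compl_self, integrableOn_univ] at this
  · have := hB.1.union hC.1
    rw [union_compl_self, integrableOn_univ] at this
    rw [← integral_add_compl (measurableSet_ball (x := (0 : ℝ³)) (ε := ℓ)) this]
    linarith [hB.2, hC.2]

/-- **The positive part of `Δθₙ` has integral `O(ℓ²)`, uniformly in `ε ≤ ℓ` and `n`**:
`∫ (Δθₙ)₊ ≤ (17/2) vB ℓ²`. [folklore] -/
theorem integral_posPart_laplacian_testFn_le (hε : 0 < ε) (hℓ : 0 < ℓ) (hεℓ : ε ≤ ℓ) (hn : 0 < n) :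
    ∫ y, max ((Δ (testFn ε ℓ n)) y) 0 ≤ 17 / 2 * vB * ℓ ^ 2 := by
  have hεℓ2 : ε ^ 2 ≤ ℓ ^ 2 := pow_le_pow_left₀ hε.le hεℓ 2
  obtain ⟨I1, h1⟩ := integrable_major₁_and_le (ℓ := ℓ) hε hℓ
  obtain ⟨I2, h2⟩ := integrable_major₂_and_le hε hℓ
  have hLc : Continuous (Δ (testFn ε ℓ n)) := continuous_laplacian' (contDiff_testFn hε hℓ hεℓ2)
  have hLs : HasCompactSupport (Δ (testFn ε ℓ n)) :=
    hasCompactSupport_laplacian (hasCompactSupport_testFn hε hℓ hεℓ2 hn)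
  have ILpos : Integrable (fun y => max ((Δ (testFn ε ℓ n)) y) 0) :=
    (hLc.max continuous_const).integrable_of_hasCompactSupport
      (hLs.comp_left (g := fun t => max t 0) (by simp))
  have hpt : ∀ y, max ((Δ (testFn ε ℓ n)) y) 0 ≤ major₁ ε ℓ y + major₂ ε ℓ y := by
    intro y
    refine max_le ?_ (add_nonneg (major₁_nonneg y) (major₂_nonneg y))
    rw [laplacian_testFn hε hℓ hεℓ2 y]
    exact lap_testRate_le hε hℓ (sq_nonneg _) hεℓ hn
  calc ∫ y, max ((Δ (testFn ε ℓ n)) y) 0 ≤ ∫ y, (major₁ ε ℓ y + major₂ ε ℓ y) :=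
        integral_mono ILpos (I1.add I2) hpt
    _ = (∫ y, major₁ ε ℓ y) + ∫ y, major₂ ε ℓ y := integral_add I1 I2
    _ ≤ 5 / 2 * vB * ℓ ^ 2 + 6 * vB * ℓ ^ 2 := add_le_add h1 h2
    _ = 17 / 2 * vB * ℓ ^ 2 := by ring

end Majorant


/-! ## The core estimate at the origin, head-pressure case -/

section CoreHead

open InnerProductSpace
open scoped RealInnerProductSpace Laplacian

/-- Local notation for physical space `ℝ³ = EuclideanSpace ℝ (Fin 3)`. -/
local notation "ℝ³" => EuclideanSpace ℝ (Fin 3)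

variable {ε ℓ n : ℝ}

/-- **The core estimate, head-pressure case (`|v|²/2 + π ≤ K`), at the origin, before
`n → ∞`.** Same setting as `core_estimate_pressure`, with the one-sided bound on the Bernoulli
head; the conclusion controls the RADIAL energy:
`∫_{B_ℓ} ⟨ŷ, v⟩²/(4τ_ε) ≤ K Λ + (1/(2ℓ) + S) ∫|v|² + S ∫_{|y| ≤ 2n} |π|`. [folklore] -/
theorem core_estimate_head (hε : 0 < ε) (hℓ : 0 < ℓ) (hεℓ : ε ≤ ℓ) (hn : 0 < n) (hℓn : ℓ ≤ n)
    {v : ℝ³ → ℝ³} {π : ℝ³ → ℝ} {K Λ : ℝ} (hK0 : 0 ≤ K)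
    (hv : Continuous v) (hv2 : Integrable (fun y => ‖v y‖ ^ 2))
    (hπ : LocallyIntegrable π) (hK : ∀ y, ‖v y‖ ^ 2 / 2 + π y ≤ K)
    (hId : ∫ y, π y * (Δ (testFn ε ℓ n)) y =
      -∫ y, fderiv ℝ (fderiv ℝ (testFn ε ℓ n)) y (v y) (v y))
    (hΛ : ∫ y, max ((Δ (testFn ε ℓ n)) y) 0 ≤ Λ) :
    ∫ y in Metric.ball (0 : ℝ³) ℓ, radE v y / (4 * regR ε (‖y‖ ^ 2)) ≤
      K * Λ + (1 / (2 * ℓ) + 2 * stDerivBound / 3 * ℓ ^ 2 / n ^ 3) * (∫ y, ‖v y‖ ^ 2) +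
        2 * stDerivBound / 3 * ℓ ^ 2 / n ^ 3 *
          (∫ y in Metric.closedBall (0 : ℝ³) (2 * n), |π y|) := by
  have hεℓ2 : ε ^ 2 ≤ ℓ ^ 2 := pow_le_pow_left₀ hε.le hεℓ 2
  set θ := testFn ε ℓ n with hθ
  set S : ℝ := 2 * stDerivBound / 3 * ℓ ^ 2 / n ^ 3 with hS
  have hS0 : 0 ≤ S := by have := stDerivBound_nonneg; positivity
  set g1 : ℝ³ → ℝ := fun y => testRate ε ℓ n (‖y‖ ^ 2) with hg1
  set Rc : ℝ³ → ℝ := fun y =>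
    2 * testRate ε ℓ n (‖y‖ ^ 2) + 4 * ‖y‖ ^ 2 * testRateD ε ℓ n (‖y‖ ^ 2) with hRc
  set L : ℝ³ → ℝ := fun y => (Δ θ) y with hL
  set H : ℝ³ → ℝ := fun y => fderiv ℝ (fderiv ℝ θ) y (v y) (v y) with hH
  -- the two coefficients of the head identity
  set A : ℝ³ → ℝ := fun y => Rc y / 2 with hA
  set B : ℝ³ → ℝ := fun y => 2 * g1 y - Rc y / 2 with hB
  have hsmooth : ContDiff ℝ ∞ θ := contDiff_testFn hε hℓ hεℓ2
  have hsupp : HasCompactSupport θ := hasCompactSupport_testFn hε hℓ hεℓ2 hn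
  have hLc : Continuous L := continuous_laplacian' hsmooth
  have hLs : HasCompactSupport L := hasCompactSupport_laplacian hsupp
  have hHdec : ∀ y, H y = 2 * g1 y * tanE v y + Rc y * radE v y := fun y =>
    hessian_testFn_decomp hε hℓ hεℓ2 v y
  have hLform : ∀ y, L y = 6 * testRate ε ℓ n (‖y‖ ^ 2) + 4 * ‖y‖ ^ 2 * testRateD ε ℓ n (‖y‖ ^ 2) :=
    fun y => laplacian_testFn hε hℓ hεℓ2 y
  have hLRc : ∀ y, L y = 4 * g1 y + Rc y := fun y => by rw [hLform]; simp only [hg1, hRc]; ring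
  have hσ : ∀ y : ℝ³, (0 : ℝ) ≤ ‖y‖ ^ 2 := fun y => sq_nonneg _
  have hLlow : ∀ y, -S ≤ L y := fun y => by
    rw [hLform]; exact lap_testRate_ge hε hℓ (hσ y) hn
  have hLoff : ∀ y : ℝ³, (‖y‖ < n ∨ 2 * n < ‖y‖) → 0 ≤ L y := fun y hy => by
    rw [hLform]
    refine lap_testRate_nonneg_of hε hℓ (hσ y) hn ?_
    rcases hy with hy | hy
    · left; nlinarith [norm_nonneg y]
    · right; nlinarith [norm_nonneg y]
  have hRclow : ∀ y, -(1 / ℓ) - S ≤ Rc y := fun y => rad_testRate_ge hε hℓ (hσ y) hn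
  have hRcup : ∀ y, Rc y ≤ 1 / ε + S := fun y => rad_testRate_le hε hℓ (hσ y) hn
  have hg1nn : ∀ y, 0 ≤ g1 y := fun y => testRate_norm_sq_nonneg hε hℓ y
  have hg1le : ∀ y, g1 y ≤ 1 / (2 * ε) := fun y => testRate_norm_sq_le hε hℓ y
  have hg1c : Continuous g1 := continuous_testRate_norm_sq hε hℓ hεℓ2
  have hcore : ∀ y ∈ Metric.ball (0 : ℝ³) ℓ, 1 / (4 * regR ε (‖y‖ ^ 2)) ≤ g1 y := by
    intro y hy
    rw [Metric.mem_ball, dist_zero_right] at hy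
    have := inv_two_regR_le hε hℓ (hσ y) (by nlinarith [norm_nonneg y]) hℓn (n := n)
    have hτ0 : 0 < regR ε (‖y‖ ^ 2) := regR_pos (neg_eps_sq_lt hε (hσ y))
    rw [show 1 / (4 * regR ε (‖y‖ ^ 2)) = (1 / (2 * regR ε (‖y‖ ^ 2))) / 2 by field_simp; ring]
    linarith
  have hAlow : ∀ y, -(1 / (2 * ℓ)) - S / 2 ≤ A y := fun y => by
    simp only [hA]
    have := hRclow y
    have e : (1 : ℝ) / (2 * ℓ) = (1 / ℓ) / 2 := by field_simp
    rw [e]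
    linarith
  have hBlow : ∀ y, g1 y - S / 2 ≤ B y := fun y => by
    simp only [hB, hRc, hg1]
    have h := testRate_sub_ge hε hℓ (hσ y) hn (n := n)
    have e : stDerivBound / 3 * ℓ ^ 2 / n ^ 3 = S / 2 := by rw [hS]; ring
    rw [e] at h
    linarith
  have hAabs : ∀ y, |A y| ≤ (1 / ε + 1 / ℓ + S) / 2 := fun y => by
    simp only [hA]
    rw [abs_le]
    have : (0 : ℝ) < 1 / ε := by positivity
    have : (0 : ℝ) < 1 / ℓ := by positivity
    constructor
    · linarith [hRclow y]
    · linarith [hRcup y]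
  have hBabs : ∀ y, |B y| ≤ 1 / ε + (1 / ε + 1 / ℓ + S) / 2 := fun y => by
    simp only [hB]
    rw [abs_le]
    have : (0 : ℝ) < 1 / ε := by positivity
    have : (0 : ℝ) < 1 / ℓ := by positivity
    have := hg1nn y
    have := hg1le y
    have e : 2 * (1 / (2 * ε)) = 1 / ε := by field_simp
    constructor
    · nlinarith [hRcup y]
    · nlinarith [hRclow y]
  -- measurability
  have hRcm : Measurable Rc :=
    ((measurable_testRate.comp (measurable_norm.pow_const 2)).const_mul 2).add
      (((measurable_norm.pow_const 2).const_mul 4).mul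
        (measurable_testRateD.comp (measurable_norm.pow_const 2)))
  have hAm : Measurable A := hRcm.div_const 2
  have hBm : Measurable B := (hg1c.measurable.const_mul 2).sub (hRcm.div_const 2)
  -- integrability
  have I_H : Integrable H := by
    have hHfun : H = fun y => 2 * g1 y * tanE v y + Rc y * radE v y := funext hHdec
    refine integrable_of_abs_le_mul_norm_sq (C := 1 / ε + (1 / ε + 1 / ℓ + S)) hv2 ?_ (fun y => ?_)
    · rw [hHfun]
      exact (((hg1c.measurable.const_mul 2).mul (measurable_tanE hv)).add
        (hRcm.mul (measurable_radE hv))).aestronglyMeasurable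
    · rw [hHdec]
      have ht0 := tanE_nonneg v y
      have ht1 := tanE_le v y
      have hr0 := radE_nonneg v y
      have hr1 := radE_le v y
      have ha : |2 * g1 y * tanE v y| ≤ 1 / ε * ‖v y‖ ^ 2 := by
        rw [abs_of_nonneg (by have := hg1nn y; positivity)]
        calc 2 * g1 y * tanE v y ≤ 2 * (1 / (2 * ε)) * ‖v y‖ ^ 2 := by
              gcongr
              exact hg1le y
          _ = 1 / ε * ‖v y‖ ^ 2 := by field_simp
      have hb : |Rc y * radE v y| ≤ (1 / ε + 1 / ℓ + S) * ‖v y‖ ^ 2 := by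
        rw [abs_mul, abs_of_nonneg hr0]
        have hRabs : |Rc y| ≤ 1 / ε + 1 / ℓ + S := by
          have h := hAabs y
          simp only [hA, abs_div, abs_two] at h
          linarith
        calc |Rc y| * radE v y ≤ (1 / ε + 1 / ℓ + S) * radE v y :=
              mul_le_mul_of_nonneg_right hRabs hr0
          _ ≤ (1 / ε + 1 / ℓ + S) * ‖v y‖ ^ 2 := by
              refine mul_le_mul_of_nonneg_left hr1 ?_
              have : (0 : ℝ) < 1 / ε := by positivity
              have : (0 : ℝ) < 1 / ℓ := by positivity
              linarith
      calc |2 * g1 y * tanE v y + Rc y * radE v y|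
          ≤ |2 * g1 y * tanE v y| + |Rc y * radE v y| := abs_add_le _ _
        _ ≤ 1 / ε * ‖v y‖ ^ 2 + (1 / ε + 1 / ℓ + S) * ‖v y‖ ^ 2 := add_le_add ha hb
        _ = (1 / ε + (1 / ε + 1 / ℓ + S)) * ‖v y‖ ^ 2 := by ring
  have I_Atan : Integrable (fun y => A y * tanE v y) := by
    refine integrable_of_abs_le_mul_norm_sq (C := (1 / ε + 1 / ℓ + S) / 2) hv2
      ((hAm.mul (measurable_tanE hv)).aestronglyMeasurable) (fun y => ?_)
    rw [abs_mul, abs_of_nonneg (tanE_nonneg v y)]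
    exact mul_le_mul (hAabs y) (tanE_le v y) (tanE_nonneg v y) (by
      have : (0 : ℝ) < 1 / ε := by positivity
      have : (0 : ℝ) < 1 / ℓ := by positivity
      linarith)
  have I_Brad : Integrable (fun y => B y * radE v y) := by
    refine integrable_of_abs_le_mul_norm_sq (C := 1 / ε + (1 / ε + 1 / ℓ + S) / 2) hv2
      ((hBm.mul (measurable_radE hv)).aestronglyMeasurable) (fun y => ?_)
    rw [abs_mul, abs_of_nonneg (radE_nonneg v y)]
    exact mul_le_mul (hBabs y) (radE_le v y) (radE_nonneg v y) (by
      have : (0 : ℝ) < 1 / ε := by positivity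
      have : (0 : ℝ) < 1 / ℓ := by positivity
      linarith)
  have I_g1rad : Integrable (fun y => g1 y * radE v y) := by
    refine integrable_of_abs_le_mul_norm_sq (C := 1 / (2 * ε)) hv2
      ((hg1c.measurable.mul (measurable_radE hv)).aestronglyMeasurable) (fun y => ?_)
    rw [abs_mul, abs_of_nonneg (hg1nn y), abs_of_nonneg (radE_nonneg v y)]
    exact mul_le_mul (hg1le y) (radE_le v y) (radE_nonneg v y) (by positivity)
  have hπabs : LocallyIntegrable (fun y => |π y|) := by
    have h : LocallyIntegrable (fun y => ‖π y‖) := fun x => (hπ x).norm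
    simpa [Real.norm_eq_abs] using h
  have I_πL : Integrable (fun y => π y * L y) := by
    have := hπ.integrable_smul_right_of_hasCompactSupport hLc hLs
    simpa [smul_eq_mul] using this
  obtain ⟨ML, hML⟩ := hLc.bounded_above_of_compact_support hLs
  have I_v2L : Integrable (fun y => ‖v y‖ ^ 2 * L y) := by
    refine integrable_of_abs_le_mul_norm_sq (C := ML) hv2
      (((hv.norm.pow 2).mul hLc).aestronglyMeasurable) (fun y => ?_)
    rw [abs_mul, abs_of_nonneg (by positivity : (0 : ℝ) ≤ ‖v y‖ ^ 2), mul_comm]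
    exact mul_le_mul_of_nonneg_right ((Real.norm_eq_abs _).symm.le.trans (hML y)) (by positivity)
  have I_Lpos : Integrable (fun y => max (L y) 0) :=
    (hLc.max continuous_const).integrable_of_hasCompactSupport
      (hLs.comp_left (g := fun t => max t 0) (by simp))
  have hLnegc : Continuous fun y => max (-L y) 0 := hLc.neg.max continuous_const
  have hLnegs : HasCompactSupport fun y => max (-L y) 0 :=
    hLs.comp_left (g := fun t => max (-t) 0) (by simp)
  have I_Lneg : Integrable (fun y => max (-L y) 0) :=
    hLnegc.integrable_of_hasCompactSupport hLnegs
  have I_πLneg : Integrable (fun y => |π y| * max (-L y) 0) := by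
    have := hπabs.integrable_smul_right_of_hasCompactSupport hLnegc hLnegs
    simpa [smul_eq_mul] using this
  have I_L : Integrable L := hLc.integrable_of_hasCompactSupport hLs
  -- Step 1: the head identity `∫ (½|v|² L - H) = ∫ A tan + ∫ B rad`, and `∫ H = -∫ π L`
  have step1 : (∫ y, B y * radE v y) =
      (1 / 2) * (∫ y, ‖v y‖ ^ 2 * L y) + (∫ y, π y * L y) - ∫ y, A y * tanE v y := by
    have e1 : ∫ y, ((1 / 2) * (‖v y‖ ^ 2 * L y) - H y) =
        (∫ y, A y * tanE v y) + ∫ y, B y * radE v y := by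
      rw [← integral_add I_Atan I_Brad]
      refine integral_congr_ae (Eventually.of_forall fun y => ?_)
      show (1 / 2) * (‖v y‖ ^ 2 * L y) - H y = A y * tanE v y + B y * radE v y
      rw [hHdec, hLRc, ← tanE_add_radE v y]
      simp only [hA, hB]
      ring
    have e2 : ∫ y, ((1 / 2) * (‖v y‖ ^ 2 * L y) - H y) =
        (1 / 2) * (∫ y, ‖v y‖ ^ 2 * L y) - ∫ y, H y := by
      rw [integral_sub (I_v2L.const_mul _) I_H, MeasureTheory.integral_const_mul]
    have e3 : ∫ y, H y = -∫ y, π y * L y := by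
      rw [hH, hL, hId]; ring
    linarith
  -- Step 2: `½∫|v|²L + ∫πL ≤ K ∫L₊ + ∫|π| L₋` (from `K - π - ½|v|² ≥ 0`)
  have step2 : (1 / 2) * (∫ y, ‖v y‖ ^ 2 * L y) + (∫ y, π y * L y) ≤
      K * (∫ y, max (L y) 0) + ∫ y, |π y| * max (-L y) 0 := by
    have I1 : Integrable (fun y => K * max (L y) 0 + |π y| * max (-L y) 0) :=
      (I_Lpos.const_mul K).add I_πLneg
    have I2 : Integrable (fun y => (1 / 2) * (‖v y‖ ^ 2 * L y) + π y * L y) :=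
      (I_v2L.const_mul _).add I_πL
    have hint : ∫ y, (K * max (L y) 0 + |π y| * max (-L y) 0 -
        ((1 / 2) * (‖v y‖ ^ 2 * L y) + π y * L y)) =
        K * (∫ y, max (L y) 0) + (∫ y, |π y| * max (-L y) 0) -
          ((1 / 2) * (∫ y, ‖v y‖ ^ 2 * L y) + ∫ y, π y * L y) := by
      rw [integral_sub I1 I2, integral_add (I_Lpos.const_mul K) I_πLneg,
        integral_add (I_v2L.const_mul _) I_πL,
        MeasureTheory.integral_const_mul, MeasureTheory.integral_const_mul]
    have hnn : 0 ≤ ∫ y, (K * max (L y) 0 + |π y| * max (-L y) 0 -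
        ((1 / 2) * (‖v y‖ ^ 2 * L y) + π y * L y)) := by
      refine integral_nonneg fun y => ?_
      have hKy := hK y
      have hv0 : (0 : ℝ) ≤ ‖v y‖ ^ 2 := by positivity
      rcases le_total 0 (L y) with hLy | hLy
      · have e : K * max (L y) 0 + |π y| * max (-L y) 0 -
            ((1 / 2) * (‖v y‖ ^ 2 * L y) + π y * L y) = (K - π y - ‖v y‖ ^ 2 / 2) * L y := by
          rw [max_eq_left hLy, max_eq_right (by linarith)]; ring
        rw [e]
        exact mul_nonneg (by linarith) hLy
      · have e : K * max (L y) 0 + |π y| * max (-L y) 0 -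
            ((1 / 2) * (‖v y‖ ^ 2 * L y) + π y * L y) =
            (-L y) * (|π y| + π y + ‖v y‖ ^ 2 / 2) := by
          rw [max_eq_right hLy, max_eq_left (by linarith)]; ring
        rw [e]
        refine mul_nonneg (by linarith) ?_
        have h1 := neg_abs_le (π y)
        have h2 : (0 : ℝ) ≤ ‖v y‖ ^ 2 / 2 := by positivity
        linarith
    linarith
  -- Step 3: `∫ |π| L₋ ≤ S ∫_{|y| ≤ 2n} |π|`
  have step3 : ∫ y, |π y| * max (-L y) 0 ≤
      S * ∫ y in Metric.closedBall (0 : ℝ³) (2 * n), |π y| := by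
    have Iball : IntegrableOn (fun y => |π y|) (Metric.closedBall (0 : ℝ³) (2 * n)) :=
      hπabs.integrableOn_isCompact (isCompact_closedBall _ _)
    rw [← integral_indicator measurableSet_closedBall, ← MeasureTheory.integral_const_mul]
    refine integral_mono I_πLneg ((Iball.integrable_indicator measurableSet_closedBall).const_mul S)
      fun y => ?_
    by_cases hy : y ∈ Metric.closedBall (0 : ℝ³) (2 * n)
    · rw [indicator_of_mem hy]
      have h1 : max (-L y) 0 ≤ S := max_le (by linarith [hLlow y]) hS0
      calc |π y| * max (-L y) 0 ≤ |π y| * S := by gcongr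
        _ = S * |π y| := by ring
    · rw [indicator_of_notMem hy, mul_zero]
      rw [Metric.mem_closedBall, dist_zero_right, not_le] at hy
      have h0 : max (-L y) 0 = 0 := max_eq_right (by linarith [hLoff y (Or.inr hy)])
      rw [h0, mul_zero]
  -- Step 4: `-∫ A tan ≤ (1/(2ℓ) + S/2) ∫|v|²` and `∫ g1 rad ≤ ∫ B rad + (S/2) ∫ |v|²`
  have step4 : -(∫ y, A y * tanE v y) ≤ (1 / (2 * ℓ) + S / 2) * ∫ y, ‖v y‖ ^ 2 := by
    rw [← MeasureTheory.integral_neg, ← MeasureTheory.integral_const_mul]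
    refine integral_mono I_Atan.neg (hv2.const_mul _) fun y => ?_
    have h1 : -(A y * tanE v y) ≤ (1 / (2 * ℓ) + S / 2) * tanE v y := by
      rw [show -(A y * tanE v y) = (-A y) * tanE v y by ring]
      exact mul_le_mul_of_nonneg_right (by linarith [hAlow y]) (tanE_nonneg v y)
    have hc : 0 ≤ 1 / (2 * ℓ) + S / 2 := by positivity
    have h2 : (1 / (2 * ℓ) + S / 2) * tanE v y ≤ (1 / (2 * ℓ) + S / 2) * ‖v y‖ ^ 2 :=
      mul_le_mul_of_nonneg_left (tanE_le v y) hc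
    linarith
  have step4' : (∫ y, g1 y * radE v y) ≤ (∫ y, B y * radE v y) + S / 2 * ∫ y, ‖v y‖ ^ 2 := by
    rw [← MeasureTheory.integral_const_mul, ← integral_add I_Brad (hv2.const_mul _)]
    have I3 : Integrable (fun y => B y * radE v y + S / 2 * ‖v y‖ ^ 2) :=
      I_Brad.add (hv2.const_mul _)
    refine integral_mono I_g1rad I3 fun y => ?_
    have hr0 := radE_nonneg v y
    have hr1 := radE_le v y
    have h3 : (g1 y - S / 2) * radE v y ≤ B y * radE v y :=
      mul_le_mul_of_nonneg_right (hBlow y) hr0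
    have h4 : S / 2 * radE v y ≤ S / 2 * ‖v y‖ ^ 2 := mul_le_mul_of_nonneg_left hr1 (by positivity)
    calc g1 y * radE v y = (g1 y - S / 2) * radE v y + S / 2 * radE v y := by ring
      _ ≤ B y * radE v y + S / 2 * ‖v y‖ ^ 2 := add_le_add h3 h4
  -- Step 5: the left-hand side is at most `∫ g1 rad`
  have step5 : ∫ y in Metric.ball (0 : ℝ³) ℓ, radE v y / (4 * regR ε (‖y‖ ^ 2)) ≤
      ∫ y, g1 y * radE v y := by
    rw [← integral_indicator measurableSet_ball]
    refine integral_mono ?_ I_g1rad fun y => ?_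
    · refine (integrable_indicator_iff measurableSet_ball).2 ?_
      refine (integrable_of_abs_le_mul_norm_sq (C := 1 / (4 * ε)) hv2 ?_ fun y => ?_).integrableOn
      · exact ((measurable_radE hv).div ((continuous_regR_norm_sq ε).measurable.const_mul 4))
          |>.aestronglyMeasurable
      · have hτ : ε ≤ regR ε (‖y‖ ^ 2) := eps_le_regR hε.le (hσ y)
        have hτ0 : 0 < regR ε (‖y‖ ^ 2) := regR_pos (neg_eps_sq_lt hε (hσ y))
        have hr0 := radE_nonneg v y
        rw [abs_of_nonneg (by positivity)]
        calc radE v y / (4 * regR ε (‖y‖ ^ 2)) ≤ radE v y / (4 * ε) := by gcongr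
          _ ≤ ‖v y‖ ^ 2 / (4 * ε) := by gcongr; exact radE_le v y
          _ = 1 / (4 * ε) * ‖v y‖ ^ 2 := by ring
    · by_cases hy : y ∈ Metric.ball (0 : ℝ³) ℓ
      · rw [indicator_of_mem hy]
        have hr0 := radE_nonneg v y
        calc radE v y / (4 * regR ε (‖y‖ ^ 2)) = 1 / (4 * regR ε (‖y‖ ^ 2)) * radE v y := by ring
          _ ≤ g1 y * radE v y := mul_le_mul_of_nonneg_right (hcore y hy) hr0
      · rw [indicator_of_notMem hy]
        have := hg1nn y
        have := radE_nonneg v y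
        positivity
  -- combine
  have hKΛ : K * (∫ y, max (L y) 0) ≤ K * Λ := mul_le_mul_of_nonneg_left hΛ hK0
  calc ∫ y in Metric.ball (0 : ℝ³) ℓ, radE v y / (4 * regR ε (‖y‖ ^ 2))
      ≤ ∫ y, g1 y * radE v y := step5
    _ ≤ (∫ y, B y * radE v y) + S / 2 * ∫ y, ‖v y‖ ^ 2 := step4'
    _ = (1 / 2) * (∫ y, ‖v y‖ ^ 2 * L y) + (∫ y, π y * L y) - (∫ y, A y * tanE v y) +
          S / 2 * ∫ y, ‖v y‖ ^ 2 := by rw [step1]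
    _ ≤ (K * (∫ y, max (L y) 0) + ∫ y, |π y| * max (-L y) 0) +
          (1 / (2 * ℓ) + S / 2) * (∫ y, ‖v y‖ ^ 2) + S / 2 * (∫ y, ‖v y‖ ^ 2) := by
          linarith [step2, step4]
    _ = (K * (∫ y, max (L y) 0) + ∫ y, |π y| * max (-L y) 0) +
          (1 / (2 * ℓ) + S) * (∫ y, ‖v y‖ ^ 2) := by ring
    _ ≤ K * Λ + (1 / (2 * ℓ) + S) * (∫ y, ‖v y‖ ^ 2) +
          S * (∫ y in Metric.closedBall (0 : ℝ³) (2 * n), |π y|) := by linarith [hKΛ, step3]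

end CoreHead


/-! ## Scale-free bounds at the origin (`n → ∞`, `ε := r`) -/

section ScaleFree

open InnerProductSpace
open scoped RealInnerProductSpace Laplacian

/-- Local notation for physical space `ℝ³ = EuclideanSpace ℝ (Fin 3)`. -/
local notation "ℝ³" => EuclideanSpace ℝ (Fin 3)

/-- **Standing hypotheses on a velocity/pressure slice** `(v, π)` on `ℝ³`: `v` continuous with
finite energy, `π` continuous with at most linear growth of `∫_{B(c,R)} |π|` in `R` (uniformly in
the centre; e.g. `π ∈ L^{3/2}`), and the pressure Poisson equation tested against every test
function: `∫ π Δθ = -∫ D²θ(v, v)`. [folklore] -/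
structure SliceHyp (v : ℝ³ → ℝ³) (π : ℝ³ → ℝ) (A B : ℝ) : Prop where
  cont : Continuous v
  energy : Integrable (fun y => ‖v y‖ ^ 2)
  contπ : Continuous π
  growth : ∀ (c : ℝ³) (R : ℝ), 0 < R → ∫ y in Metric.closedBall c R, |π y| ≤ A * R + B
  ident : ∀ θ : ℝ³ → ℝ, FunctionSpaces.IsTestFunctionOn (⊤ : TopologicalSpace.Opens ℝ³) θ →
    ∫ y, π y * (Δ θ) y = -∫ y, fderiv ℝ (fderiv ℝ θ) y (v y) (v y)

variable {v : ℝ³ → ℝ³} {π : ℝ³ → ℝ} {A B K : ℝ}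

/-- The shell constant tends to zero: `S(n) (E + 2An + B) → 0` as `n → ∞`. [folklore] -/
theorem tendsto_shell_error (ℓ E A B : ℝ) :
    Tendsto (fun n : ℝ => 2 * stDerivBound / 3 * ℓ ^ 2 / n ^ 3 * (E + (A * (2 * n) + B)))
      atTop (𝓝 0) := by
  have h3 : Tendsto (fun n : ℝ => (2 * stDerivBound / 3 * ℓ ^ 2 * (E + B)) / n ^ 3) atTop (𝓝 0) :=
    tendsto_const_nhds.div_atTop (tendsto_pow_atTop three_ne_zero)
  have h2 : Tendsto (fun n : ℝ => (2 * stDerivBound / 3 * ℓ ^ 2 * (2 * A)) / n ^ 2) atTop (𝓝 0) :=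
    tendsto_const_nhds.div_atTop (tendsto_pow_atTop two_ne_zero)
  have h := h3.add h2
  rw [add_zero] at h
  refine h.congr' ?_
  filter_upwards [eventually_gt_atTop 0] with n hn
  field_simp
  ring

/-- **Scale-free tangential bound at the origin (pressure case).** Under `SliceHyp` and
`π ≥ -K` (`K ≥ 0`), for `0 < r ≤ ℓ`:
`∫_{B_r} |v_tan|² ≤ 2√2 · r · (K · (17/2) vB ℓ² + ℓ⁻¹ ∫ |v|²)`. [folklore] -/
theorem tan_energy_ball_le (h : SliceHyp v π A B) (hK0 : 0 ≤ K)
    (hK : ∀ y, -K ≤ π y) {ℓ r : ℝ} (hℓ : 0 < ℓ) (hr : 0 < r) (hrℓ : r ≤ ℓ) :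
    ∫ y in Metric.ball (0 : ℝ³) r, tanE v y ≤
      2 * Real.sqrt 2 * r * (K * (17 / 2 * vB * ℓ ^ 2) + (1 / ℓ) * ∫ y, ‖v y‖ ^ 2) := by
  set E : ℝ := ∫ y, ‖v y‖ ^ 2 with hE
  set M : ℝ := K * (17 / 2 * vB * ℓ ^ 2) + (1 / ℓ) * E with hM
  have hE0 : 0 ≤ E := integral_nonneg fun y => by positivity
  -- the limit `n → ∞` of the core estimate with `ε := r`
  have claim : ∫ y in Metric.ball (0 : ℝ³) ℓ, tanE v y / (2 * regR r (‖y‖ ^ 2)) ≤ M := by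
    refine le_of_forall_pos_le_add fun δ hδ => ?_
    have hev := ((tendsto_shell_error ℓ E A B).eventually (Iio_mem_nhds hδ)).and
      (eventually_ge_atTop (max ℓ 1))
    obtain ⟨n, hn, hnℓ⟩ := hev.exists
    have hn1 : 1 ≤ n := (le_max_right _ _).trans hnℓ
    have hn0 : 0 < n := one_pos.trans_le hn1
    have hℓn : ℓ ≤ n := (le_max_left _ _).trans hnℓ
    set S : ℝ := 2 * stDerivBound / 3 * ℓ ^ 2 / n ^ 3 with hS
    have hS0 : 0 ≤ S := by have := stDerivBound_nonneg; positivity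
    have hr2 : r ^ 2 ≤ ℓ ^ 2 := pow_le_pow_left₀ hr.le hrℓ 2
    have hcore := core_estimate_pressure hr hℓ hrℓ hn0 hℓn hK0 h.cont h.energy
      h.contπ.locallyIntegrable hK (h.ident _ (isTestFunctionOn_testFn hr hℓ hr2 hn0))
      (integral_posPart_laplacian_testFn_le hr hℓ hrℓ hn0)
    have hgrowth : ∫ y in Metric.closedBall (0 : ℝ³) (2 * n), |π y| ≤ A * (2 * n) + B :=
      h.growth 0 (2 * n) (by linarith)
    have hSn : S * (E + (A * (2 * n) + B)) < δ := hn
    have h1 : S * (∫ y in Metric.closedBall (0 : ℝ³) (2 * n), |π y|) ≤ S * (A * (2 * n) + B) :=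
      mul_le_mul_of_nonneg_left hgrowth hS0
    have h2 : (1 / ℓ + S) * E = (1 / ℓ) * E + S * E := by ring
    rw [← hS] at hcore
    nlinarith
  -- restrict to the small ball and compare `τ_r ≤ √2 r` there
  have hsub : ∫ y in Metric.ball (0 : ℝ³) r, tanE v y / (2 * regR r (‖y‖ ^ 2)) ≤ M := by
    refine le_trans (setIntegral_mono_set ?_ ?_ ?_) claim
    · refine (integrable_of_abs_le_mul_norm_sq (C := 1 / (2 * r)) h.energy ?_ fun y => ?_).integrableOn
      · exact ((measurable_tanE h.cont).div
          ((continuous_regR_norm_sq r).measurable.const_mul 2)).aestronglyMeasurable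
      · have hτ : r ≤ regR r (‖y‖ ^ 2) := eps_le_regR hr.le (sq_nonneg _)
        have hτ0 : 0 < regR r (‖y‖ ^ 2) := regR_pos (neg_eps_sq_lt hr (sq_nonneg _))
        have ht0 := tanE_nonneg v y
        rw [abs_of_nonneg (by positivity)]
        calc tanE v y / (2 * regR r (‖y‖ ^ 2)) ≤ tanE v y / (2 * r) := by gcongr
          _ ≤ ‖v y‖ ^ 2 / (2 * r) := by gcongr; exact tanE_le v y
          _ = 1 / (2 * r) * ‖v y‖ ^ 2 := by ring
    · refine Eventually.of_forall fun y => ?_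
      have := tanE_nonneg v y
      have := regR_nonneg r (‖y‖ ^ 2)
      positivity
    · exact Eventually.of_forall (Metric.ball_subset_ball hrℓ)
  have hlow : (1 / (2 * Real.sqrt 2 * r)) * ∫ y in Metric.ball (0 : ℝ³) r, tanE v y ≤
      ∫ y in Metric.ball (0 : ℝ³) r, tanE v y / (2 * regR r (‖y‖ ^ 2)) := by
    rw [← integral_const_mul]
    refine setIntegral_mono_on ?_ ?_ measurableSet_ball fun y hy => ?_
    · exact ((integrable_of_abs_le_mul_norm_sq (C := 1) h.energy
        (measurable_tanE h.cont).aestronglyMeasurable fun y => by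
          rw [abs_of_nonneg (tanE_nonneg v y), one_mul]; exact tanE_le v y).const_mul _).integrableOn
    · refine (integrable_of_abs_le_mul_norm_sq (C := 1 / (2 * r)) h.energy ?_ fun y => ?_).integrableOn
      · exact ((measurable_tanE h.cont).div
          ((continuous_regR_norm_sq r).measurable.const_mul 2)).aestronglyMeasurable
      · have hτ : r ≤ regR r (‖y‖ ^ 2) := eps_le_regR hr.le (sq_nonneg _)
        have hτ0 : 0 < regR r (‖y‖ ^ 2) := regR_pos (neg_eps_sq_lt hr (sq_nonneg _))
        have ht0 := tanE_nonneg v y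
        rw [abs_of_nonneg (by positivity)]
        calc tanE v y / (2 * regR r (‖y‖ ^ 2)) ≤ tanE v y / (2 * r) := by gcongr
          _ ≤ ‖v y‖ ^ 2 / (2 * r) := by gcongr; exact tanE_le v y
          _ = 1 / (2 * r) * ‖v y‖ ^ 2 := by ring
    · rw [Metric.mem_ball, dist_zero_right] at hy
      have hτ : regR r (‖y‖ ^ 2) ≤ Real.sqrt 2 * r := by
        refine regR_le_of_le_sq ?_ (by positivity)
        rw [mul_pow, Real.sq_sqrt (by norm_num : (0:ℝ) ≤ 2)]
        nlinarith [norm_nonneg y]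
      have hτ0 : 0 < regR r (‖y‖ ^ 2) := regR_pos (neg_eps_sq_lt hr (sq_nonneg _))
      have ht0 := tanE_nonneg v y
      have key : 1 / (2 * Real.sqrt 2 * r) * tanE v y ≤ tanE v y / (2 * regR r (‖y‖ ^ 2)) := by
        rw [div_eq_mul_inv (tanE v y), mul_comm (tanE v y)]
        refine mul_le_mul_of_nonneg_right ?_ ht0
        rw [one_div]
        exact inv_anti₀ (by positivity) (by nlinarith)
      simpa [one_div] using key
  have hpos : 0 < 2 * Real.sqrt 2 * r := by positivity
  have := hlow.trans hsub
  rwa [one_div, inv_mul_le_iff₀ hpos] at this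

/-- **Scale-free radial bound at the origin (head-pressure case).** Under `SliceHyp` and
`|v|²/2 + π ≤ K` (`K ≥ 0`), for `0 < r ≤ ℓ`:
`∫_{B_r} ⟨ŷ, v⟩² ≤ 4√2 · r · (K · (17/2) vB ℓ² + (2ℓ)⁻¹ ∫ |v|²)`. [folklore] -/
theorem rad_energy_ball_le (h : SliceHyp v π A B) (hK0 : 0 ≤ K)
    (hK : ∀ y, ‖v y‖ ^ 2 / 2 + π y ≤ K) {ℓ r : ℝ} (hℓ : 0 < ℓ) (hr : 0 < r) (hrℓ : r ≤ ℓ) :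
    ∫ y in Metric.ball (0 : ℝ³) r, radE v y ≤
      4 * Real.sqrt 2 * r * (K * (17 / 2 * vB * ℓ ^ 2) + (1 / (2 * ℓ)) * ∫ y, ‖v y‖ ^ 2) := by
  set E : ℝ := ∫ y, ‖v y‖ ^ 2 with hE
  set M : ℝ := K * (17 / 2 * vB * ℓ ^ 2) + (1 / (2 * ℓ)) * E with hM
  have hE0 : 0 ≤ E := integral_nonneg fun y => by positivity
  have claim : ∫ y in Metric.ball (0 : ℝ³) ℓ, radE v y / (4 * regR r (‖y‖ ^ 2)) ≤ M := by
    refine le_of_forall_pos_le_add fun δ hδ => ?_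
    have hev := ((tendsto_shell_error ℓ E A B).eventually (Iio_mem_nhds hδ)).and
      (eventually_ge_atTop (max ℓ 1))
    obtain ⟨n, hn, hnℓ⟩ := hev.exists
    have hn1 : 1 ≤ n := (le_max_right _ _).trans hnℓ
    have hn0 : 0 < n := one_pos.trans_le hn1
    have hℓn : ℓ ≤ n := (le_max_left _ _).trans hnℓ
    set S : ℝ := 2 * stDerivBound / 3 * ℓ ^ 2 / n ^ 3 with hS
    have hS0 : 0 ≤ S := by have := stDerivBound_nonneg; positivity
    have hr2 : r ^ 2 ≤ ℓ ^ 2 := pow_le_pow_left₀ hr.le hrℓ 2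
    have hcore := core_estimate_head hr hℓ hrℓ hn0 hℓn hK0 h.cont h.energy
      h.contπ.locallyIntegrable hK (h.ident _ (isTestFunctionOn_testFn hr hℓ hr2 hn0))
      (integral_posPart_laplacian_testFn_le hr hℓ hrℓ hn0)
    have hgrowth : ∫ y in Metric.closedBall (0 : ℝ³) (2 * n), |π y| ≤ A * (2 * n) + B :=
      h.growth 0 (2 * n) (by linarith)
    have hSn : S * (E + (A * (2 * n) + B)) < δ := hn
    have h1 : S * (∫ y in Metric.closedBall (0 : ℝ³) (2 * n), |π y|) ≤ S * (A * (2 * n) + B) :=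
      mul_le_mul_of_nonneg_left hgrowth hS0
    have h2 : (1 / (2 * ℓ) + S) * E = (1 / (2 * ℓ)) * E + S * E := by ring
    rw [← hS] at hcore
    nlinarith
  have hsub : ∫ y in Metric.ball (0 : ℝ³) r, radE v y / (4 * regR r (‖y‖ ^ 2)) ≤ M := by
    refine le_trans (setIntegral_mono_set ?_ ?_ ?_) claim
    · refine (integrable_of_abs_le_mul_norm_sq (C := 1 / (4 * r)) h.energy ?_ fun y => ?_).integrableOn
      · exact ((measurable_radE h.cont).div
          ((continuous_regR_norm_sq r).measurable.const_mul 4)).aestronglyMeasurable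
      · have hτ : r ≤ regR r (‖y‖ ^ 2) := eps_le_regR hr.le (sq_nonneg _)
        have hτ0 : 0 < regR r (‖y‖ ^ 2) := regR_pos (neg_eps_sq_lt hr (sq_nonneg _))
        have ht0 := radE_nonneg v y
        rw [abs_of_nonneg (by positivity)]
        calc radE v y / (4 * regR r (‖y‖ ^ 2)) ≤ radE v y / (4 * r) := by gcongr
          _ ≤ ‖v y‖ ^ 2 / (4 * r) := by gcongr; exact radE_le v y
          _ = 1 / (4 * r) * ‖v y‖ ^ 2 := by ring
    · refine Eventually.of_forall fun y => ?_
      have := radE_nonneg v y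
      have := regR_nonneg r (‖y‖ ^ 2)
      positivity
    · exact Eventually.of_forall (Metric.ball_subset_ball hrℓ)
  have hlow : (1 / (4 * Real.sqrt 2 * r)) * ∫ y in Metric.ball (0 : ℝ³) r, radE v y ≤
      ∫ y in Metric.ball (0 : ℝ³) r, radE v y / (4 * regR r (‖y‖ ^ 2)) := by
    rw [← integral_const_mul]
    refine setIntegral_mono_on ?_ ?_ measurableSet_ball fun y hy => ?_
    · exact ((integrable_of_abs_le_mul_norm_sq (C := 1) h.energy
        (measurable_radE h.cont).aestronglyMeasurable fun y => by
          rw [abs_of_nonneg (radE_nonneg v y), one_mul]; exact radE_le v y).const_mul _).integrableOn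
    · refine (integrable_of_abs_le_mul_norm_sq (C := 1 / (4 * r)) h.energy ?_ fun y => ?_).integrableOn
      · exact ((measurable_radE h.cont).div
          ((continuous_regR_norm_sq r).measurable.const_mul 4)).aestronglyMeasurable
      · have hτ : r ≤ regR r (‖y‖ ^ 2) := eps_le_regR hr.le (sq_nonneg _)
        have hτ0 : 0 < regR r (‖y‖ ^ 2) := regR_pos (neg_eps_sq_lt hr (sq_nonneg _))
        have ht0 := radE_nonneg v y
        rw [abs_of_nonneg (by positivity)]
        calc radE v y / (4 * regR r (‖y‖ ^ 2)) ≤ radE v y / (4 * r) := by gcongr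
          _ ≤ ‖v y‖ ^ 2 / (4 * r) := by gcongr; exact radE_le v y
          _ = 1 / (4 * r) * ‖v y‖ ^ 2 := by ring
    · rw [Metric.mem_ball, dist_zero_right] at hy
      have hτ : regR r (‖y‖ ^ 2) ≤ Real.sqrt 2 * r := by
        refine regR_le_of_le_sq ?_ (by positivity)
        rw [mul_pow, Real.sq_sqrt (by norm_num : (0:ℝ) ≤ 2)]
        nlinarith [norm_nonneg y]
      have hτ0 : 0 < regR r (‖y‖ ^ 2) := regR_pos (neg_eps_sq_lt hr (sq_nonneg _))
      have ht0 := radE_nonneg v y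
      have key : 1 / (4 * Real.sqrt 2 * r) * radE v y ≤ radE v y / (4 * regR r (‖y‖ ^ 2)) := by
        rw [div_eq_mul_inv (radE v y), mul_comm (radE v y)]
        refine mul_le_mul_of_nonneg_right ?_ ht0
        rw [one_div]
        exact inv_anti₀ (by positivity) (by nlinarith)
      simpa [one_div] using key
  have hpos : 0 < 4 * Real.sqrt 2 * r := by positivity
  have := hlow.trans hsub
  rwa [one_div, inv_mul_le_iff₀ hpos] at this

end ScaleFree


/-! ## Arbitrary centres: translation, and recombination of three centres -/

section Centres

open InnerProductSpace
open scoped RealInnerProductSpace Laplacian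

/-- Local notation for physical space `ℝ³ = EuclideanSpace ℝ (Fin 3)`. -/
local notation "ℝ³" => EuclideanSpace ℝ (Fin 3)

/-! ### Translation -/

/-- `D(f(· - c))(x) = Df(x - c)`. [folklore] -/
theorem fderiv_comp_sub_const' (f : ℝ³ → ℝ) (c x : ℝ³) :
    fderiv ℝ (fun w => f (w - c)) x = fderiv ℝ f (x - c) := by
  simpa [sub_eq_add_neg] using fderiv_comp_add_right (f := f) (x := x) (-c)

/-- `D²(f(· - c))(x) = D²f(x - c)`. [folklore] -/
theorem fderiv_fderiv_comp_sub_const' (f : ℝ³ → ℝ) (c x : ℝ³) :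
    fderiv ℝ (fderiv ℝ (fun w => f (w - c))) x = fderiv ℝ (fderiv ℝ f) (x - c) := by
  have h1 : fderiv ℝ (fun w => f (w - c)) = fun w => fderiv ℝ f (w - c) :=
    funext fun w => fderiv_comp_sub_const' f c w
  rw [h1]
  simpa [sub_eq_add_neg] using fderiv_comp_add_right (f := fderiv ℝ f) (x := x) (-c)

/-- `Δ(f(· - c))(x) = Δf(x - c)`. [folklore] -/
theorem laplacian_comp_sub_const' (f : ℝ³ → ℝ) (c x : ℝ³) :
    (Δ (fun w => f (w - c))) x = (Δ f) (x - c) := by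
  rw [congrFun (laplacian_eq_iteratedFDeriv_orthonormalBasis (fun w => f (w - c))
      (stdOrthonormalBasis ℝ ℝ³)) x,
    congrFun (laplacian_eq_iteratedFDeriv_orthonormalBasis f (stdOrthonormalBasis ℝ ℝ³)) (x - c)]
  simp only [iteratedFDeriv_two_apply, fderiv_fderiv_comp_sub_const']

/-- Translates of test functions are test functions. [folklore] -/
theorem isTestFunctionOn_comp_sub_const {θ : ℝ³ → ℝ}
    (hθ : FunctionSpaces.IsTestFunctionOn (⊤ : TopologicalSpace.Opens ℝ³) θ) (c : ℝ³) :
    FunctionSpaces.IsTestFunctionOn (⊤ : TopologicalSpace.Opens ℝ³) (fun w => θ (w - c)) where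
  contDiff := hθ.contDiff.comp (contDiff_id.sub contDiff_const)
  hasCompactSupport := by
    simpa [Function.comp_def, sub_eq_add_neg] using
      hθ.hasCompactSupport.comp_homeomorph (Homeomorph.addRight (-c))
  tsupport_subset := by simp

/-- Set integrals over translated balls. [folklore] -/
theorem setIntegral_ball_comp_add (g : ℝ³ → ℝ) (c : ℝ³) (R : ℝ) :
    ∫ y in Metric.ball (0 : ℝ³) R, g (y + c) = ∫ x in Metric.ball c R, g x := by
  rw [← integral_indicator measurableSet_ball, ← integral_indicator measurableSet_ball]
  have h : (fun y => (Metric.ball (0 : ℝ³) R).indicator (fun y => g (y + c)) y) =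
      fun y => (Metric.ball c R).indicator g (y + c) := by
    funext y
    by_cases hy : y ∈ Metric.ball (0 : ℝ³) R
    · have hy' : y + c ∈ Metric.ball c R := by
        rw [Metric.mem_ball, dist_zero_right] at hy
        rwa [Metric.mem_ball, dist_eq_norm, add_sub_cancel_right]
      rw [indicator_of_mem hy, indicator_of_mem hy']
    · have hy' : y + c ∉ Metric.ball c R := by
        rw [Metric.mem_ball, dist_zero_right] at hy
        rwa [Metric.mem_ball, dist_eq_norm, add_sub_cancel_right]
      rw [indicator_of_notMem hy, indicator_of_notMem hy']
  rw [h]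
  exact integral_add_right_eq_self _ c

/-- Set integrals over translated closed balls. [folklore] -/
theorem setIntegral_closedBall_comp_add (g : ℝ³ → ℝ) (c' c : ℝ³) (R : ℝ) :
    ∫ y in Metric.closedBall c' R, g (y + c) = ∫ x in Metric.closedBall (c' + c) R, g x := by
  rw [← integral_indicator measurableSet_closedBall, ← integral_indicator measurableSet_closedBall]
  have h : (fun y => (Metric.closedBall c' R).indicator (fun y => g (y + c)) y) =
      fun y => (Metric.closedBall (c' + c) R).indicator g (y + c) := by
    funext y
    have hd : dist (y + c) (c' + c) = dist y c' := by simp [dist_eq_norm]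
    by_cases hy : y ∈ Metric.closedBall c' R
    · have hy' : y + c ∈ Metric.closedBall (c' + c) R := by
        rw [Metric.mem_closedBall] at hy ⊢; rwa [hd]
      rw [indicator_of_mem hy, indicator_of_mem hy']
    · have hy' : y + c ∉ Metric.closedBall (c' + c) R := by
        rw [Metric.mem_closedBall] at hy ⊢; rwa [hd]
      rw [indicator_of_notMem hy, indicator_of_notMem hy']
  rw [h]
  exact integral_add_right_eq_self _ c

variable {v : ℝ³ → ℝ³} {π : ℝ³ → ℝ} {A B K : ℝ}

/-- **`SliceHyp` is translation invariant.** [folklore] -/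
theorem SliceHyp.translate (h : SliceHyp v π A B) (c : ℝ³) :
    SliceHyp (fun y => v (y + c)) (fun y => π (y + c)) A B where
  cont := h.cont.comp (continuous_id.add continuous_const)
  energy := h.energy.comp_add_right c
  contπ := h.contπ.comp (continuous_id.add continuous_const)
  growth := fun c' R hR => by
    rw [setIntegral_closedBall_comp_add (fun y => |π y|) c' c R]
    exact h.growth (c' + c) R hR
  ident := fun θ hθ => by
    have h1 := h.ident _ (isTestFunctionOn_comp_sub_const hθ c)
    simp only [laplacian_comp_sub_const', fderiv_fderiv_comp_sub_const'] at h1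
    have e1 : ∫ y, π (y + c) * (Δ θ) y = ∫ x, π x * (Δ θ) (x - c) := by
      have := integral_add_right_eq_self (μ := (volume : Measure ℝ³))
        (fun x => π x * (Δ θ) (x - c)) c
      simpa using this
    have e2 : ∫ y, fderiv ℝ (fderiv ℝ θ) y (v (y + c)) (v (y + c)) =
        ∫ x, fderiv ℝ (fderiv ℝ θ) (x - c) (v x) (v x) := by
      have := integral_add_right_eq_self (μ := (volume : Measure ℝ³))
        (fun x => fderiv ℝ (fderiv ℝ θ) (x - c) (v x) (v x)) c
      simpa using this
    rw [e1, e2]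
    exact h1

/-- The energy is translation invariant. [folklore] -/
theorem integral_norm_sq_comp_add (v : ℝ³ → ℝ³) (c : ℝ³) :
    ∫ y, ‖v (y + c)‖ ^ 2 = ∫ y, ‖v y‖ ^ 2 :=
  integral_add_right_eq_self (fun y => ‖v y‖ ^ 2) c

/-! ### Geometry of three shifted centres -/

/-- **Perturbation of a unit vector**: for a unit vector `e`, `D > 0` and any `z`,
`‖ ‖z‖⁻¹ z - e ‖ ≤ 2 ‖z - D e‖ / D`. [folklore] -/
theorem norm_normalize_sub_le {e z : ℝ³} (he : ‖e‖ = 1) {D : ℝ} (hD : 0 < D) :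
    ‖(‖z‖⁻¹) • z - e‖ ≤ 2 * ‖z - D • e‖ / D := by
  have hDe : ‖D • e‖ = D := by rw [norm_smul, he, mul_one, Real.norm_of_nonneg hD.le]
  rcases eq_or_ne z 0 with rfl | hz
  · simp only [norm_zero, inv_zero, zero_smul, zero_sub, norm_neg, he]
    rw [hDe, le_div_iff₀ hD]
    linarith
  · have hz0 : 0 < ‖z‖ := norm_pos_iff.2 hz
    -- `‖z/‖z‖ - z/D‖ = |D - ‖z‖| / D ≤ ‖D e - z‖ / D`
    have h1 : ‖(‖z‖⁻¹) • z - D⁻¹ • z‖ ≤ ‖z - D • e‖ / D := by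
      rw [← sub_smul, norm_smul, Real.norm_eq_abs]
      have e1 : |‖z‖⁻¹ - D⁻¹| * ‖z‖ = |D - ‖z‖| / D := by
        rw [show ‖z‖⁻¹ - D⁻¹ = (D - ‖z‖) / (‖z‖ * D) by field_simp, abs_div,
          abs_of_pos (by positivity : 0 < ‖z‖ * D)]
        field_simp
      rw [e1]
      refine div_le_div_of_nonneg_right ?_ hD.le
      have := abs_norm_sub_norm_le (D • e) z
      rwa [hDe, ← norm_neg (D • e - z), neg_sub] at this
    have h2 : ‖D⁻¹ • z - e‖ = ‖z - D • e‖ / D := by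
      have e2 : D⁻¹ • z - e = D⁻¹ • (z - D • e) := by
        rw [smul_sub, smul_smul, inv_mul_cancel₀ hD.ne', one_smul]
      rw [e2, norm_smul, Real.norm_of_nonneg (inv_nonneg.2 hD.le)]
      field_simp
    calc ‖(‖z‖⁻¹) • z - e‖ ≤ ‖(‖z‖⁻¹) • z - D⁻¹ • z‖ + ‖D⁻¹ • z - e‖ := norm_sub_le_norm_sub_add_norm_sub _ _ _
      _ ≤ ‖z - D • e‖ / D + ‖z - D • e‖ / D := by rw [h2]; exact add_le_add h1 le_rfl
      _ = 2 * ‖z - D • e‖ / D := by ring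

/-- **The radial part seen from a perturbed direction (upper bound)**: with
`δ = ‖ ‖z‖⁻¹ z - e ‖` and `‖e‖ = 1`, `⟨z, w⟩²/‖z‖² ≤ ⟨e, w⟩² + (2δ + δ²) ‖w‖²`. [folklore] -/
theorem inner_sq_div_le {e z : ℝ³} (he : ‖e‖ = 1) (w : ℝ³) :
    ⟪z, w⟫ ^ 2 / ‖z‖ ^ 2 ≤
      ⟪e, w⟫ ^ 2 + (2 * ‖(‖z‖⁻¹) • z - e‖ + ‖(‖z‖⁻¹) • z - e‖ ^ 2) * ‖w‖ ^ 2 := by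
  set δ := ‖(‖z‖⁻¹) • z - e‖ with hδ
  have hδ0 : 0 ≤ δ := norm_nonneg _
  rcases eq_or_ne z 0 with rfl | hz
  · simp only [inner_zero_left, norm_zero]
    norm_num
    positivity
  · have hz0 : 0 < ‖z‖ := norm_pos_iff.2 hz
    set u : ℝ³ := (‖z‖⁻¹) • z with hu
    have hzu : ⟪z, w⟫ ^ 2 / ‖z‖ ^ 2 = ⟪u, w⟫ ^ 2 := by
      rw [hu, real_inner_smul_left]
      field_simp
    rw [hzu]
    have hew : |⟪e, w⟫| ≤ ‖w‖ := by
      have := abs_real_inner_le_norm e w; rwa [he, one_mul] at this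
    have hue : |⟪u, w⟫| ≤ |⟪e, w⟫| + δ * ‖w‖ := by
      have e1 : ⟪u, w⟫ = ⟪e, w⟫ + ⟪u - e, w⟫ := by rw [inner_sub_left]; ring
      rw [e1]
      refine (abs_add_le _ _).trans (add_le_add le_rfl ?_)
      exact abs_real_inner_le_norm _ _
    have hnn : 0 ≤ |⟪e, w⟫| + δ * ‖w‖ := by positivity
    calc ⟪u, w⟫ ^ 2 = |⟪u, w⟫| ^ 2 := (sq_abs _).symm
      _ ≤ (|⟪e, w⟫| + δ * ‖w‖) ^ 2 := pow_le_pow_left₀ (abs_nonneg _) hue 2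
      _ = ⟪e, w⟫ ^ 2 + 2 * δ * (‖w‖ * |⟪e, w⟫|) + δ ^ 2 * ‖w‖ ^ 2 := by rw [← sq_abs ⟪e, w⟫]; ring
      _ ≤ ⟪e, w⟫ ^ 2 + 2 * δ * (‖w‖ * ‖w‖) + δ ^ 2 * ‖w‖ ^ 2 := by gcongr
      _ = ⟪e, w⟫ ^ 2 + (2 * δ + δ ^ 2) * ‖w‖ ^ 2 := by ring

/-- **The radial part seen from a perturbed direction (lower bound)**:
`⟨z, w⟩²/‖z‖² ≥ ⟨e, w⟩² - 2δ ‖w‖²` (for `z ≠ 0`). [folklore] -/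
theorem inner_sq_div_ge {e z : ℝ³} (he : ‖e‖ = 1) (hz : z ≠ 0) (w : ℝ³) :
    ⟪e, w⟫ ^ 2 - 2 * ‖(‖z‖⁻¹) • z - e‖ * ‖w‖ ^ 2 ≤ ⟪z, w⟫ ^ 2 / ‖z‖ ^ 2 := by
  set δ := ‖(‖z‖⁻¹) • z - e‖ with hδ
  have hδ0 : 0 ≤ δ := norm_nonneg _
  have hz0 : 0 < ‖z‖ := norm_pos_iff.2 hz
  set u : ℝ³ := (‖z‖⁻¹) • z with hu
  have hzu : ⟪z, w⟫ ^ 2 / ‖z‖ ^ 2 = ⟪u, w⟫ ^ 2 := by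
    rw [hu, real_inner_smul_left]
    field_simp
  rw [hzu]
  have hew : |⟪e, w⟫| ≤ ‖w‖ := by
    have := abs_real_inner_le_norm e w; rwa [he, one_mul] at this
  -- `|⟨e,w⟩| ≤ |⟨u,w⟩| + δ‖w‖`
  have heu : |⟪e, w⟫| ≤ |⟪u, w⟫| + δ * ‖w‖ := by
    have e1 : ⟪e, w⟫ = ⟪u, w⟫ + ⟪e - u, w⟫ := by rw [inner_sub_left]; ring
    rw [e1]
    refine (abs_add_le _ _).trans (add_le_add le_rfl ?_)
    calc |⟪e - u, w⟫| ≤ ‖e - u‖ * ‖w‖ := abs_real_inner_le_norm _ _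
      _ = δ * ‖w‖ := by rw [hδ, ← norm_neg (e - u), neg_sub]
  by_cases hc : δ * ‖w‖ ≤ |⟪e, w⟫|
  · have h1 : |⟪e, w⟫| - δ * ‖w‖ ≤ |⟪u, w⟫| := by linarith
    have h2 : (|⟪e, w⟫| - δ * ‖w‖) ^ 2 ≤ |⟪u, w⟫| ^ 2 := pow_le_pow_left₀ (by linarith) h1 2
    rw [sq_abs] at h2
    nlinarith [sq_abs ⟪e, w⟫, mul_nonneg hδ0 (norm_nonneg w)]
  · push Not at hc
    have h1 : ⟪e, w⟫ ^ 2 < (δ * ‖w‖) ^ 2 := by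
      rw [← sq_abs ⟪e, w⟫]; exact pow_lt_pow_left₀ hc (abs_nonneg _) two_ne_zero
    have hu1 : ‖u‖ = 1 := by rw [hu]; exact norm_smul_inv_norm hz
    have hδ2 : δ ≤ 2 := by
      calc δ = ‖u - e‖ := rfl
        _ ≤ ‖u‖ + ‖e‖ := norm_sub_le _ _
        _ = 2 := by rw [hu1, he]; norm_num
    have h3 : δ * δ ≤ δ * 2 := mul_le_mul_of_nonneg_left hδ2 hδ0
    have h4 : δ ^ 2 * ‖w‖ ^ 2 ≤ 2 * δ * ‖w‖ ^ 2 := by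
      rw [sq]; nlinarith [sq_nonneg ‖w‖]
    have h5 : (δ * ‖w‖) ^ 2 = δ ^ 2 * ‖w‖ ^ 2 := by ring
    nlinarith [sq_nonneg ⟪u, w⟫]

/-- The standard unit vectors. [folklore] -/
theorem norm_single_one (k : Fin 3) : ‖(EuclideanSpace.single k (1 : ℝ) : ℝ³)‖ = 1 := by
  simp

/-- `∑ₖ ⟨eₖ, w⟩² = |w|²`. [folklore] -/
theorem sum_inner_single_sq (w : ℝ³) :
    ∑ k : Fin 3, ⟪(EuclideanSpace.single k (1 : ℝ) : ℝ³), w⟫ ^ 2 = ‖w‖ ^ 2 := by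
  rw [EuclideanSpace.real_norm_sq_eq]
  refine Finset.sum_congr rfl fun k _ => ?_
  rw [EuclideanSpace.inner_single_left]
  simp

/-- The shifted centres `cₖ = x₀ - D eₖ`. [folklore] -/
def centre (x₀ : ℝ³) (D : ℝ) (k : Fin 3) : ℝ³ := x₀ - D • EuclideanSpace.single k (1 : ℝ)

/-- For `x ∈ B(x₀, r)` and `cₖ = x₀ - D eₖ` with `D > 0`: the direction perturbation is
`≤ 2r/D`. [folklore] -/
theorem norm_normalize_centre_le {x₀ x : ℝ³} {r D : ℝ} (hD : 0 < D) (hx : x ∈ Metric.ball x₀ r)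
    (k : Fin 3) :
    ‖(‖x - centre x₀ D k‖⁻¹) • (x - centre x₀ D k) - EuclideanSpace.single k (1 : ℝ)‖ ≤
      2 * r / D := by
  have h := norm_normalize_sub_le (z := x - centre x₀ D k) (norm_single_one k) hD
  refine h.trans ?_
  have e : x - centre x₀ D k - D • EuclideanSpace.single k (1 : ℝ) = x - x₀ := by
    unfold centre; abel
  rw [e]
  rw [Metric.mem_ball, dist_eq_norm] at hx
  gcongr

/-- `x ∈ B(x₀, r)` lies in `B(cₖ, r + D)` (so in `B(cₖ, 9r)` for `D = 8r`). [folklore] -/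
theorem mem_ball_centre {x₀ x : ℝ³} {r D : ℝ} (hD : 0 ≤ D) (hx : x ∈ Metric.ball x₀ r) (k : Fin 3) :
    x ∈ Metric.ball (centre x₀ D k) (r + D) := by
  rw [Metric.mem_ball, dist_eq_norm] at hx ⊢
  unfold centre
  calc ‖x - (x₀ - D • EuclideanSpace.single k (1 : ℝ))‖
      = ‖(x - x₀) + D • EuclideanSpace.single k (1 : ℝ)‖ := by congr 1; abel
    _ ≤ ‖x - x₀‖ + ‖D • EuclideanSpace.single k (1 : ℝ)‖ := norm_add_le _ _
    _ < r + D := by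
        rw [norm_smul, norm_single_one, mul_one, Real.norm_of_nonneg hD]
        linarith

/-- **Tangential parts from three centres control the full energy**: with `cₖ = x₀ - 8r eₖ`
and `x ∈ B(x₀, r)`,
`(5/16)|w|² ≤ ∑ₖ (|w|² - ⟨x - cₖ, w⟩²/|x - cₖ|²)`. [folklore] -/
theorem sum_tan_ge {x₀ x : ℝ³} {r : ℝ} (hr : 0 < r) (hx : x ∈ Metric.ball x₀ r) (w : ℝ³) :
    5 / 16 * ‖w‖ ^ 2 ≤
      ∑ k : Fin 3, (‖w‖ ^ 2 - ⟪x - centre x₀ (8 * r) k, w⟫ ^ 2 / ‖x - centre x₀ (8 * r) k‖ ^ 2) := by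
  have hD : 0 < 8 * r := by positivity
  have hk : ∀ k : Fin 3, ⟪x - centre x₀ (8 * r) k, w⟫ ^ 2 / ‖x - centre x₀ (8 * r) k‖ ^ 2 ≤
      ⟪(EuclideanSpace.single k (1 : ℝ) : ℝ³), w⟫ ^ 2 + 9 / 16 * ‖w‖ ^ 2 := by
    intro k
    have h1 := inner_sq_div_le (z := x - centre x₀ (8 * r) k) (norm_single_one k) w
    have hδ := norm_normalize_centre_le hD hx k
    have hδ' : 2 * r / (8 * r) = 1 / 4 := by field_simp; ring
    rw [hδ'] at hδ
    set δ := ‖(‖x - centre x₀ (8 * r) k‖⁻¹) • (x - centre x₀ (8 * r) k) -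
      EuclideanSpace.single k (1 : ℝ)‖
    have hδ0 : 0 ≤ δ := norm_nonneg _
    have h2 : (2 * δ + δ ^ 2) * ‖w‖ ^ 2 ≤ 9 / 16 * ‖w‖ ^ 2 := by
      refine mul_le_mul_of_nonneg_right ?_ (by positivity)
      nlinarith
    linarith
  have hsum := Finset.sum_le_sum fun k (_ : k ∈ Finset.univ) => hk k
  rw [Finset.sum_add_distrib, sum_inner_single_sq, Finset.sum_const, Finset.card_univ,
    Fintype.card_fin] at hsum
  simp only [nsmul_eq_mul, Nat.cast_ofNat] at hsum
  rw [Finset.sum_sub_distrib, Finset.sum_const, Finset.card_univ, Fintype.card_fin]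
  simp only [nsmul_eq_mul, Nat.cast_ofNat]
  linarith

/-- **Radial parts from three centres control the full energy**: with `cₖ = x₀ - 16r eₖ`
and `x ∈ B(x₀, r)`, `|w|²/4 ≤ ∑ₖ ⟨x - cₖ, w⟩²/|x - cₖ|²`. [folklore] -/
theorem sum_rad_ge {x₀ x : ℝ³} {r : ℝ} (hr : 0 < r) (hx : x ∈ Metric.ball x₀ r) (w : ℝ³) :
    ‖w‖ ^ 2 / 4 ≤
      ∑ k : Fin 3, ⟪x - centre x₀ (16 * r) k, w⟫ ^ 2 / ‖x - centre x₀ (16 * r) k‖ ^ 2 := by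
  have hD : 0 < 16 * r := by positivity
  have hk : ∀ k : Fin 3, ⟪(EuclideanSpace.single k (1 : ℝ) : ℝ³), w⟫ ^ 2 - 1 / 4 * ‖w‖ ^ 2 ≤
      ⟪x - centre x₀ (16 * r) k, w⟫ ^ 2 / ‖x - centre x₀ (16 * r) k‖ ^ 2 := by
    intro k
    have hz : x - centre x₀ (16 * r) k ≠ 0 := by
      intro h0
      have hmem := mem_ball_centre hD.le hx k
      rw [Metric.mem_ball, dist_eq_norm, h0, norm_zero] at hmem
      -- `‖x - c_k‖ ≥ 16 r - r > 0`
      have : (15 : ℝ) * r ≤ ‖x - centre x₀ (16 * r) k‖ := by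
        rw [Metric.mem_ball, dist_eq_norm] at hx
        have e : x - centre x₀ (16 * r) k = (16 * r) • EuclideanSpace.single k (1 : ℝ) + (x - x₀) := by
          unfold centre; abel
        rw [e]
        have := norm_sub_norm_le ((16 * r) • EuclideanSpace.single k (1 : ℝ)) (-(x - x₀))
        rw [sub_neg_eq_add, norm_neg, norm_smul, norm_single_one, mul_one,
          Real.norm_of_nonneg hD.le] at this
        linarith
      rw [h0, norm_zero] at this
      linarith
    have h1 := inner_sq_div_ge (z := x - centre x₀ (16 * r) k) (norm_single_one k) hz w
    have hδ := norm_normalize_centre_le hD hx k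
    have hδ' : 2 * r / (16 * r) = 1 / 8 := by field_simp; ring
    rw [hδ'] at hδ
    set δ := ‖(‖x - centre x₀ (16 * r) k‖⁻¹) • (x - centre x₀ (16 * r) k) -
      EuclideanSpace.single k (1 : ℝ)‖
    have h2 : 2 * δ * ‖w‖ ^ 2 ≤ 1 / 4 * ‖w‖ ^ 2 := by
      refine mul_le_mul_of_nonneg_right ?_ (by positivity)
      linarith
    linarith
  have hsum := Finset.sum_le_sum fun k (_ : k ∈ Finset.univ) => hk k
  rw [Finset.sum_sub_distrib, sum_inner_single_sq, Finset.sum_const, Finset.card_univ,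
    Fintype.card_fin] at hsum
  simp only [nsmul_eq_mul, Nat.cast_ofNat] at hsum
  linarith

/-! ### From tangential / radial bounds at shifted centres to the full local energy -/

variable {v : ℝ³ → ℝ³}

/-- The tangential density of the translated field is the tangential part seen from the centre.
[folklore] -/
theorem tanE_translate (v : ℝ³ → ℝ³) (c x : ℝ³) :
    tanE (fun y => v (y + c)) (x - c) = ‖v x‖ ^ 2 - ⟪x - c, v x⟫ ^ 2 / ‖x - c‖ ^ 2 := by
  simp [tanE, radE, sub_add_cancel]

/-- Auxiliary lemma `radE_translate`. [folklore] -/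
theorem radE_translate (v : ℝ³ → ℝ³) (c x : ℝ³) :
    radE (fun y => v (y + c)) (x - c) = ⟪x - c, v x⟫ ^ 2 / ‖x - c‖ ^ 2 := by
  simp [radE, sub_add_cancel]

/-- **Full energy from tangential bounds at three centres**: if
`∫_{B(0, 9r)} |(v(· + cₖ))_tan|² ≤ M` for the three centres `cₖ = x₀ - 8r eₖ`, then
`∫_{B(x₀, r)} |v|² ≤ (48/5) M`. [folklore] -/
theorem energy_ball_le_of_tan (hv : Continuous v) (hv2 : Integrable (fun y => ‖v y‖ ^ 2))
    (x₀ : ℝ³) {r M : ℝ} (hr : 0 < r)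
    (htan : ∀ k : Fin 3,
      ∫ y in Metric.ball (0 : ℝ³) (9 * r), tanE (fun y => v (y + centre x₀ (8 * r) k)) y ≤ M) :
    ∫ x in Metric.ball x₀ r, ‖v x‖ ^ 2 ≤ 48 / 5 * M := by
  set c : Fin 3 → ℝ³ := centre x₀ (8 * r) with hc
  set T : Fin 3 → ℝ³ → ℝ := fun k x => ‖v x‖ ^ 2 - ⟪x - c k, v x⟫ ^ 2 / ‖x - c k‖ ^ 2 with hT
  -- each `T k` is the translated tangential density, nonnegative, bounded by `|v|²`
  have hTeq : ∀ k x, T k x = tanE (fun y => v (y + c k)) (x - c k) := fun k x =>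
    (tanE_translate v (c k) x).symm
  have hT0 : ∀ k x, 0 ≤ T k x := fun k x => by rw [hTeq]; exact tanE_nonneg _ _
  have hTle : ∀ k x, T k x ≤ ‖v x‖ ^ 2 := fun k x => by
    rw [hTeq]
    have := tanE_le (fun y => v (y + c k)) (x - c k)
    simpa [sub_add_cancel] using this
  have hTm : ∀ k, AEStronglyMeasurable (T k) volume := fun k => by
    have hm : Measurable (T k) :=
      (hv.norm.pow 2).measurable.sub ((((continuous_id.sub continuous_const).inner hv).pow 2).measurable.div
        ((continuous_id.sub continuous_const).norm.pow 2).measurable)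
    exact hm.aestronglyMeasurable
  have hTint : ∀ k, Integrable (T k) := fun k =>
    integrable_of_abs_le_mul_norm_sq (C := 1) hv2 (hTm k) fun x => by
      rw [abs_of_nonneg (hT0 k x), one_mul]; exact hTle k x
  -- `∫_{B(x₀,r)} T k ≤ ∫_{B(c k, 9r)} T k = ∫_{B(0,9r)} tanE(v(·+c k)) ≤ M`
  have hTball : ∀ k, ∫ x in Metric.ball x₀ r, T k x ≤ M := by
    intro k
    calc ∫ x in Metric.ball x₀ r, T k x ≤ ∫ x in Metric.ball (c k) (9 * r), T k x := by
          refine setIntegral_mono_set (hTint k).integrableOn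
            (Eventually.of_forall fun x => hT0 k x) (Eventually.of_forall fun x hx => ?_)
          have := mem_ball_centre (by positivity : (0:ℝ) ≤ 8 * r) hx k
          rwa [show r + 8 * r = 9 * r by ring] at this
      _ = ∫ y in Metric.ball (0 : ℝ³) (9 * r), tanE (fun y => v (y + c k)) y := by
          rw [← setIntegral_ball_comp_add (T k) (c k) (9 * r)]
          refine setIntegral_congr_fun measurableSet_ball fun y _ => ?_
          rw [hTeq k (y + c k), add_sub_cancel_right]
      _ ≤ M := htan k
  -- pointwise recombination and integration
  have hpt : ∀ x ∈ Metric.ball x₀ r, 5 / 16 * ‖v x‖ ^ 2 ≤ ∑ k : Fin 3, T k x := fun x hx =>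
    sum_tan_ge hr hx (v x)
  have hsumInt : Integrable (fun x => ∑ k : Fin 3, T k x) :=
    integrable_finsetSum _ fun k _ => hTint k
  have h1 : ∫ x in Metric.ball x₀ r, 5 / 16 * ‖v x‖ ^ 2 ≤ ∫ x in Metric.ball x₀ r, ∑ k : Fin 3, T k x :=
    setIntegral_mono_on (hv2.const_mul _).integrableOn hsumInt.integrableOn measurableSet_ball hpt
  rw [integral_const_mul, integral_finsetSum _ (fun k _ => (hTint k).integrableOn)] at h1
  have h2 : ∑ k : Fin 3, ∫ x in Metric.ball x₀ r, T k x ≤ 3 * M := by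
    calc ∑ k : Fin 3, ∫ x in Metric.ball x₀ r, T k x ≤ ∑ _k : Fin 3, M :=
          Finset.sum_le_sum fun k _ => hTball k
      _ = 3 * M := by simp
  linarith

/-- **Full energy from radial bounds at three centres**: if
`∫_{B(0, 17r)} ⟨ŷ, v(· + cₖ)⟩² ≤ M` for the three centres `cₖ = x₀ - 16r eₖ`, then
`∫_{B(x₀, r)} |v|² ≤ 12 M`. [folklore] -/
theorem energy_ball_le_of_rad (hv : Continuous v) (hv2 : Integrable (fun y => ‖v y‖ ^ 2))
    (x₀ : ℝ³) {r M : ℝ} (hr : 0 < r)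
    (hrad : ∀ k : Fin 3,
      ∫ y in Metric.ball (0 : ℝ³) (17 * r), radE (fun y => v (y + centre x₀ (16 * r) k)) y ≤ M) :
    ∫ x in Metric.ball x₀ r, ‖v x‖ ^ 2 ≤ 12 * M := by
  set c : Fin 3 → ℝ³ := centre x₀ (16 * r) with hc
  set T : Fin 3 → ℝ³ → ℝ := fun k x => ⟪x - c k, v x⟫ ^ 2 / ‖x - c k‖ ^ 2 with hT
  have hTeq : ∀ k x, T k x = radE (fun y => v (y + c k)) (x - c k) := fun k x =>
    (radE_translate v (c k) x).symm
  have hT0 : ∀ k x, 0 ≤ T k x := fun k x => by rw [hTeq]; exact radE_nonneg _ _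
  have hTle : ∀ k x, T k x ≤ ‖v x‖ ^ 2 := fun k x => by
    rw [hTeq]
    have := radE_le (fun y => v (y + c k)) (x - c k)
    simpa [sub_add_cancel] using this
  have hTm : ∀ k, AEStronglyMeasurable (T k) volume := fun k => by
    have hm : Measurable (T k) :=
      ((((continuous_id.sub continuous_const).inner hv).pow 2).measurable.div
        ((continuous_id.sub continuous_const).norm.pow 2).measurable)
    exact hm.aestronglyMeasurable
  have hTint : ∀ k, Integrable (T k) := fun k =>
    integrable_of_abs_le_mul_norm_sq (C := 1) hv2 (hTm k) fun x => by
      rw [abs_of_nonneg (hT0 k x), one_mul]; exact hTle k x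
  have hTball : ∀ k, ∫ x in Metric.ball x₀ r, T k x ≤ M := by
    intro k
    calc ∫ x in Metric.ball x₀ r, T k x ≤ ∫ x in Metric.ball (c k) (17 * r), T k x := by
          refine setIntegral_mono_set (hTint k).integrableOn
            (Eventually.of_forall fun x => hT0 k x) (Eventually.of_forall fun x hx => ?_)
          have := mem_ball_centre (by positivity : (0:ℝ) ≤ 16 * r) hx k
          rwa [show r + 16 * r = 17 * r by ring] at this
      _ = ∫ y in Metric.ball (0 : ℝ³) (17 * r), radE (fun y => v (y + c k)) y := by
          rw [← setIntegral_ball_comp_add (T k) (c k) (17 * r)]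
          refine setIntegral_congr_fun measurableSet_ball fun y _ => ?_
          rw [hTeq k (y + c k), add_sub_cancel_right]
      _ ≤ M := hrad k
  have hpt : ∀ x ∈ Metric.ball x₀ r, ‖v x‖ ^ 2 / 4 ≤ ∑ k : Fin 3, T k x := fun x hx =>
    sum_rad_ge hr hx (v x)
  have hsumInt : Integrable (fun x => ∑ k : Fin 3, T k x) :=
    integrable_finsetSum _ fun k _ => hTint k
  have h1 : ∫ x in Metric.ball x₀ r, ‖v x‖ ^ 2 / 4 ≤ ∫ x in Metric.ball x₀ r, ∑ k : Fin 3, T k x :=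
    setIntegral_mono_on (hv2.div_const _).integrableOn hsumInt.integrableOn measurableSet_ball hpt
  rw [integral_div, integral_finsetSum _ (fun k _ => (hTint k).integrableOn)] at h1
  have h2 : ∑ k : Fin 3, ∫ x in Metric.ball x₀ r, T k x ≤ 3 * M := by
    calc ∑ k : Fin 3, ∫ x in Metric.ball x₀ r, T k x ≤ ∑ _k : Fin 3, M :=
          Finset.sum_le_sum fun k _ => hTball k
      _ = 3 * M := by simp
  linarith

/-! ### The local energy bound at every centre and every small scale -/

variable {π : ℝ³ → ℝ} {A B K : ℝ}

/-- **Local energy bound, pressure case.** Under `SliceHyp v π A B` and `π ≥ -K` (`K ≥ 0`):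
for every centre `x₀`, every `ℓ > 0` and every radius `0 < r ≤ ℓ/9`,
`∫_{B(x₀, r)} |v|² ≤ (48/5)·2√2·9 · r · (K (17/2) vB ℓ² + ℓ⁻¹ ∫|v|²)`. [folklore] -/
theorem energy_ball_le_pressure (h : SliceHyp v π A B) (hK0 : 0 ≤ K)
    (hK : ∀ y, -K ≤ π y) {ℓ r : ℝ} (hℓ : 0 < ℓ) (hr : 0 < r) (hrℓ : 9 * r ≤ ℓ) (x₀ : ℝ³) :
    ∫ x in Metric.ball x₀ r, ‖v x‖ ^ 2 ≤
      48 / 5 * (2 * Real.sqrt 2 * (9 * r) * (K * (17 / 2 * vB * ℓ ^ 2) + (1 / ℓ) * ∫ y, ‖v y‖ ^ 2)) := by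
  refine energy_ball_le_of_tan h.cont h.energy x₀ hr fun k => ?_
  have hk := h.translate (centre x₀ (8 * r) k)
  have hb := tan_energy_ball_le hk hK0 (fun y => hK _) hℓ (by positivity : 0 < 9 * r) hrℓ
  rwa [integral_norm_sq_comp_add] at hb

/-- **Local energy bound, head-pressure case.** Under `SliceHyp v π A B` and
`|v|²/2 + π ≤ K` (`K ≥ 0`): for every centre `x₀`, every `ℓ > 0` and `0 < r ≤ ℓ/17`,
`∫_{B(x₀, r)} |v|² ≤ 12·4√2·17 · r · (K (17/2) vB ℓ² + (2ℓ)⁻¹ ∫|v|²)`. [folklore] -/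
theorem energy_ball_le_head (h : SliceHyp v π A B) (hK0 : 0 ≤ K)
    (hK : ∀ y, ‖v y‖ ^ 2 / 2 + π y ≤ K) {ℓ r : ℝ} (hℓ : 0 < ℓ) (hr : 0 < r) (hrℓ : 17 * r ≤ ℓ)
    (x₀ : ℝ³) :
    ∫ x in Metric.ball x₀ r, ‖v x‖ ^ 2 ≤
      12 * (4 * Real.sqrt 2 * (17 * r) *
        (K * (17 / 2 * vB * ℓ ^ 2) + (1 / (2 * ℓ)) * ∫ y, ‖v y‖ ^ 2)) := by
  refine energy_ball_le_of_rad h.cont h.energy x₀ hr fun k => ?_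
  have hk := h.translate (centre x₀ (16 * r) k)
  have hb := rad_energy_ball_le hk hK0 (fun y => hK _) hℓ (by positivity : 0 < 17 * r) hrℓ
  rwa [integral_norm_sq_comp_add] at hb

end Centres


/-! ## Instantiation: the slices of a classical Leray–Hopf solution -/

section Instantiate

open InnerProductSpace
open scoped RealInnerProductSpace Laplacian ENNReal

/-- Local notation for physical space `ℝ³ = EuclideanSpace ℝ (Fin 3)`. -/
local notation "ℝ³" => EuclideanSpace ℝ (Fin 3)

/-! ### Linear growth of `∫_{B(c,R)} |π|` for `π ∈ L^{3/2}` -/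

/-- Young's inequality in the form `a ≤ (2R/3) a√a + 1/(3R²)` (`a ≥ 0`, `R > 0`). [folklore] -/
theorem young_threeHalves {a R : ℝ} (ha : 0 ≤ a) (hR : 0 < R) :
    a ≤ 2 * R / 3 * (a * Real.sqrt a) + 1 / (3 * R ^ 2) := by
  set b := Real.sqrt a with hb
  have hb0 : 0 ≤ b := Real.sqrt_nonneg a
  have hab : a = b ^ 2 := (Real.sq_sqrt ha).symm
  rw [hab]
  have key : 0 ≤ (R * b - 1) ^ 2 * (2 * R * b + 1) := by positivity
  have h3 : 3 * R ^ 2 * b ^ 2 ≤ 2 * R ^ 3 * b ^ 3 + 1 := by nlinarith [key]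
  have hR2 : 0 < 3 * R ^ 2 := by positivity
  calc b ^ 2 = 3 * R ^ 2 * b ^ 2 / (3 * R ^ 2) := by field_simp
    _ ≤ (2 * R ^ 3 * b ^ 3 + 1) / (3 * R ^ 2) := by gcongr
    _ = 2 * R / 3 * (b ^ 2 * b) + 1 / (3 * R ^ 2) := by field_simp

/-- `‖r‖ₑ^{3/2} = ofReal (|r| √|r|)`. [folklore] -/
theorem enorm_rpow_threeHalves_eq (r : ℝ) :
    ‖r‖ₑ ^ (3 / 2 : ℝ) = ENNReal.ofReal (|r| * Real.sqrt |r|) := by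
  rw [Real.enorm_eq_ofReal_abs, ENNReal.ofReal_rpow_of_nonneg (abs_nonneg r) (by norm_num)]
  congr 1
  rw [show (3 / 2 : ℝ) = 1 + 1 / 2 by norm_num, Real.rpow_add' (abs_nonneg r) (by norm_num),
    Real.rpow_one, Real.sqrt_eq_rpow]

/-- **Linear growth of ball integrals for `π ∈ L^{3/2}`**: if `π` is continuous with
`∫ |π|^{3/2} < ⊤` then `∫_{B̄(c, R)} |π| ≤ A R` for all centres `c` and radii `R > 0`
(Young: `|π| ≤ (2R/3)|π|^{3/2} + 1/(3R²)`). [folklore] -/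
theorem exists_growth_of_lintegral_lt_top {π : ℝ³ → ℝ} (hc : Continuous π)
    (hfin : ∫⁻ x, ‖π x‖ₑ ^ (3 / 2 : ℝ) < ⊤) :
    ∃ A : ℝ, ∀ (c : ℝ³) (R : ℝ), 0 < R → ∫ y in Metric.closedBall c R, |π y| ≤ A * R + 0 := by
  set I : ℝ := (∫⁻ x, ‖π x‖ₑ ^ (3 / 2 : ℝ)).toReal with hI
  have hI0 : 0 ≤ I := ENNReal.toReal_nonneg
  refine ⟨2 / 3 * I + vB / 3, fun c R hR => ?_⟩
  set g : ℝ³ → ℝ := fun y => |π y| * Real.sqrt |π y| with hg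
  have hgc : Continuous g := (continuous_abs.comp hc).mul (Real.continuous_sqrt.comp (continuous_abs.comp hc))
  have hg0 : ∀ y, 0 ≤ g y := fun y => by positivity
  have hK : IsCompact (Metric.closedBall c R) := isCompact_closedBall c R
  have I1 : IntegrableOn (fun y => |π y|) (Metric.closedBall c R) :=
    (continuous_abs.comp hc).continuousOn.integrableOn_compact hK
  have I2 : IntegrableOn g (Metric.closedBall c R) := hgc.continuousOn.integrableOn_compact hK
  have I3 : IntegrableOn (fun _ : ℝ³ => 1 / (3 * R ^ 2)) (Metric.closedBall c R) :=
    integrableOn_const (hK.measure_lt_top).ne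
  -- `∫_{B̄} g ≤ I`
  have hgI : ∫ y in Metric.closedBall c R, g y ≤ I := by
    rw [integral_eq_lintegral_of_nonneg_ae (Eventually.of_forall hg0) hgc.aestronglyMeasurable.restrict,
      hI]
    refine ENNReal.toReal_mono hfin.ne ?_
    calc ∫⁻ y in Metric.closedBall c R, ENNReal.ofReal (g y)
        ≤ ∫⁻ y, ENNReal.ofReal (g y) := lintegral_mono' Measure.restrict_le_self le_rfl
      _ = ∫⁻ y, ‖π y‖ₑ ^ (3 / 2 : ℝ) := lintegral_congr fun y => (enorm_rpow_threeHalves_eq (π y)).symm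
  have hvol : (volume : Measure ℝ³).real (Metric.closedBall c R) = R ^ 3 * vB := by
    unfold vB
    rw [Measure.addHaar_real_closedBall volume c hR.le, finrank_euclideanSpace_fin]
  have I4 : IntegrableOn (fun y => 2 * R / 3 * g y + 1 / (3 * R ^ 2)) (Metric.closedBall c R) :=
    (I2.const_mul _).add I3
  calc ∫ y in Metric.closedBall c R, |π y|
      ≤ ∫ y in Metric.closedBall c R, (2 * R / 3 * g y + 1 / (3 * R ^ 2)) :=
        setIntegral_mono I1 I4 fun y => young_threeHalves (abs_nonneg _) hR
    _ = 2 * R / 3 * (∫ y in Metric.closedBall c R, g y) +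
          (volume : Measure ℝ³).real (Metric.closedBall c R) * (1 / (3 * R ^ 2)) := by
        rw [integral_add (I2.const_mul _) I3, integral_const_mul, setIntegral_const, smul_eq_mul]
    _ ≤ 2 * R / 3 * I + R ^ 3 * vB * (1 / (3 * R ^ 2)) := by rw [hvol]; gcongr
    _ = (2 / 3 * I + vB / 3) * R + 0 := by field_simp; ring

/-! ### Slices of the classical Leray–Hopf solution -/

variable {ν T : ℝ} {u : ℝ → ℝ³ → ℝ³} {p : ℝ → ℝ³ → ℝ}

/-- **`u(t) ∈ L³` for a.e. `t ∈ (0, T)`** (Tonelli on the slab bound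
`∫∫_{(0,T)×ℝ³} |u|³ < ⊤`). [folklore] -/
theorem ae_lintegral_cube_lt_top (hν : 0 < ν)
    (hsol : IsClassicalNSSolutionOn (Ico 0 T) ν 0 u p) (hLH : IsLerayHopfOn T ν 0 (u 0) u) :
    ∀ᵐ t ∂(volume.restrict (Ioo 0 T)), ∫⁻ x, ‖u t x‖ₑ ^ (3 : ℕ) < ⊤ := by
  have hslab := lintegral_slab_enorm_pow_three_lt_top hν hLH
  set F : ℝ × ℝ³ → ENNReal := fun z => ‖u z.1 z.2‖ₑ ^ (3 : ℕ) with hF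
  have hcont : ContinuousOn (Function.uncurry u) (Ioo 0 T ×ˢ (univ : Set ℝ³)) :=
    (continuousOn_uncurry hsol).mono (prod_mono Ioo_subset_Ico_self Subset.rfl)
  have hFm : AEMeasurable F ((volume : Measure (ℝ × ℝ³)).restrict (Ioo 0 T ×ˢ (univ : Set ℝ³))) :=
    ((hcont.aemeasurable (measurableSet_Ioo.prod MeasurableSet.univ)).enorm.pow_const 3)
  rw [← restrict_prod_univ_eq (Ioo 0 T)] at hFm hslab
  have hprod := lintegral_prod F hFm
  rw [hprod] at hslab
  have := ae_lt_top' hFm.lintegral_prod_right' hslab.ne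
  simpa [hF] using this

/-- **The slice hypotheses hold for a.e. `t ∈ (0, T)`** for a classical solution on `[0, T)`
which is Leray–Hopf on `[0, T)`: velocity slice continuous with finite energy, normalised
pressure continuous (`= p(t) − c(t)`, Tao's gauge) with `L^{3/2}` growth, and the pressure
Poisson identity against every test function. [folklore] -/
theorem ae_sliceHyp (hν : 0 < ν) (hT : 0 < T)
    (hsol : IsClassicalNSSolutionOn (Ico 0 T) ν 0 u p) (hLH : IsLerayHopfOn T ν 0 (u 0) u) :
    ∀ᵐ t ∂(volume.restrict (Ioo 0 T)), ∃ A : ℝ, SliceHyp (u t) (normalisedPressure (u t)) A 0 := by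
  -- the gauge and the distributional slab identity
  obtain ⟨hgauge, -⟩ := exists_pressure_gauge_of_classical hν hT hsol hLH
  set q : ℝ → ℝ³ → ℝ := fun t x => p t x - (p t 0 - normalisedPressure (u t) 0) with hq
  set Q : TopologicalSpace.Opens (ℝ × ℝ³) :=
    ⟨Ioo 0 T ×ˢ ((⊤ : TopologicalSpace.Opens ℝ³) : Set ℝ³),
      isOpen_Ioo.prod (⊤ : TopologicalSpace.Opens ℝ³).isOpen⟩ with hQ
  have hQsub : (Q : Set (ℝ × ℝ³)) ⊆ Ioo 0 T ×ˢ univ := by simp [hQ]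
  have hsw := isSuitableWeakSolutionOn_gauge_of_classical hν hT hsol hLH Q hQsub
  have hns : IsDistributionalNSSolutionOn Q ν 0 u q := hsw.distributional
  have hf : LocallyIntegrableOn (Function.uncurry (0 : ℝ → ℝ³ → ℝ³))
      (Ioo 0 T ×ˢ ((⊤ : TopologicalSpace.Opens ℝ³) : Set ℝ³)) volume :=
    locallyIntegrableOn_const (0 : ℝ³)
  have hdivf : ∀ φ : ℝ → ℝ³ → ℝ, IsSpaceTimeTestOn Q φ →
      ∫ z in Ioo 0 T ×ˢ ((⊤ : TopologicalSpace.Opens ℝ³) : Set ℝ³),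
        ⟪(0 : ℝ → ℝ³ → ℝ³) z.1 z.2, gradient (φ z.1) z.2⟫ = 0 := fun φ _ => by simp
  have hslice := hns.ae_forall_slice_pressure_identity hf hdivf
  have hcube := ae_lintegral_cube_lt_top hν hsol hLH
  filter_upwards [hgauge, hslice, hcube, ae_restrict_mem measurableSet_Ioo] with t hg hsl hcu ht
  have htI : t ∈ Ico 0 T := ⟨ht.1.le, ht.2⟩
  have htc : t ∈ Icc 0 T := ⟨ht.1.le, ht.2.le⟩
  have hucont : Continuous (u t) := (hsol.contDiff_velocity htI).continuous
  have hpcont : Continuous (p t) := (hsol.contDiff_pressure htI).continuous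
  have hL2 : Integrable (fun x => ‖u t x‖ ^ 2) := (hLH.memLp t htc).integrable_norm_pow two_ne_zero
  -- the normalised pressure is the gauged classical pressure
  have hpn : normalisedPressure (u t) = fun x => p t x - (p t 0 - normalisedPressure (u t) 0) :=
    funext fun x => (hg x).symm
  have hπcont : Continuous (normalisedPressure (u t)) := by
    rw [hpn]; exact hpcont.sub continuous_const
  -- `L^{3/2}` and growth
  have hfin : ∫⁻ x, ‖normalisedPressure (u t) x‖ₑ ^ (3 / 2 : ℝ) < ⊤ := by
    refine lt_of_le_of_lt (lintegral_normalisedPressure_rpow_le (hsol.contDiff_velocity htI) hL2) ?_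
    exact ENNReal.mul_lt_top (ENNReal.rpow_lt_top_of_nonneg (by norm_num) ENNReal.coe_ne_top) hcu
  obtain ⟨A, hA⟩ := exists_growth_of_lintegral_lt_top hπcont hfin
  refine ⟨A, ⟨hucont, hL2, hπcont, hA, fun θ hθ => ?_⟩⟩
  -- the identity, through the gauged pressure `q t = p̃(t)`
  have h1 := hsl hucont.aestronglyMeasurable ((hucont.norm.pow 2).locallyIntegrable.locallyIntegrableOn _)
    ((hpcont.sub continuous_const).locallyIntegrable.locallyIntegrableOn _) θ hθ
  have hqt : (fun x => q t x) = normalisedPressure (u t) := by rw [hpn]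
  simpa [hq] using (hqt ▸ h1 : _)

/-- **The local energy bound for a.e. slice.** For a classical solution on `[0, T)` which is
Leray–Hopf on `[0, T)` and satisfies a one-sided bound on the Bernoulli head or on the normalised
pressure on `(0, T) × ℝ³`, there is `M` with
`∫_{B(x₀, r)} |u(t)|² ≤ M r` for a.e. `t ∈ (0, T)`, every centre `x₀` and every `0 < r ≤ 1/17`
(Type I in the `A`-sense, uniformly up to the final time). [folklore] -/
theorem ae_energy_ball_le (hν : 0 < ν) (hT : 0 < T)
    (hsol : IsClassicalNSSolutionOn (Ico 0 T) ν 0 u p) (hLH : IsLerayHopfOn T ν 0 (u 0) u)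
    (hone : (∃ K : ℝ, ∀ t ∈ Ioo 0 T, ∀ x, ‖u t x‖ ^ 2 / 2 + normalisedPressure (u t) x ≤ K) ∨
      (∃ K : ℝ, ∀ t ∈ Ioo 0 T, ∀ x, -K ≤ normalisedPressure (u t) x)) :
    ∃ M : ℝ, ∀ᵐ t ∂(volume.restrict (Ioo 0 T)), ∀ (x₀ : ℝ³) (r : ℝ), 0 < r → 17 * r ≤ 1 →
      ∫ x in Metric.ball x₀ r, ‖u t x‖ ^ 2 ≤ M * r := by
  -- the energy bound `∫ |u(t)|² ≤ 2 E(u₀)`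
  set Ebar : ℝ := 2 * VectorCalculus.kineticEnergy (u 0) with hEbar
  have hEt : ∀ t ∈ Icc 0 T, ∫ x, ‖u t x‖ ^ 2 ≤ Ebar := by
    intro t ht
    have h1 := eEnergy_le hν.le hLH ht
    rw [eEnergy_eq_ofReal _ (hLH.memLp t ht)] at h1
    have h2 : 2 * VectorCalculus.kineticEnergy (u t) ≤ Ebar :=
      (ENNReal.ofReal_le_ofReal_iff (by have := kineticEnergy_nonneg (u 0); positivity)).1 h1
    have h3 : ∫ x, ‖u t x‖ ^ 2 = 2 * VectorCalculus.kineticEnergy (u t) := by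
      simp [VectorCalculus.kineticEnergy]
    linarith
  have hE0 : 0 ≤ Ebar := by have := kineticEnergy_nonneg (u 0); positivity
  have hae := ae_sliceHyp hν hT hsol hLH
  rcases hone with ⟨K, hK⟩ | ⟨K, hK⟩
  · -- head-pressure case
    set K' : ℝ := max K 0 with hK'
    have hK'0 : 0 ≤ K' := le_max_right _ _
    refine ⟨12 * (4 * Real.sqrt 2 * 17 * (K' * (17 / 2 * vB * 1 ^ 2) + (1 / (2 * 1)) * Ebar)), ?_⟩
    filter_upwards [hae, ae_restrict_mem measurableSet_Ioo] with t ⟨A, hA⟩ ht x₀ r hr hr17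
    have hKt : ∀ y, ‖u t y‖ ^ 2 / 2 + normalisedPressure (u t) y ≤ K' := fun y =>
      (hK t ht y).trans (le_max_left _ _)
    have hb := energy_ball_le_head hA hK'0 hKt one_pos hr hr17 x₀
    have hEt' := hEt t ⟨ht.1.le, ht.2.le⟩
    have hvB := vB_pos
    calc ∫ x in Metric.ball x₀ r, ‖u t x‖ ^ 2
        ≤ 12 * (4 * Real.sqrt 2 * (17 * r) *
            (K' * (17 / 2 * vB * 1 ^ 2) + (1 / (2 * 1)) * ∫ y, ‖u t y‖ ^ 2)) := hb
      _ ≤ 12 * (4 * Real.sqrt 2 * (17 * r) * (K' * (17 / 2 * vB * 1 ^ 2) + (1 / (2 * 1)) * Ebar)) := by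
          gcongr
      _ = 12 * (4 * Real.sqrt 2 * 17 * (K' * (17 / 2 * vB * 1 ^ 2) + (1 / (2 * 1)) * Ebar)) * r := by
          ring
  · -- pressure case
    set K' : ℝ := max K 0 with hK'
    have hK'0 : 0 ≤ K' := le_max_right _ _
    refine ⟨48 / 5 * (2 * Real.sqrt 2 * 9 * (K' * (17 / 2 * vB * 1 ^ 2) + (1 / 1) * Ebar)), ?_⟩
    filter_upwards [hae, ae_restrict_mem measurableSet_Ioo] with t ⟨A, hA⟩ ht x₀ r hr hr17
    have hKt : ∀ y, -K' ≤ normalisedPressure (u t) y := fun y =>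
      le_trans (neg_le_neg (le_max_left _ _)) (hK t ht y)
    have hr9 : 9 * r ≤ 1 := by linarith
    have hb := energy_ball_le_pressure hA hK'0 hKt one_pos hr hr9 x₀
    have hEt' := hEt t ⟨ht.1.le, ht.2.le⟩
    have hvB := vB_pos
    calc ∫ x in Metric.ball x₀ r, ‖u t x‖ ^ 2
        ≤ 48 / 5 * (2 * Real.sqrt 2 * (9 * r) *
            (K' * (17 / 2 * vB * 1 ^ 2) + (1 / 1) * ∫ y, ‖u t y‖ ^ 2)) := hb
      _ ≤ 48 / 5 * (2 * Real.sqrt 2 * (9 * r) * (K' * (17 / 2 * vB * 1 ^ 2) + (1 / 1) * Ebar)) := by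
          gcongr
      _ = 48 / 5 * (2 * Real.sqrt 2 * 9 * (K' * (17 / 2 * vB * 1 ^ 2) + (1 / 1) * Ebar)) * r := by
          ring

end Instantiate

end SereginSverak2002

end Literature.Analysis.FluidPDE

end
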